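import Literature.NumberTheory.LFunctions.MoebiusWalshTypeIEstimate
import Literature.NumberTheory.LFunctions.MoebiusWalshGeomSums
import Literature.NumberTheory.LFunctions.MoebiusWalshTypeIITools
import Literature.Computability.Complexity.WalshDyadicFourier
import Literature.NumberTheory.Sieve.FejerKernelCounting
import HarnessLib

/-!
# Möbius–Walsh sums: the type-II resonance analysis and the mean-square bound for the bottom
# digit window (Bourgain 2013, §2, (2.1)–(2.22)) — proved

Topic `Literature/NumberTheory/LFunctions`; a proofs file towards the named fact
`bourgain_moebius_walsh_uniform` (J. Bourgain, *Möbius–Walsh correlation bounds and an estimate of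
Mauduit and Rivat*, J. Anal. Math. **119** (2013) 147–163 = arXiv:1109.2784, Theorem 1)
[Bourgain2013MoebiusWalsh]. Everything here is PROVED (0 `sorry`, no named fact); the `def`s are
explicit bodies (`boxKernel`, `dft`, `dirichletFactor`, `fejerCoeff`, `fejerSmooth`, `specWeight`,
`longSum`, `diffCorr`, `resBoundBottom`).

**What is new here (not elsewhere in the tree).** The RESONANCE ANALYSIS of Bourgain's §2 for the
bottom digit window `K = 0` — `resonance_bottom`, the bound for
`∑_b ∑_{h,h'} |ŵ(h)||ŵ(h')| 𝟙[‖((h+h')b + h'ℓ)/2^ν‖ < 1/M₁]` of (2.11)–(2.22) (diagonal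
`h + h' ≡ 0`: sup norm (Lemma 2) twice and the count of `h'` with `‖h'ℓ/2^ν‖ < 1/M₁`; off the
diagonal, with `2^r ∥ h + h'`: the `b`-count (2.16)/(2.18), the restriction (2.17) of `h'` to few
classes mod `2^r`, and Lemma 4 for the class sums) — and the ASSEMBLED MEAN-SQUARE BOUND
`meanSquare_le_bottom`:
`∑_{a ∈ D_i} (∑_{b ∈ D_j} β(b) w_T(ab))² ≤ ((N+L)/L)(3MN + 2L(36MN/2^E + 2M·RES + tail))`
for `|β| ≤ 1`, with every constant explicit (`resBoundBottom`), from which the type-II box bound for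
digit sets living in `[0, i+2+ρ+E)` follows by Cauchy–Schwarz. The steps are those of the paper:
(2.1)–(2.2) van der Corput differencing (here with a smooth weight on the short variable inserted
BEFORE differencing, `sum_weight_mul_longSum_sq_le`), the digit truncation of [M-R] Lemma 5 with
the carry count (`diffCorr_le_window`), the smoothed `a`-summation (2.11) (`diffCorr_le_resonance`,
through the factorised Fourier transform of the iterated box kernel `boxKernel`), and the count.

**Overlap with sibling files (parallel development, stated precisely).** While this file was
written, companions by other seats landed tools for the same programme in their own normalisations:
`MoebiusWalshVanDerCorput` (differencing), `MoebiusWalshCarry`/`MoebiusWalshTypeIITools` (carry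
truncation, window counts), `MoebiusWalshCounting` (counts of `‖an/2^L + β‖ < δ`),
`MoebiusWalshSmoothCutoff` (a polynomial realisation of the same iterated box smoothing) and
`MoebiusWalshLocalised` (Lemma 5). The versions below (`vdCorput_shift_pairs`, `natWalsh_mul_natWalsh_shift_eq`,
`card_filter_block_eq_le`, `boxKernel`/`sum_boxKernel_mul_eChar`, `card_filter_phase_lt_le`,
`fejerSmooth`/`sum_sq_sub_fejerSmooth_le`) are kept because the resonance theorem and the assembly
consume exactly these shapes (pairs-indexed differencing with the weight inside, two-sided shifts
`x ± c2^K`, the kernel transform factorised as `(∑_J e)(W⁻¹∑_{u<W} e)^A` on `range (3M)`, the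
`2`-adic form `(2δ2^{ν-r}+2)(N/2^{ν-r}+1)` of the count, an `L²` Fejér localisation for block
functions `F(⌊x/2^K⌋)` needed for the windows `K > 0`); they are elementary and short, and no
statement of a sibling file is restated verbatim (the Walsh-spectral inputs — Lemmas 1, 2, 4, 6,
Fourier inversion `natWalsh_eq_sum_range`, `norm_walshCoeff_le_two_mul_rpow` — are IMPORTED from
`MoebiusWalshCircuitsProofs`/`MoebiusWalshTypeIEstimate`, not re-proved).

## References

* J. Bourgain, J. Anal. Math. 119 (2013) 147–163 = arXiv:1109.2784, §2 (2.1)–(2.22); Lemmas 1, 2,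
  4. [Bourgain2013MoebiusWalsh]
* C. Mauduit, J. Rivat, Ann. of Math. 171 (2010) 1591–1646, Lemmes 4–5 (differencing, carries).
-/

noncomputable section

open Finset Real ArithmeticFunction
open scoped ArithmeticFunction.sigma

namespace Literature.NumberTheory.LFunctions.MoebiusWalshResonance

open Literature.Computability.Complexity (bitsToNat)
open Literature.NumberTheory.LFunctions.MoebiusWalshVaughan
open Literature.NumberTheory.LFunctions.MoebiusWalsh (eChar eChar_eq_fourierChar norm_eChar
  eChar_add eChar_add_intCast eChar_zero eChar_sum walshCoeff walshSupExponent walshL1Exponent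
  walshNat natWalsh_eq_walshNat natWalsh_eq_sum_range norm_walshCoeff_le_two_mul_rpow
  one_div_le_distInt_int_div)
open Literature.NumberTheory.Sieve.Vinogradov (distInt distInt_nonneg geomBound geomBound_le
  geomBound_nonneg geomBound_neg geomBound_le_inv norm_sum_Ioc_fourierChar_le_geomBound
  distInt_add_int distInt_le_half distInt_le_abs_sub_int card_filter_distInt_mem_Ico_le_two)
open Literature.NumberTheory.LFunctions.MoebiusWalsh (sum_eChar_mul_div eChar_intCast eChar_nat_mul
  walshSign sum_digits_eq_sum_range sum_norm_walshCoeff_progression_le sum_norm_walshCoeff_le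
  sum_Ico_norm_walshCoeff_le_rpow walshL1Exponent_pos walshL1Exponent_lt_half)
open Literature.NumberTheory.Sieve.FejerCounting (fejerKernel fejerKernel_nonneg fejerKernel_eq_sum)
open Literature.Computability.Complexity.WalshDyadic (fejerKernel_natCast_div_le sum_range_fejerKernel_div
  sum_range_add_of_periodic sum_range_mul_of_periodic)
open scoped FourierTransform

/-- Splitting `range (d g)` along `h = h₁ + d h₂`. [folklore] -/
theorem sum_range_mul_eq_sum_sum {M : Type*} [AddCommMonoid M] (f : ℕ → M) (d g : ℕ) :
    ∑ h ∈ range (d * g), f h = ∑ h₂ ∈ range g, ∑ h₁ ∈ range d, f (h₁ + d * h₂) := by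
  induction g with
  | zero => simp
  | succ g ih =>
    rw [Finset.sum_range_succ, ← ih, Nat.mul_succ, Finset.sum_range_add]
    congr 1
    refine Finset.sum_congr rfl fun h₁ _ => ?_
    rw [add_comm]

/-! ### Van der Corput differencing with shifts in a progression (Mauduit–Rivat, Lemme 4) -/

/-- The number of pairs `(u, u') ∈ [0, L)²` with `u − u' = h` is at most `L`. [folklore] -/
theorem card_filter_sub_eq_le' (L : ℕ) (h : ℤ) :
    ((range L ×ˢ range L).filter (fun p : ℕ × ℕ => (p.1 : ℤ) - p.2 = h)).card ≤ L := by
  calc ((range L ×ˢ range L).filter (fun p : ℕ × ℕ => (p.1 : ℤ) - p.2 = h)).card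
      ≤ ((range L ×ˢ range L).filter (fun p : ℕ × ℕ => (p.1 : ℤ) - p.2 = h)).card := le_rfl
    _ ≤ (range L).card := by
        refine Finset.card_le_card_of_injOn (fun p => p.2) (fun p hp => ?_) ?_
        · rw [Finset.mem_coe, Finset.mem_filter, Finset.mem_product] at hp
          exact hp.1.2
        · intro p hp p' hp' hpp
          rw [Finset.mem_coe, Finset.mem_filter] at hp hp'
          simp only at hpp
          have h1 : (p.1 : ℤ) = p'.1 := by have := hp.2; have := hp'.2; omega
          exact Prod.ext (by exact_mod_cast h1) hpp
    _ = L := Finset.card_range L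

/-- Shifting a sum of a function supported in `I`: `∑_{b ∈ T} φ(b + v) = ∑_{c ∈ I} φ(c)` as soon as
`T + v` contains the support. [folklore] -/
theorem sum_shift_eq_of_support {φ : ℤ → ℝ} {I T : Finset ℤ} (v : ℤ)
    (hI : ∀ c, φ c ≠ 0 → c ∈ I) (hT : ∀ c, φ c ≠ 0 → c - v ∈ T) :
    ∑ b ∈ T, φ (b + v) = ∑ c ∈ I, φ c := by
  classical
  have h1 : ∑ b ∈ T, φ (b + v) = ∑ c ∈ T.image (fun b => b + v), φ c := by
    rw [Finset.sum_image fun b _ b' _ h => by simpa using h]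
  rw [h1]
  set U := I ∪ T.image (fun b => b + v) with hU
  have h2 : ∑ c ∈ T.image (fun b => b + v), φ c = ∑ c ∈ U, φ c := by
    refine Finset.sum_subset Finset.subset_union_right fun c _ hc => ?_
    by_contra h
    exact hc (Finset.mem_image.2 ⟨c - v, hT c h, by ring⟩)
  have h3 : ∑ c ∈ I, φ c = ∑ c ∈ U, φ c := by
    refine Finset.sum_subset Finset.subset_union_left fun c _ hc => ?_
    by_contra h
    exact hc (hI c h)
  rw [h2, h3]

/-- Regrouping a sum over pairs by the difference: for `Ψ ≥ 0`,
`∑_{u, u' < L} Ψ(u − u') ≤ L ∑_{|ℓ| < L} Ψ(ℓ)`. [folklore] -/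
theorem sum_pairs_le_mul_sum_Ioo {Ψ : ℤ → ℝ} (hΨ : ∀ h, 0 ≤ Ψ h) (L : ℕ) :
    ∑ p ∈ range L ×ˢ range L, Ψ ((p.1 : ℤ) - p.2) ≤ L * ∑ ℓ ∈ Ioo (-(L : ℤ)) L, Ψ ℓ := by
  classical
  have hmaps : ∀ p ∈ range L ×ˢ range L, (p.1 : ℤ) - p.2 ∈ Ioo (-(L : ℤ)) L := by
    intro p hp
    rw [Finset.mem_product, mem_range, mem_range] at hp
    rw [Finset.mem_Ioo]; constructor <;> omega
  rw [← Finset.sum_fiberwise_of_maps_to hmaps, Finset.mul_sum]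
  refine Finset.sum_le_sum fun ℓ _ => ?_
  calc ∑ p ∈ (range L ×ˢ range L).filter (fun p => (p.1 : ℤ) - p.2 = ℓ), Ψ ((p.1 : ℤ) - p.2)
      = ∑ p ∈ (range L ×ˢ range L).filter (fun p => (p.1 : ℤ) - p.2 = ℓ), Ψ ℓ :=
        Finset.sum_congr rfl fun p hp => by rw [(Finset.mem_filter.mp hp).2]
    _ = ((range L ×ˢ range L).filter (fun p => (p.1 : ℤ) - p.2 = ℓ)).card * Ψ ℓ := by
        rw [Finset.sum_const, nsmul_eq_mul]
    _ ≤ L * Ψ ℓ := mul_le_mul_of_nonneg_right (by exact_mod_cast card_filter_sub_eq_le' L ℓ) (hΨ ℓ)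

/-- **Van der Corput's inequality with shifts `ℓS`, signed form** (Mauduit–Rivat 2010, Lemme 4;
Bourgain 2013, (2.1)–(2.2)): for a real sequence `z` on `ℤ` supported in `I = [b₀, b₀ + N)`,
`(L ∑_b z_b)² ≤ (N + SL) ∑_{u,u' < L} ∑_{b ∈ I} z_{b+(u−u')S} z_b`.
[cite: Bourgain2013MoebiusWalsh, (2.2)] -/
theorem vdCorput_shift_pairs {z : ℤ → ℝ} {b₀ : ℤ} {N S : ℕ} (L : ℕ)
    (hz : ∀ b, z b ≠ 0 → b ∈ Ico b₀ (b₀ + N)) :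
    ((L : ℝ) * ∑ b ∈ Ico b₀ (b₀ + N), z b) ^ 2 ≤
      ((N : ℝ) + S * L) * ∑ p ∈ range L ×ˢ range L,
        ∑ b ∈ Ico b₀ (b₀ + N), z (b + ((p.1 : ℤ) - p.2) * S) * z b := by
  classical
  set I : Finset ℤ := Ico b₀ (b₀ + N) with hI
  set R : Finset ℤ := Ico (b₀ - S * L) (b₀ + N) with hR
  set Z : ℝ := ∑ b ∈ I, z b with hZ
  set Γ : ℤ → ℝ := fun h => ∑ c ∈ I, z (c + h * S) * z c with hΓ
  -- Step 1: `L Z = ∑_{b ∈ R} ∑_{u < L} z(b + uS)`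
  have hshift : ∀ u ∈ range L, ∑ b ∈ R, z (b + (u : ℤ) * S) = Z := by
    intro u hu
    have hu' := mem_range.mp hu
    refine sum_shift_eq_of_support ((u : ℤ) * S) hz fun c hc => ?_
    have hcI := hz c hc
    rw [hI, mem_Ico] at hcI
    rw [hR, mem_Ico]
    have h1 : (u : ℤ) * S ≤ (S : ℤ) * L := by
      have : (u : ℤ) ≤ L := by exact_mod_cast hu'.le
      nlinarith [Int.natCast_nonneg S]
    have h2 : 0 ≤ (u : ℤ) * S := by positivity
    constructor <;> linarith
  have hLZ : (L : ℝ) * Z = ∑ b ∈ R, ∑ u ∈ range L, z (b + (u : ℤ) * S) := by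
    rw [Finset.sum_comm, Finset.sum_congr rfl hshift, Finset.sum_const, Finset.card_range, nsmul_eq_mul]
  -- Step 2: Cauchy–Schwarz
  have hCS : ((L : ℝ) * Z) ^ 2 ≤ ((N : ℝ) + S * L) * ∑ b ∈ R, (∑ u ∈ range L, z (b + (u : ℤ) * S)) ^ 2 := by
    rw [hLZ]
    have h := Finset.sum_mul_sq_le_sq_mul_sq R (fun _ => (1 : ℝ)) (fun b => ∑ u ∈ range L, z (b + (u : ℤ) * S))
    simp only [one_pow, one_mul, Finset.sum_const, nsmul_eq_mul, mul_one] at h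
    have hcard : (R.card : ℝ) = (N : ℝ) + S * L := by
      rw [hR, Int.card_Ico]
      have : (b₀ + N - (b₀ - S * L)).toNat = N + S * L := by
        have : b₀ + (N : ℤ) - (b₀ - S * L) = ((N + S * L : ℕ) : ℤ) := by push_cast; ring
        rw [this, Int.toNat_natCast]
      rw [this]; push_cast; ring
    rw [hcard] at h
    exact h
  -- Step 3: expand the square
  have hΓeq : ∀ u ∈ range L, ∀ u' ∈ range L,
      ∑ b ∈ R, z (b + (u : ℤ) * S) * z (b + (u' : ℤ) * S) = Γ ((u : ℤ) - u') := by
    intro u _ u' hu'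
    have hu'' := mem_range.mp hu'
    have key := sum_shift_eq_of_support (φ := fun c => z (c + ((u : ℤ) - u') * S) * z c) (I := I) (T := R)
      ((u' : ℤ) * S) (fun c hc => hz c (right_ne_zero_of_mul hc)) (fun c hc => ?_)
    · rw [hΓ]
      simp only at key ⊢
      rw [← key]
      refine Finset.sum_congr rfl fun b _ => ?_
      ring_nf
    · have hcI := hz c (right_ne_zero_of_mul hc)
      rw [hI, mem_Ico] at hcI
      rw [hR, mem_Ico]
      have h1 : (u' : ℤ) * S ≤ (S : ℤ) * L := by
        have : (u' : ℤ) ≤ L := by exact_mod_cast hu''.le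
        nlinarith [Int.natCast_nonneg S]
      have h2 : 0 ≤ (u' : ℤ) * S := by positivity
      constructor <;> linarith
  have hexpand : ∑ b ∈ R, (∑ u ∈ range L, z (b + (u : ℤ) * S)) ^ 2 =
      ∑ p ∈ range L ×ˢ range L, Γ ((p.1 : ℤ) - p.2) := by
    calc ∑ b ∈ R, (∑ u ∈ range L, z (b + (u : ℤ) * S)) ^ 2
        = ∑ b ∈ R, ∑ u ∈ range L, ∑ u' ∈ range L, z (b + (u : ℤ) * S) * z (b + (u' : ℤ) * S) := by
          refine Finset.sum_congr rfl fun b _ => ?_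
          rw [sq, Finset.sum_mul_sum]
      _ = ∑ u ∈ range L, ∑ u' ∈ range L, ∑ b ∈ R, z (b + (u : ℤ) * S) * z (b + (u' : ℤ) * S) := by
          rw [Finset.sum_comm]
          refine Finset.sum_congr rfl fun u _ => ?_
          rw [Finset.sum_comm]
      _ = ∑ u ∈ range L, ∑ u' ∈ range L, Γ ((u : ℤ) - u') := by
          refine Finset.sum_congr rfl fun u hu => Finset.sum_congr rfl fun u' hu' => hΓeq u hu u' hu'
      _ = ∑ p ∈ range L ×ˢ range L, Γ ((p.1 : ℤ) - p.2) := by rw [Finset.sum_product]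
  rw [hexpand] at hCS
  simpa [hΓ] using hCS

/-- **Van der Corput's inequality with shifts `ℓS`** (Mauduit–Rivat 2010, Lemme 4; Bourgain 2013,
(2.1)–(2.2)): for a real sequence `z` on `ℤ` supported in `I = [b₀, b₀ + N)` and `L ≥ 1`, `S ≥ 0`,
`(∑_b z_b)² ≤ ((N + SL)/L) ∑_{|ℓ| < L} |∑_{b ∈ I} z_{b+ℓS} z_b|`.
[cite: Bourgain2013MoebiusWalsh, (2.2)] -/
theorem vdCorput_shift {z : ℤ → ℝ} {b₀ : ℤ} {N S L : ℕ} (hL : 1 ≤ L)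
    (hz : ∀ b, z b ≠ 0 → b ∈ Ico b₀ (b₀ + N)) :
    (∑ b ∈ Ico b₀ (b₀ + N), z b) ^ 2 ≤
      (((N : ℝ) + S * L) / L) * ∑ ℓ ∈ Ioo (-(L : ℤ)) L,
        |∑ b ∈ Ico b₀ (b₀ + N), z (b + ℓ * S) * z b| := by
  have hL0 : (0 : ℝ) < L := by exact_mod_cast hL
  have h1 := vdCorput_shift_pairs (S := S) L hz
  set Z := ∑ b ∈ Ico b₀ (b₀ + N), z b
  set Γ : ℤ → ℝ := fun h => ∑ c ∈ Ico b₀ (b₀ + N), z (c + h * S) * z c with hΓ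
  have h2 : ∑ p ∈ range L ×ˢ range L, Γ ((p.1 : ℤ) - p.2) ≤ L * ∑ ℓ ∈ Ioo (-(L : ℤ)) L, |Γ ℓ| :=
    (Finset.sum_le_sum fun p _ => le_abs_self (Γ ((p.1 : ℤ) - p.2))).trans
      (sum_pairs_le_mul_sum_Ioo (fun h => abs_nonneg _) L)
  have hmain : ((L : ℝ) * Z) ^ 2 ≤ ((N : ℝ) + S * L) * (L * ∑ ℓ ∈ Ioo (-(L : ℤ)) L, |Γ ℓ|) :=
    h1.trans (mul_le_mul_of_nonneg_left h2 (by positivity))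
  have : Z ^ 2 ≤ (((N : ℝ) + S * L) / L) * ∑ ℓ ∈ Ioo (-(L : ℤ)) L, |Γ ℓ| := by
    rw [div_mul_eq_mul_div, le_div_iff₀ hL0]
    have e : ((L : ℝ) * Z) ^ 2 = Z ^ 2 * L * L := by ring
    have e2 : ((N : ℝ) + S * L) * (L * ∑ ℓ ∈ Ioo (-(L : ℤ)) L, |Γ ℓ|) =
        ((N : ℝ) + S * L) * (∑ ℓ ∈ Ioo (-(L : ℤ)) L, |Γ ℓ|) * L := by ring
    rw [e, e2] at hmain
    exact le_of_mul_le_mul_right hmain hL0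
  simpa [hΓ] using this

/-! ### Binary carries (Mauduit–Rivat, Lemme 5; Bourgain 2013, before (2.3)) -/

/-- The block of `E` digits of `x` starting at position `P`, as a number `< 2^E`. [folklore] -/
theorem digitBlock_lt (x P E : ℕ) : x / 2 ^ P % 2 ^ E < 2 ^ E := Nat.mod_lt _ (Nat.two_pow_pos E)

/-- The low `P + E` digits split as `2^P · (block) + (x mod 2^P)`. [folklore] -/
theorem mod_two_pow_add_eq (x P E : ℕ) :
    x % 2 ^ (P + E) = 2 ^ P * (x / 2 ^ P % 2 ^ E) + x % 2 ^ P := by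
  rw [pow_add, Nat.mod_mul, add_comm, mul_comm]

/-- **No carry out of a block that is not all ones**: if `d < 2^P` and the `E` digits of `x` from
position `P` are not all `1`, then adding `d` does not change any digit of `x` at positions
`≥ P + E`. [cite: Bourgain2013MoebiusWalsh, §2 (digit truncation, cf. [M-R] Lemma 5)] -/
theorem testBit_add_eq_of_block_ne {x d P E : ℕ} (hd : d < 2 ^ P)
    (hx : x / 2 ^ P % 2 ^ E ≠ 2 ^ E - 1) {p : ℕ} (hp : P + E ≤ p) :
    (x + d).testBit p = x.testBit p := by
  set hi := x / 2 ^ (P + E) with hhi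
  set lo := x % 2 ^ (P + E) with hlo
  have hx_eq : x = 2 ^ (P + E) * hi + lo := (Nat.div_add_mod x (2 ^ (P + E))).symm
  have hlo_lt : lo < 2 ^ (P + E) := Nat.mod_lt _ (Nat.two_pow_pos _)
  have hblock : x / 2 ^ P % 2 ^ E ≤ 2 ^ E - 2 := by
    have := digitBlock_lt x P E; omega
  have hlod : lo + d < 2 ^ (P + E) := by
    rw [hlo, mod_two_pow_add_eq]
    have h1 : x % 2 ^ P < 2 ^ P := Nat.mod_lt _ (Nat.two_pow_pos P)
    calc 2 ^ P * (x / 2 ^ P % 2 ^ E) + x % 2 ^ P + d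
        < 2 ^ P * (2 ^ E - 2) + 2 ^ P + 2 ^ P := by
          have := Nat.mul_le_mul_left (2 ^ P) hblock; omega
      _ = 2 ^ P * 2 ^ E := by
          have h2 : 2 ≤ 2 ^ E := by
            rcases Nat.eq_zero_or_pos E with h0 | hE
            · exfalso; rw [h0] at hx hblock; simp at hblock hx; exact hx hblock
            · calc 2 = 2 ^ 1 := by norm_num
                _ ≤ 2 ^ E := Nat.pow_le_pow_right Nat.two_pos hE
          rw [Nat.mul_sub, mul_two]; have := Nat.mul_le_mul_left (2 ^ P) h2; omega
      _ = 2 ^ (P + E) := by rw [pow_add]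
  rw [hx_eq, add_assoc, Nat.testBit_two_pow_mul_add _ hlod, Nat.testBit_two_pow_mul_add _ hlo_lt,
    if_neg (by omega), if_neg (by omega)]

/-- **No borrow out of a block that is not all zeros**: if `d < 2^P` and the `E` digits of `x`
from position `P` are not all `0`, then `d ≤ x` and subtracting `d` does not change any digit of
`x` at positions `≥ P + E`. [cite: Bourgain2013MoebiusWalsh, §2 (digit truncation, cf. [M-R] Lemma 5)] -/
theorem testBit_sub_eq_of_block_ne {x d P E : ℕ} (hd : d < 2 ^ P)
    (hx : x / 2 ^ P % 2 ^ E ≠ 0) {p : ℕ} (hp : P + E ≤ p) :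
    d ≤ x ∧ (x - d).testBit p = x.testBit p := by
  set hi := x / 2 ^ (P + E) with hhi
  set lo := x % 2 ^ (P + E) with hlo
  have hx_eq : x = 2 ^ (P + E) * hi + lo := (Nat.div_add_mod x (2 ^ (P + E))).symm
  have hlo_lt : lo < 2 ^ (P + E) := Nat.mod_lt _ (Nat.two_pow_pos _)
  have hdlo : d ≤ lo := by
    rw [hlo, mod_two_pow_add_eq]
    have h1 : 1 ≤ x / 2 ^ P % 2 ^ E := Nat.one_le_iff_ne_zero.mpr hx
    have := Nat.mul_le_mul_left (2 ^ P) h1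
    omega
  refine ⟨hdlo.trans (by rw [hx_eq]; omega), ?_⟩
  have hsub : x - d = 2 ^ (P + E) * hi + (lo - d) := by rw [hx_eq]; omega
  rw [hsub, hx_eq, Nat.testBit_two_pow_mul_add _ (by omega : lo - d < 2 ^ (P + E)),
    Nat.testBit_two_pow_mul_add _ hlo_lt, if_neg (by omega), if_neg (by omega)]

/-- Adding a multiple of `2^K` does not change the digits below `K`. [folklore] -/
theorem testBit_add_mul_two_pow_of_lt (x c K : ℕ) {p : ℕ} (hp : p < K) :
    (x + c * 2 ^ K).testBit p = x.testBit p := by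
  have h1 : (x + c * 2 ^ K) % 2 ^ K = x % 2 ^ K := Nat.add_mul_mod_self_right x c (2 ^ K)
  have e1 : (x + c * 2 ^ K).testBit p = ((x + c * 2 ^ K) % 2 ^ K).testBit p := by
    rw [Nat.testBit_mod_two_pow]; simp [hp]
  have e2 : x.testBit p = (x % 2 ^ K).testBit p := by
    rw [Nat.testBit_mod_two_pow]; simp [hp]
  rw [e1, e2, h1]

/-- Subtracting a multiple of `2^K` (not exceeding `x`) does not change the digits below `K`.
[folklore] -/
theorem testBit_sub_mul_two_pow_of_lt {x c K : ℕ} (hcx : c * 2 ^ K ≤ x) {p : ℕ} (hp : p < K) :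
    (x - c * 2 ^ K).testBit p = x.testBit p := by
  have := testBit_add_mul_two_pow_of_lt (x - c * 2 ^ K) c K hp
  rw [Nat.sub_add_cancel hcx] at this
  exact this.symm

/-- The digit `p` of `x` with `P ≤ p < P + E` is the digit `p − P` of the block `x / 2^P mod 2^E`.
[folklore] -/
theorem testBit_eq_testBit_block {x P E p : ℕ} (h1 : P ≤ p) (h2 : p < P + E) :
    x.testBit p = (x / 2 ^ P % 2 ^ E).testBit (p - P) := by
  rw [Nat.testBit_mod_two_pow, Nat.testBit_div_two_pow]
  have : p - P < E := by omega
  simp [this, Nat.sub_add_cancel h1]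

/-- **The Walsh character of a shifted argument only sees a window of digits** (Bourgain 2013, §2:
"we may write `w_S(mn)w_S(m(n + ℓ2^K)) = w_{S'}(mn)w_{S'}(m(n + ℓ2^K))` with
`S' = S ∩ [K, K + μ + ρ']`" off the carry-bad set): if `d = c·2^K < 2^P` (`K ≤ P`) and the block of
`E` digits of `x` at position `P` is neither all ones nor all zeros, then
`w_T(x) w_T(x + d) = w_{T_K}(x) w_{T_K}(x + d)` and `w_T(x) w_T(x − d) = w_{T_K}(x) w_{T_K}(x − d)`
with `T_K = {t ∈ T : K ≤ t < P + E}` (any `K`; in the application `2^K ≤ d < 2^P`).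
[cite: Bourgain2013MoebiusWalsh, §2 (before (2.3))] -/
theorem natWalsh_mul_natWalsh_shift_eq (T : Finset ℕ) {x c K P E : ℕ}
    (hd : c * 2 ^ K < 2 ^ P) (h1 : x / 2 ^ P % 2 ^ E ≠ 2 ^ E - 1) (h0 : x / 2 ^ P % 2 ^ E ≠ 0) :
    natWalsh T x * natWalsh T (x + c * 2 ^ K) =
        natWalsh (T.filter (fun t => K ≤ t ∧ t < P + E)) x *
          natWalsh (T.filter (fun t => K ≤ t ∧ t < P + E)) (x + c * 2 ^ K) ∧
      natWalsh T x * natWalsh T (x - c * 2 ^ K) =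
        natWalsh (T.filter (fun t => K ≤ t ∧ t < P + E)) x *
          natWalsh (T.filter (fun t => K ≤ t ∧ t < P + E)) (x - c * 2 ^ K) := by
  have hle : c * 2 ^ K ≤ x := (testBit_sub_eq_of_block_ne hd h0 (le_refl (P + E))).1
  -- the digits outside the window agree
  have hagree_add : ∀ t, ¬ (K ≤ t ∧ t < P + E) → (x + c * 2 ^ K).testBit t = x.testBit t := by
    intro t ht
    rcases Nat.lt_or_ge t K with htK | htK
    · exact testBit_add_mul_two_pow_of_lt x c K htK
    · exact testBit_add_eq_of_block_ne hd h1 (by omega)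
  have hagree_sub : ∀ t, ¬ (K ≤ t ∧ t < P + E) → (x - c * 2 ^ K).testBit t = x.testBit t := by
    intro t ht
    rcases Nat.lt_or_ge t K with htK | htK
    · exact testBit_sub_mul_two_pow_of_lt hle htK
    · exact (testBit_sub_eq_of_block_ne hd h0 (by omega : P + E ≤ t)).2
  -- generic splitting
  have key : ∀ y, (∀ t, ¬ (K ≤ t ∧ t < P + E) → y.testBit t = x.testBit t) →
      natWalsh T x * natWalsh T y =
        natWalsh (T.filter (fun t => K ≤ t ∧ t < P + E)) x *
          natWalsh (T.filter (fun t => K ≤ t ∧ t < P + E)) y := by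
    intro y hy
    unfold natWalsh
    rw [← Finset.prod_mul_distrib, ← Finset.prod_mul_distrib,
      ← Finset.prod_filter_mul_prod_filter_not T (fun t => K ≤ t ∧ t < P + E)]
    conv_rhs => rw [← mul_one (∏ t ∈ T.filter (fun t => K ≤ t ∧ t < P + E),
      ((if x.testBit t then (-1 : ℝ) else 1) * (if y.testBit t then (-1 : ℝ) else 1)))]
    congr 1
    refine Finset.prod_eq_one fun t ht => ?_
    rw [Finset.mem_filter] at ht
    rw [hy t ht.2]
    split_ifs <;> norm_num
  exact ⟨key _ hagree_add, key _ hagree_sub⟩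

/-! ### Counting the carry-bad points along a progression -/

/-- A finite set of naturals any two of whose elements differ by at most `D` has at most `D + 1`
elements. [folklore] -/
theorem card_le_of_forall_sub_le {F : Finset ℕ} {D : ℕ} (h : ∀ b ∈ F, ∀ b' ∈ F, b ≤ b' + D) :
    F.card ≤ D + 1 := by
  rcases F.eq_empty_or_nonempty with hF | hF
  · rw [hF]; simp
  · have hsub : F ⊆ Icc (F.min' hF) (F.min' hF + D) := by
      intro b hb
      rw [mem_Icc]
      exact ⟨Finset.min'_le F b hb, h b hb _ (Finset.min'_mem F hF)⟩
    calc F.card ≤ (Icc (F.min' hF) (F.min' hF + D)).card := Finset.card_le_card hsub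
      _ = D + 1 := by rw [Nat.card_Icc]; omega

/-- **Few points of a progression have a prescribed digit block** (the count behind Bourgain's
"additional error term of the order `2^{-ερ}M²N²`", cf. [M-R] Lemma 5): for `a ≥ 1`, an interval
`I` of `N` consecutive integers and `c < 2^E`,
`#{b ∈ I : block of E digits of ab at position P equals c} ≤ (aN/2^{P+E} + 2)((2^P − 1)/a + 1)`
(the quotient `ab/2^{P+E}` takes at most `aN/2^{P+E} + 2` values on this set, and each value is
taken on a run of `b`'s of length `≤ (2^P−1)/a + 1`). [cite: Bourgain2013MoebiusWalsh, §2 (before (2.3))] -/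
theorem card_filter_block_eq_le {a : ℕ} (ha : 0 < a) (b₀ N P E c : ℕ) :
    ((Ico b₀ (b₀ + N)).filter (fun b => a * b / 2 ^ P % 2 ^ E = c)).card ≤
      (a * N / 2 ^ (P + E) + 2) * ((2 ^ P - 1) / a + 1) := by
  classical
  set B := (Ico b₀ (b₀ + N)).filter (fun b => a * b / 2 ^ P % 2 ^ E = c) with hB
  set m : ℕ → ℕ := fun b => a * b / 2 ^ (P + E) with hm
  have hPE : 2 ^ (P + E) = 2 ^ P * 2 ^ E := pow_add _ _ _
  -- on `B`, `ab / 2^P = 2^E m(b) + c`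
  have hkey : ∀ b ∈ B, a * b / 2 ^ P = 2 ^ E * m b + c := by
    intro b hb
    rw [hB, Finset.mem_filter] at hb
    have h1 := Nat.div_add_mod (a * b / 2 ^ P) (2 ^ E)
    rw [hb.2, Nat.div_div_eq_div_mul, ← hPE] at h1
    exact h1.symm
  -- fibers of `m` are short runs
  have hfiber : ∀ v ∈ B.image m, (B.filter (fun b => m b = v)).card ≤ (2 ^ P - 1) / a + 1 := by
    intro v _
    refine card_le_of_forall_sub_le fun b hb b' hb' => ?_
    rw [Finset.mem_filter] at hb hb'
    have e1 := hkey b hb.1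
    have e2 := hkey b' hb'.1
    rw [hb.2] at e1; rw [hb'.2] at e2
    -- `ab` and `ab'` lie in the same interval `[2^P y, 2^P y + 2^P)`, `y = 2^E v + c`
    have hl' := Nat.div_mul_le_self (a * b') (2 ^ P)
    have hu := Nat.lt_div_mul_add (a := a * b) (Nat.two_pow_pos P)
    rw [e2] at hl'; rw [e1] at hu
    generalize (2 ^ E * v + c) * 2 ^ P = Y at hl' hu
    have h3 : a * b < a * b' + 2 ^ P := by omega
    have h4 : a * (b - b') ≤ 2 ^ P - 1 := by
      rw [Nat.mul_sub]; omega
    have h5 : b - b' ≤ (2 ^ P - 1) / a := by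
      rw [Nat.le_div_iff_mul_le ha, mul_comm]; exact h4
    omega
  -- the image of `m` is an interval of length `≤ aN/2^{P+E} + 1`
  have himage : (B.image m).card ≤ a * N / 2 ^ (P + E) + 2 := by
    have hsub : B.image m ⊆ Icc (m b₀) (m b₀ + (a * N / 2 ^ (P + E) + 1)) := by
      intro v hv
      rw [Finset.mem_image] at hv
      obtain ⟨b, hb, rfl⟩ := hv
      rw [hB, Finset.mem_filter, mem_Ico] at hb
      rw [mem_Icc]
      constructor
      · exact Nat.div_le_div_right (Nat.mul_le_mul_left a hb.1.1)
      · simp only [hm]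
        have hb2 : a * b ≤ a * b₀ + a * N := by nlinarith [hb.1.2]
        calc a * b / 2 ^ (P + E) ≤ (a * b₀ + a * N) / 2 ^ (P + E) := Nat.div_le_div_right hb2
          _ ≤ a * b₀ / 2 ^ (P + E) + a * N / 2 ^ (P + E) + 1 := by
              rw [Nat.add_div (Nat.two_pow_pos (P + E))]
              split_ifs <;> simp
          _ = _ := by ring
    calc (B.image m).card ≤ (Icc (m b₀) (m b₀ + (a * N / 2 ^ (P + E) + 1))).card := Finset.card_le_card hsub
      _ = a * N / 2 ^ (P + E) + 2 := by
          simp only [Nat.card_Icc]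
          generalize a * N / 2 ^ (P + E) = k
          omega
  calc B.card ≤ ((2 ^ P - 1) / a + 1) * (B.image m).card := Finset.card_le_mul_card_image B _ hfiber
    _ ≤ ((2 ^ P - 1) / a + 1) * (a * N / 2 ^ (P + E) + 2) := Nat.mul_le_mul_left _ himage
    _ = _ := mul_comm _ _

/-! ### A smooth majorant of the short variable with rapidly decaying Fourier transform -/

/-- **The iterated box kernel** `Ω = 𝟙_J ∗ B_W^{∗A}`, `J = [M/2, 2M)`, `B_W = W⁻¹𝟙_{[0,W)}`:
`Ω(m) = W^{-A} #{u ∈ [0,W)^A : m − ∑u ∈ J}`. It replaces the "smoothened `m`-summation" of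
Bourgain 2013, (2.11): `Ω = 1` on `[M, 2M)` (when `AW ≤ M/2`), `0 ≤ Ω ≤ 1`, `Ω` is supported on
`[M/2, 5M/2)`, and `∑_m Ω(m)e(mφ) = (∑_{y ∈ J} e(yφ))·(W⁻¹∑_{u<W} e(uφ))^A` decays like
`(2W‖φ‖)^{-A}`. [cite: Bourgain2013MoebiusWalsh, (2.11)] -/
def boxKernel (M W A : ℕ) (m : ℕ) : ℝ :=
  (∑ u ∈ Fintype.piFinset (fun _ : Fin A => range W),
    (if (∑ k, u k) + M / 2 ≤ m ∧ m < (∑ k, u k) + 2 * M then (1 : ℝ) else 0)) / (W : ℝ) ^ A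

/-- `#([0,W)^A) = W^A`. [folklore] -/
theorem card_piFinset_range (W A : ℕ) :
    (Fintype.piFinset (fun _ : Fin A => range W)).card = W ^ A := by
  rw [Fintype.card_piFinset, Finset.prod_const, Finset.card_range, Finset.card_univ, Fintype.card_fin]

/-- `0 ≤ Ω`. [folklore] -/
theorem boxKernel_nonneg (M W A m : ℕ) : 0 ≤ boxKernel M W A m := by
  unfold boxKernel
  refine div_nonneg (Finset.sum_nonneg fun u _ => ?_) (by positivity)
  split_ifs <;> norm_num

/-- `Ω ≤ 1`. [folklore] -/
theorem boxKernel_le_one (M W A m : ℕ) : boxKernel M W A m ≤ 1 := by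
  unfold boxKernel
  rcases Nat.eq_zero_or_pos W with hW | hW
  · subst hW
    rcases Nat.eq_zero_or_pos A with hA | hA
    · subst hA; simp
      split_ifs <;> norm_num
    · simp [zero_pow hA.ne']
  have hWA : (0 : ℝ) < (W : ℝ) ^ A := by positivity
  rw [div_le_one hWA]
  calc ∑ u ∈ Fintype.piFinset (fun _ : Fin A => range W),
        (if (∑ k, u k) + M / 2 ≤ m ∧ m < (∑ k, u k) + 2 * M then (1 : ℝ) else 0)
      ≤ ∑ _u ∈ Fintype.piFinset (fun _ : Fin A => range W), (1 : ℝ) :=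
        Finset.sum_le_sum fun u _ => by split_ifs <;> norm_num
    _ = (W : ℝ) ^ A := by rw [Finset.sum_const, nsmul_eq_mul, mul_one, card_piFinset_range]; push_cast; ring

/-- The digit sums of `u ∈ [0, W)^A` are `≤ A(W − 1)`. [folklore] -/
theorem sum_le_of_mem_piFinset {W A : ℕ} {u : Fin A → ℕ}
    (hu : u ∈ Fintype.piFinset (fun _ : Fin A => range W)) : ∑ k, u k ≤ A * (W - 1) := by
  have h : ∀ k, u k ≤ W - 1 := fun k => by
    have := mem_range.mp (Fintype.mem_piFinset.mp hu k); omega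
  calc ∑ k, u k ≤ ∑ _k : Fin A, (W - 1) := Finset.sum_le_sum fun k _ => h k
    _ = A * (W - 1) := by rw [Finset.sum_const, Finset.card_univ, Fintype.card_fin, smul_eq_mul]

/-- `Ω = 1` on `[M, 2M)` when `AW ≤ M/2`. [folklore] -/
theorem boxKernel_eq_one {M W A m : ℕ} (hAW : A * W ≤ M / 2) (hW : 0 < W) (hm1 : M ≤ m) (hm2 : m < 2 * M) :
    boxKernel M W A m = 1 := by
  unfold boxKernel
  have hWA : (0 : ℝ) < (W : ℝ) ^ A := by positivity
  rw [div_eq_one_iff_eq hWA.ne']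
  calc ∑ u ∈ Fintype.piFinset (fun _ : Fin A => range W),
        (if (∑ k, u k) + M / 2 ≤ m ∧ m < (∑ k, u k) + 2 * M then (1 : ℝ) else 0)
      = ∑ _u ∈ Fintype.piFinset (fun _ : Fin A => range W), (1 : ℝ) := by
        refine Finset.sum_congr rfl fun u hu => ?_
        have hs := sum_le_of_mem_piFinset hu
        have : A * (W - 1) ≤ M / 2 := (Nat.mul_le_mul_left A (Nat.sub_le W 1)).trans hAW
        rw [if_pos]
        constructor <;> omega
    _ = (W : ℝ) ^ A := by rw [Finset.sum_const, nsmul_eq_mul, mul_one, card_piFinset_range]; push_cast; ring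

/-- `Ω(m) = 0` unless `M/2 ≤ m < 2M + A(W−1)`. [folklore] -/
theorem boxKernel_eq_zero {M W A m : ℕ} (hm : m < M / 2 ∨ 2 * M + A * (W - 1) ≤ m) :
    boxKernel M W A m = 0 := by
  unfold boxKernel
  rw [div_eq_zero_iff]
  left
  refine Finset.sum_eq_zero fun u hu => ?_
  have hs := sum_le_of_mem_piFinset hu
  rw [if_neg]
  omega

/-- `|∑_{u < W} e(uφ)| ≤ min(W, 1/(2‖φ‖))`. [cite: Nathanson1996, §4.4, Lemma 4.7] -/
theorem norm_sum_range_eChar_le (W : ℕ) (φ : ℝ) :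
    ‖∑ u ∈ range W, eChar (u * φ)‖ ≤ geomBound (W : ℝ) φ := by
  have h1 : ∑ u ∈ range W, eChar (u * φ) = eChar (-φ) * ∑ n ∈ Ioc 0 W, eChar (n * φ) := by
    rw [Finset.range_eq_Ico, Finset.mul_sum]
    have : Ioc 0 W = Ico 1 (W + 1) := by ext n; simp only [mem_Ioc, mem_Ico]; omega
    rw [this, Finset.sum_Ico_eq_sum_range, Finset.sum_Ico_eq_sum_range]
    simp only [Nat.zero_add, tsub_zero, Nat.add_sub_cancel]
    refine Finset.sum_congr rfl fun u _ => ?_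
    rw [← eChar_add]; congr 1; push_cast; ring
  rw [h1, norm_mul, norm_eChar, one_mul]
  have h := norm_sum_Ioc_fourierChar_le_geomBound (a := 0) (b := W) (V := (W : ℝ)) φ (by simp)
  simpa [eChar_eq_fourierChar] using h

/-- **Fourier transform of the iterated box kernel**: for `AW ≤ M`,
`∑_{m < 3M} Ω(m) e(mφ) = (∑_{y ∈ [M/2, 2M)} e(yφ)) · (W⁻¹ ∑_{u<W} e(uφ))^A`.
[folklore] -/
theorem sum_boxKernel_mul_eChar {M W A : ℕ} (hAW : A * W ≤ M) (hW : 0 < W) (φ : ℝ) :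
    ∑ m ∈ range (3 * M), (boxKernel M W A m : ℂ) * eChar (m * φ) =
      (∑ y ∈ Ico (M / 2) (2 * M), eChar (y * φ)) *
        ((∑ u ∈ range W, eChar (u * φ)) / W) ^ A := by
  classical
  have hWc : (W : ℂ) ≠ 0 := by exact_mod_cast hW.ne'
  have hcast : ∀ m, (boxKernel M W A m : ℂ) =
      (∑ u ∈ Fintype.piFinset (fun _ : Fin A => range W),
        (if (∑ k, u k) + M / 2 ≤ m ∧ m < (∑ k, u k) + 2 * M then (1 : ℂ) else 0)) / (W : ℂ) ^ A := by
    intro m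
    unfold boxKernel
    push_cast
    congr 1
    refine Finset.sum_congr rfl fun u _ => ?_
    split_ifs <;> simp
  simp_rw [hcast]
  -- exchange the sums and reindex `m = y + ∑ u`
  have hinner : ∀ u ∈ Fintype.piFinset (fun _ : Fin A => range W),
      ∑ m ∈ range (3 * M), (if (∑ k, u k) + M / 2 ≤ m ∧ m < (∑ k, u k) + 2 * M then (1 : ℂ) else 0) *
        eChar (m * φ) = eChar ((∑ k, u k : ℕ) * φ) * ∑ y ∈ Ico (M / 2) (2 * M), eChar (y * φ) := by
    intro u hu
    have hs := sum_le_of_mem_piFinset hu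
    have hs' : (∑ k, u k) + 2 * M ≤ 3 * M := by
      have : A * (W - 1) ≤ M := (Nat.mul_le_mul_left A (Nat.sub_le W 1)).trans hAW
      omega
    simp_rw [ite_mul, one_mul, zero_mul]
    rw [← Finset.sum_filter, Finset.mul_sum]
    have hset : (range (3 * M)).filter (fun m => (∑ k, u k) + M / 2 ≤ m ∧ m < (∑ k, u k) + 2 * M) =
        (Ico (M / 2) (2 * M)).image (fun y => y + ∑ k, u k) := by
      ext m
      simp only [Finset.mem_filter, mem_range, Finset.mem_image, mem_Ico]
      constructor
      · rintro ⟨hm, h1, h2⟩; exact ⟨m - ∑ k, u k, ⟨by omega, by omega⟩, by omega⟩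
      · rintro ⟨y, ⟨hy1, hy2⟩, rfl⟩; exact ⟨by omega, by omega, by omega⟩
    rw [hset, Finset.sum_image fun y _ y' _ h => by simpa using h]
    refine Finset.sum_congr rfl fun y _ => ?_
    rw [← eChar_add]; congr 1; push_cast; ring
  -- the sum over `u` of `e(φ ∑ u_k)` factors
  have hprod : ∑ u ∈ Fintype.piFinset (fun _ : Fin A => range W), eChar ((∑ k, u k : ℕ) * φ) =
      (∑ u ∈ range W, eChar (u * φ)) ^ A := by
    have h1 : (∑ u ∈ range W, eChar (u * φ)) ^ A = ∏ _k : Fin A, ∑ u ∈ range W, eChar (u * φ) := by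
      rw [Finset.prod_const, Finset.card_univ, Fintype.card_fin]
    rw [h1, Finset.prod_univ_sum]
    refine Finset.sum_congr rfl fun u _ => ?_
    rw [← eChar_sum]; congr 1; push_cast; rw [Finset.sum_mul]
  calc ∑ m ∈ range (3 * M), (∑ u ∈ Fintype.piFinset (fun _ : Fin A => range W),
          (if (∑ k, u k) + M / 2 ≤ m ∧ m < (∑ k, u k) + 2 * M then (1 : ℂ) else 0)) / (W : ℂ) ^ A *
          eChar (m * φ)
      = (∑ m ∈ range (3 * M), ∑ u ∈ Fintype.piFinset (fun _ : Fin A => range W),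
          (if (∑ k, u k) + M / 2 ≤ m ∧ m < (∑ k, u k) + 2 * M then (1 : ℂ) else 0) * eChar (m * φ)) /
          (W : ℂ) ^ A := by
        rw [Finset.sum_div]
        refine Finset.sum_congr rfl fun m _ => ?_
        rw [div_mul_eq_mul_div, Finset.sum_mul]
    _ = (∑ u ∈ Fintype.piFinset (fun _ : Fin A => range W), ∑ m ∈ range (3 * M),
          (if (∑ k, u k) + M / 2 ≤ m ∧ m < (∑ k, u k) + 2 * M then (1 : ℂ) else 0) * eChar (m * φ)) /
          (W : ℂ) ^ A := by rw [Finset.sum_comm]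
    _ = ((∑ u ∈ Fintype.piFinset (fun _ : Fin A => range W), eChar ((∑ k, u k : ℕ) * φ)) *
          ∑ y ∈ Ico (M / 2) (2 * M), eChar (y * φ)) / (W : ℂ) ^ A := by
        rw [Finset.sum_congr rfl hinner, Finset.sum_mul]
    _ = _ := by rw [hprod, div_pow]; ring

/-- `|∑_m Ω(m) e(mφ)| ≤ 2M`. [folklore] -/
theorem norm_sum_boxKernel_mul_eChar_le {M W A : ℕ} (hAW : A * W ≤ M) (hW : 0 < W) (φ : ℝ) :
    ‖∑ m ∈ range (3 * M), (boxKernel M W A m : ℂ) * eChar (m * φ)‖ ≤ 2 * M := by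
  rw [sum_boxKernel_mul_eChar hAW hW, norm_mul]
  have hW0 : (0 : ℝ) < W := by exact_mod_cast hW
  have h1 : ‖∑ y ∈ Ico (M / 2) (2 * M), eChar (y * φ)‖ ≤ 2 * M := by
    calc ‖∑ y ∈ Ico (M / 2) (2 * M), eChar (y * φ)‖ ≤ ∑ y ∈ Ico (M / 2) (2 * M), ‖eChar (y * φ)‖ := norm_sum_le _ _
      _ = ((Ico (M / 2) (2 * M)).card : ℝ) := by simp [norm_eChar]
      _ ≤ 2 * M := by
          rw [Nat.card_Ico]
          have : 2 * M - M / 2 ≤ 2 * M := Nat.sub_le _ _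
          exact_mod_cast this
  have h2 : ‖((∑ u ∈ range W, eChar (u * φ)) / W) ^ A‖ ≤ 1 := by
    rw [norm_pow]
    refine pow_le_one₀ (norm_nonneg _) ?_
    rw [norm_div, Complex.norm_natCast, div_le_one hW0]
    exact (norm_sum_range_eChar_le W φ).trans (geomBound_le _ _)
  calc ‖∑ y ∈ Ico (M / 2) (2 * M), eChar (y * φ)‖ * ‖((∑ u ∈ range W, eChar (u * φ)) / W) ^ A‖
      ≤ (2 * (M : ℝ)) * 1 := mul_le_mul h1 h2 (norm_nonneg _) (by positivity)
    _ = 2 * M := mul_one _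

/-- **Tail decay**: if `‖φ‖ > 0` then `|∑_m Ω(m) e(mφ)| ≤ 2M (1/(2W‖φ‖))^A`. [folklore] -/
theorem norm_sum_boxKernel_mul_eChar_le_tail {M W A : ℕ} (hAW : A * W ≤ M) (hW : 0 < W) {φ : ℝ}
    (hφ : 0 < distInt φ) :
    ‖∑ m ∈ range (3 * M), (boxKernel M W A m : ℂ) * eChar (m * φ)‖ ≤
      2 * M * (1 / (2 * W * distInt φ)) ^ A := by
  rw [sum_boxKernel_mul_eChar hAW hW, norm_mul]
  have hW0 : (0 : ℝ) < W := by exact_mod_cast hW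
  have h1 : ‖∑ y ∈ Ico (M / 2) (2 * M), eChar (y * φ)‖ ≤ 2 * M := by
    calc ‖∑ y ∈ Ico (M / 2) (2 * M), eChar (y * φ)‖ ≤ ∑ y ∈ Ico (M / 2) (2 * M), ‖eChar (y * φ)‖ := norm_sum_le _ _
      _ = ((Ico (M / 2) (2 * M)).card : ℝ) := by simp [norm_eChar]
      _ ≤ 2 * M := by
          rw [Nat.card_Ico]
          have : 2 * M - M / 2 ≤ 2 * M := Nat.sub_le _ _
          exact_mod_cast this
  have h2 : ‖((∑ u ∈ range W, eChar (u * φ)) / W) ^ A‖ ≤ (1 / (2 * W * distInt φ)) ^ A := by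
    rw [norm_pow]
    refine pow_le_pow_left₀ (norm_nonneg _) ?_ A
    rw [norm_div, Complex.norm_natCast, div_le_iff₀ hW0]
    calc ‖∑ u ∈ range W, eChar (u * φ)‖ ≤ geomBound (W : ℝ) φ := norm_sum_range_eChar_le W φ
      _ ≤ 1 / (2 * distInt φ) := geomBound_le_inv _ hφ
      _ = 1 / (2 * W * distInt φ) * W := by field_simp
  calc _ ≤ 2 * M * (1 / (2 * W * distInt φ)) ^ A := mul_le_mul h1 h2 (norm_nonneg _) (by positivity)

/-! ### Walsh characters of a digit window as block functions -/

/-- A Walsh character whose digits lie in `[K, ∞)` only reads `x / 2^K`: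
`w_T(x) = w_{T − K}(⌊x/2^K⌋)`. [folklore] -/
theorem natWalsh_eq_natWalsh_image_sub_div {T : Finset ℕ} {K : ℕ} (hT : ∀ t ∈ T, K ≤ t) (x : ℕ) :
    natWalsh T x = natWalsh (T.image (fun t => t - K)) (x / 2 ^ K) := by
  classical
  unfold natWalsh
  rw [Finset.prod_image]
  · refine Finset.prod_congr rfl fun t ht => ?_
    rw [Nat.testBit_div_two_pow, Nat.sub_add_cancel (hT t ht)]
  · intro t ht t' ht' h
    simp only at h
    have := hT t ht; have := hT t' ht'; omega

/-- The shifted window lies below `ν`: if `T ⊆ [K, K + ν)` then `T − K ⊆ [0, ν)`. [folklore] -/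
theorem image_sub_subset_range {T : Finset ℕ} {K ν : ℕ} (hT : ∀ t ∈ T, K ≤ t ∧ t < K + ν) :
    T.image (fun t => t - K) ⊆ range ν := by
  intro u hu
  rw [Finset.mem_image] at hu
  obtain ⟨t, ht, rfl⟩ := hu
  have := hT t ht
  rw [mem_range]; omega

/-! ### The discrete Fourier transform on `ℤ/2^kℤ` -/

/-- The normalised DFT coefficient `f̂(h) = 2^{-k} ∑_{y < 2^k} f(y) e(hy/2^k)` of a function on
`ℕ` read modulo `2^k`, at an integer frequency `h`. [folklore] -/
def dft (k : ℕ) (f : ℕ → ℝ) (h : ℤ) : ℂ :=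
  ((2 : ℂ) ^ k)⁻¹ * ∑ y ∈ range (2 ^ k), (f y : ℂ) * eChar ((h : ℝ) * y / 2 ^ k)

/-- `f̂` is `2^k`-periodic in the frequency. [folklore] -/
theorem dft_add_two_pow_mul (k : ℕ) (f : ℕ → ℝ) (h m : ℤ) :
    dft k f (h + 2 ^ k * m) = dft k f h := by
  unfold dft
  congr 1
  refine Finset.sum_congr rfl fun y _ => ?_
  congr 1
  have e : (((h + 2 ^ k * m : ℤ) : ℝ)) * y / 2 ^ k = (h : ℝ) * y / 2 ^ k + ((m * y : ℤ) : ℝ) := by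
    have h2 : (2 : ℝ) ^ k ≠ 0 := pow_ne_zero _ two_ne_zero
    push_cast
    field_simp
  rw [e]
  exact eChar_add_intCast _ _

/-- `|f̂(h)| ≤ 1` for `|f| ≤ 1`. [folklore] -/
theorem norm_dft_le_one {k : ℕ} {f : ℕ → ℝ} (hf : ∀ y, |f y| ≤ 1) (h : ℤ) : ‖dft k f h‖ ≤ 1 := by
  unfold dft
  rw [norm_mul, norm_inv, norm_pow, Complex.norm_two]
  have h2 : (0 : ℝ) < 2 ^ k := by positivity
  rw [inv_mul_le_iff₀ h2, mul_one]
  calc ‖∑ y ∈ range (2 ^ k), (f y : ℂ) * eChar ((h : ℝ) * y / 2 ^ k)‖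
      ≤ ∑ y ∈ range (2 ^ k), ‖(f y : ℂ) * eChar ((h : ℝ) * y / 2 ^ k)‖ := norm_sum_le _ _
    _ ≤ ∑ _y ∈ range (2 ^ k), (1 : ℝ) := Finset.sum_le_sum fun y _ => by
        rw [norm_mul, norm_eChar, mul_one, Complex.norm_real, Real.norm_eq_abs]; exact hf y
    _ = 2 ^ k := by simp

/-- **Fourier inversion on `ℤ/2^kℤ`**: for `f` read modulo `2^k`,
`f(x mod 2^k) = ∑_{h < 2^k} f̂(h) e(−hx/2^k)`. [folklore] -/
theorem dft_inversion (k : ℕ) (f : ℕ → ℝ) (x : ℕ) :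
    (f (x % 2 ^ k) : ℂ) = ∑ h ∈ range (2 ^ k), dft k f h * eChar (-((h : ℝ) * x / 2 ^ k)) := by
  unfold dft
  simp only [Int.cast_natCast]
  have h2 : (2 : ℂ) ^ k ≠ 0 := pow_ne_zero _ two_ne_zero
  -- exchange the sums and use orthogonality
  have hcalc : ∑ h ∈ range (2 ^ k), ((2 : ℂ) ^ k)⁻¹ *
      (∑ y ∈ range (2 ^ k), (f y : ℂ) * eChar ((h : ℝ) * y / 2 ^ k)) * eChar (-((h : ℝ) * x / 2 ^ k)) =
      ((2 : ℂ) ^ k)⁻¹ * ∑ y ∈ range (2 ^ k), (f y : ℂ) *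
        ∑ h ∈ range (2 ^ k), eChar (h * ((((y : ℤ) - x : ℤ) : ℝ) / 2 ^ k)) := by
    calc ∑ h ∈ range (2 ^ k), ((2 : ℂ) ^ k)⁻¹ *
          (∑ y ∈ range (2 ^ k), (f y : ℂ) * eChar ((h : ℝ) * y / 2 ^ k)) * eChar (-((h : ℝ) * x / 2 ^ k))
        = ∑ h ∈ range (2 ^ k), ∑ y ∈ range (2 ^ k), ((2 : ℂ) ^ k)⁻¹ *
            ((f y : ℂ) * (eChar ((h : ℝ) * y / 2 ^ k) * eChar (-((h : ℝ) * x / 2 ^ k)))) := by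
          refine Finset.sum_congr rfl fun h _ => ?_
          rw [Finset.mul_sum, Finset.sum_mul]
          refine Finset.sum_congr rfl fun y _ => by ring
      _ = ∑ y ∈ range (2 ^ k), ∑ h ∈ range (2 ^ k), ((2 : ℂ) ^ k)⁻¹ *
            ((f y : ℂ) * (eChar ((h : ℝ) * y / 2 ^ k) * eChar (-((h : ℝ) * x / 2 ^ k)))) := Finset.sum_comm
      _ = ((2 : ℂ) ^ k)⁻¹ * ∑ y ∈ range (2 ^ k), (f y : ℂ) *
            ∑ h ∈ range (2 ^ k), eChar (h * ((((y : ℤ) - x : ℤ) : ℝ) / 2 ^ k)) := by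
          rw [Finset.mul_sum]
          refine Finset.sum_congr rfl fun y _ => ?_
          rw [Finset.mul_sum, Finset.mul_sum]
          refine Finset.sum_congr rfl fun h _ => ?_
          rw [← eChar_add]
          congr 3
          push_cast; ring
  rw [hcalc]
  simp_rw [sum_eChar_mul_div]
  -- exactly one `y < 2^k` with `2^k ∣ y − x`, namely `y = x mod 2^k`
  have hdvd : ∀ y ∈ range (2 ^ k), ((2 ^ k : ℤ) ∣ (y : ℤ) - x) ↔ y = x % 2 ^ k := by
    intro y hy
    have hy' := mem_range.mp hy
    rw [← Int.modEq_iff_dvd]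
    unfold Int.ModEq
    constructor
    · intro h
      have h' : ((x % 2 ^ k : ℕ) : ℤ) = ((y % 2 ^ k : ℕ) : ℤ) := by push_cast; exact h
      have h'' : x % 2 ^ k = y % 2 ^ k := by exact_mod_cast h'
      rw [Nat.mod_eq_of_lt hy'] at h''
      exact h''.symm
    · intro h
      rw [h]; push_cast; simp
  rw [Finset.sum_congr rfl fun y hy => by rw [if_congr (hdvd y hy) rfl rfl]]
  simp_rw [mul_ite, mul_zero]
  rw [Finset.sum_ite_eq' (range (2 ^ k)) (x % 2 ^ k) (fun y => (f y : ℂ) * ((2 ^ k : ℕ) : ℂ))]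
  rw [if_pos (mem_range.2 (Nat.mod_lt _ (Nat.two_pow_pos k)))]
  push_cast
  field_simp

/-- **The DFT of a Walsh character is its Walsh–Fourier coefficient**: for `T ⊆ [0, ν)`,
`dft ν w_T h = ŵ(h/2^ν) = walshCoeff (T.attachFin hT) (h/2^ν)`. [cite: Bourgain2013MoebiusWalsh, Lemma 1] -/
theorem dft_natWalsh_eq_walshCoeff {ν : ℕ} {T : Finset ℕ} (hT : ∀ t ∈ T, t < ν) (h : ℤ) :
    dft ν (natWalsh T) h = walshCoeff (T.attachFin hT) ((h : ℝ) / 2 ^ ν) := by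
  unfold dft walshCoeff
  congr 1
  rw [← sum_digits_eq_sum_range ν (fun m => ((natWalsh T m : ℝ) : ℂ) * eChar ((h : ℝ) * m / 2 ^ ν))]
  refine Finset.sum_congr rfl fun x _ => ?_
  have h1 : natWalsh T (bitsToNat (List.ofFn x)) = walshSign (T.attachFin hT) x := by
    rw [natWalsh_eq_walshNat T hT]
    unfold walshNat
    congr 1
    funext j
    exact Literature.NumberTheory.Sieve.MoebiusWalsh.testBit_bitsToNat_ofFn x j
  rw [h1]
  congr 1
  congr 1
  ring

/-! ### The DFT of a block function: the Dirichlet-kernel factor -/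

/-- The normalised Dirichlet factor `D_K(h) = 2^{-K} ∑_{z < 2^K} e(hz/2^{K+ν})` of a function of
`⌊x/2^K⌋`. [folklore] -/
def dirichletFactor (K ν : ℕ) (h : ℤ) : ℂ :=
  ((2 : ℂ) ^ K)⁻¹ * ∑ z ∈ range (2 ^ K), eChar ((h : ℝ) * z / 2 ^ (K + ν))

/-- `|D_K(h)| ≤ min(1, 1/(2^{K+1}‖h/2^{K+ν}‖))` (as `geomBound 2^K / 2^K`). [folklore] -/
theorem norm_dirichletFactor_le (K ν : ℕ) (h : ℤ) :
    ‖dirichletFactor K ν h‖ ≤ geomBound ((2 : ℝ) ^ K) ((h : ℝ) / 2 ^ (K + ν)) / 2 ^ K := by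
  unfold dirichletFactor
  rw [norm_mul, norm_inv, norm_pow, Complex.norm_two]
  have h2 : (0 : ℝ) < 2 ^ K := by positivity
  rw [inv_mul_eq_div, div_le_div_iff_of_pos_right h2]
  have h := norm_sum_range_eChar_le (2 ^ K) ((h : ℝ) / 2 ^ (K + ν))
  push_cast at h
  refine le_trans (le_of_eq ?_) h
  congr 1
  refine Finset.sum_congr rfl fun z _ => ?_
  congr 1; ring

/-- `|D_K(h)| ≤ 1`. [folklore] -/
theorem norm_dirichletFactor_le_one (K ν : ℕ) (h : ℤ) : ‖dirichletFactor K ν h‖ ≤ 1 := by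
  refine (norm_dirichletFactor_le K ν h).trans ?_
  have h2 : (0 : ℝ) < 2 ^ K := by positivity
  rw [div_le_one h2]
  exact geomBound_le _ _

/-- **The DFT of a block function factors**: for `f(x) = F(⌊x/2^K⌋)` read modulo `2^{K+ν}`,
`f̂(h) = F̂(h) · D_K(h)` (split `x = z + 2^K y`). [folklore] -/
theorem dft_block (K ν : ℕ) (F : ℕ → ℝ) (h : ℤ) :
    dft (K + ν) (fun x => F (x / 2 ^ K)) h = dft ν F h * dirichletFactor K ν h := by
  unfold dft dirichletFactor
  have hQ : 2 ^ (K + ν) = 2 ^ K * 2 ^ ν := pow_add _ _ _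
  rw [hQ, sum_range_mul_eq_sum_sum _ (2 ^ K) (2 ^ ν)]
  have hK0 : 0 < 2 ^ K := Nat.two_pow_pos K
  have h2K : (2 : ℂ) ^ K ≠ 0 := pow_ne_zero _ two_ne_zero
  have h2ν : (2 : ℂ) ^ ν ≠ 0 := pow_ne_zero _ two_ne_zero
  have hterm : ∀ y ∈ range (2 ^ ν), ∀ z ∈ range (2 ^ K),
      ((F ((z + 2 ^ K * y) / 2 ^ K) : ℝ) : ℂ) * eChar ((h : ℝ) * ((z + 2 ^ K * y : ℕ) : ℝ) / 2 ^ (K + ν)) =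
        ((F y : ℝ) : ℂ) * eChar ((h : ℝ) * y / 2 ^ ν) * eChar ((h : ℝ) * z / 2 ^ (K + ν)) := by
    intro y _ z hz
    have hz' := mem_range.mp hz
    have hdiv : (z + 2 ^ K * y) / 2 ^ K = y := by
      rw [Nat.add_mul_div_left _ _ hK0, Nat.div_eq_of_lt hz', zero_add]
    rw [hdiv, mul_assoc, ← eChar_add]
    congr 2
    have h2r : (2 : ℝ) ^ K ≠ 0 := pow_ne_zero _ two_ne_zero
    push_cast
    rw [pow_add]
    field_simp
    ring
  rw [Finset.sum_congr rfl fun y hy => Finset.sum_congr rfl fun z hz => hterm y hy z hz]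
  simp_rw [← Finset.mul_sum]
  rw [← Finset.sum_mul]
  rw [pow_add]
  field_simp

/-! ### Fejér localisation of the spectrum (replaces Bourgain's Lemma 5, (1.12)–(1.13)) -/

/-- The discrete Fejér mean `g(x) = 2^{-k} ∑_{z < 2^k} K_H(z/2^k) f(x + z)` of a function read
modulo `2^k`. [folklore] -/
def fejerSmooth (k H : ℕ) (f : ℕ → ℝ) (x : ℕ) : ℝ :=
  (∑ z ∈ range (2 ^ k), fejerKernel H ((z : ℝ) / 2 ^ k) * f (x + z)) / 2 ^ k

/-- `|g| ≤ 1` when `|f| ≤ 1` and `H + 1 ≤ 2^k` (the kernel is non-negative of total mass `2^k`).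
[folklore] -/
theorem abs_fejerSmooth_le_one {k H : ℕ} (hH : H + 1 ≤ 2 ^ k) {f : ℕ → ℝ} (hf : ∀ y, |f y| ≤ 1)
    (x : ℕ) : |fejerSmooth k H f x| ≤ 1 := by
  unfold fejerSmooth
  have hQ : (0 : ℝ) < 2 ^ k := by positivity
  rw [abs_div, abs_of_pos hQ, div_le_one hQ]
  have hmass := sum_range_fejerKernel_div hH
  push_cast at hmass
  calc |∑ z ∈ range (2 ^ k), fejerKernel H ((z : ℝ) / 2 ^ k) * f (x + z)|
      ≤ ∑ z ∈ range (2 ^ k), |fejerKernel H ((z : ℝ) / 2 ^ k) * f (x + z)| := abs_sum_le_sum_abs _ _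
    _ ≤ ∑ z ∈ range (2 ^ k), fejerKernel H ((z : ℝ) / 2 ^ k) := by
        refine Finset.sum_le_sum fun z _ => ?_
        rw [abs_mul, abs_of_nonneg (fejerKernel_nonneg _ _)]
        calc _ ≤ fejerKernel H ((z : ℝ) / 2 ^ k) * 1 :=
              mul_le_mul_of_nonneg_left (hf _) (fejerKernel_nonneg _ _)
          _ = _ := mul_one _
    _ = 2 ^ k := hmass

/-- The Fejér multiplier `c_H(d) = #{(n, n') ∈ [1, H+1]² : n − n' = d}/(H + 1) ∈ [0, 1]`. [folklore] -/
def fejerCoeff (H : ℕ) (d : ℤ) : ℝ :=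
  (((Ioc 0 (H + 1) ×ˢ Ioc 0 (H + 1)).filter (fun p : ℕ × ℕ => (p.1 : ℤ) - p.2 = d)).card : ℝ) / (H + 1)

/-- `0 ≤ c_H(d)`. [folklore] -/
theorem fejerCoeff_nonneg (H : ℕ) (d : ℤ) : 0 ≤ fejerCoeff H d := by
  unfold fejerCoeff; positivity

/-- `c_H(d) ≤ 1`. [folklore] -/
theorem fejerCoeff_le_one (H : ℕ) (d : ℤ) : fejerCoeff H d ≤ 1 := by
  unfold fejerCoeff
  have hH : (0 : ℝ) < H + 1 := by positivity
  rw [div_le_one hH]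
  have : ((Ioc 0 (H + 1) ×ˢ Ioc 0 (H + 1)).filter (fun p : ℕ × ℕ => (p.1 : ℤ) - p.2 = d)).card ≤ H + 1 := by
    calc _ ≤ (Ioc 0 (H + 1)).card := by
          refine Finset.card_le_card_of_injOn (fun p => p.2) (fun p hp => ?_) ?_
          · rw [Finset.mem_coe, Finset.mem_filter, Finset.mem_product] at hp
            exact hp.1.2
          · intro p hp p' hp' hpp
            rw [Finset.mem_coe, Finset.mem_filter] at hp hp'
            simp only at hpp
            have h1 : (p.1 : ℤ) = p'.1 := by have := hp.2; have := hp'.2; omega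
            exact Prod.ext (by exact_mod_cast h1) hpp
      _ = H + 1 := by simp
  exact_mod_cast this

/-- **The Fejér mean as a trigonometric polynomial of degree `≤ H`**: if `f` is `2^k`-periodic,
`g(x) = ∑_{|d| ≤ H} c_H(d) f̂(d) e(−dx/2^k)`. [folklore] -/
theorem fejerSmooth_eq_sum {k H : ℕ} {f : ℕ → ℝ} (hf : ∀ y, f (y + 2 ^ k) = f y) (x : ℕ) :
    (fejerSmooth k H f x : ℂ) = ∑ d ∈ Ioo (-((H : ℤ) + 1)) ((H : ℤ) + 1),
      (fejerCoeff H d : ℂ) * dft k f d * eChar (-((d : ℝ) * x / 2 ^ k)) := by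
  classical
  have hQc : ((2 : ℂ) ^ k) ≠ 0 := pow_ne_zero _ two_ne_zero
  have hQr : ((2 : ℝ) ^ k) ≠ 0 := pow_ne_zero _ two_ne_zero
  have hHc : ((H : ℂ) + 1) ≠ 0 := by exact_mod_cast Nat.succ_ne_zero H
  set P : Finset (ℕ × ℕ) := Ioc 0 (H + 1) ×ˢ Ioc 0 (H + 1) with hPdef
  -- the inner sums: shift invariance of full-period sums
  have hinner : ∀ n n' : ℕ,
      ∑ z ∈ range (2 ^ k), (𝐞 (((n : ℝ) - n') * ((z : ℝ) / 2 ^ k)) : ℂ) * (f (x + z) : ℂ) =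
        eChar (-((((n : ℤ) - n' : ℤ) : ℝ) * x / 2 ^ k)) * ((2 : ℂ) ^ k * dft k f ((n : ℤ) - n')) := by
    intro n n'
    set φ : ℕ → ℂ := fun y => (𝐞 (((n : ℝ) - n') * ((y : ℝ) / 2 ^ k)) : ℂ) * (f y : ℂ) with hφ
    have hper : ∀ y, φ (y + 2 ^ k) = φ y := by
      intro y
      simp only [hφ]
      rw [hf]
      congr 1
      have : ((n : ℝ) - n') * ((((y + 2 ^ k : ℕ)) : ℝ) / 2 ^ k) =
          ((n : ℝ) - n') * ((y : ℝ) / 2 ^ k) + ((((n : ℤ) - n' : ℤ)) : ℝ) := by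
        push_cast; field_simp
      rw [this]
      exact Literature.NumberTheory.Sieve.FejerCounting.fourierChar_add_intCast _ _
    have hshift := sum_range_add_of_periodic hper x
    have hstep : ∀ z : ℕ, (𝐞 (((n : ℝ) - n') * ((z : ℝ) / 2 ^ k)) : ℂ) * (f (x + z) : ℂ) =
        eChar (-((((n : ℤ) - n' : ℤ) : ℝ) * x / 2 ^ k)) * φ (x + z) := by
      intro z
      simp only [hφ]
      rw [← mul_assoc]
      congr 1
      rw [eChar_eq_fourierChar, ← Circle.coe_mul, ← AddChar.map_add_eq_mul]
      congr 2
      push_cast; field_simp; ring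
    rw [Finset.sum_congr rfl fun z _ => hstep z, ← Finset.mul_sum, hshift]
    congr 1
    unfold dft
    rw [← mul_assoc, mul_inv_cancel₀ hQc, one_mul]
    refine Finset.sum_congr rfl fun y _ => ?_
    simp only [hφ]
    rw [mul_comm, eChar_eq_fourierChar]
    congr 3
    push_cast; ring
  -- expand the kernel and use the inner sums
  have h1 : (fejerSmooth k H f x : ℂ) =
      ∑ p ∈ P, ((H : ℂ) + 1)⁻¹ * (dft k f ((p.1 : ℤ) - p.2) *
        eChar (-((((p.1 : ℤ) - p.2 : ℤ) : ℝ) * x / 2 ^ k))) := by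
    unfold fejerSmooth
    push_cast
    simp_rw [fejerKernel_eq_sum]
    rw [hPdef, Finset.sum_product, Finset.sum_div]
    have e1 : ∀ z : ℕ, ((H : ℂ) + 1)⁻¹ *
        (∑ n ∈ Ioc 0 (H + 1), ∑ n' ∈ Ioc 0 (H + 1), (𝐞 (((n : ℝ) - n') * ((z : ℝ) / 2 ^ k)) : ℂ)) *
          (f (x + z) : ℂ) / (2 : ℂ) ^ k =
        ∑ n ∈ Ioc 0 (H + 1), ∑ n' ∈ Ioc 0 (H + 1), ((H : ℂ) + 1)⁻¹ * ((2 : ℂ) ^ k)⁻¹ *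
          ((𝐞 (((n : ℝ) - n') * ((z : ℝ) / 2 ^ k)) : ℂ) * (f (x + z) : ℂ)) := by
      intro z
      rw [div_eq_mul_inv, Finset.mul_sum, Finset.sum_mul, Finset.sum_mul]
      refine Finset.sum_congr rfl fun n _ => ?_
      rw [Finset.mul_sum, Finset.sum_mul, Finset.sum_mul]
      refine Finset.sum_congr rfl fun n' _ => ?_
      ring
    rw [Finset.sum_congr rfl fun z _ => e1 z, Finset.sum_comm]
    refine Finset.sum_congr rfl fun n _ => ?_
    rw [Finset.sum_comm]
    refine Finset.sum_congr rfl fun n' _ => ?_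
    rw [← Finset.mul_sum, hinner n n']
    field_simp
    rw [mul_comm]
    congr 2
    push_cast; ring
  rw [h1]
  -- regroup by the difference `d = n − n'`
  have hmaps : ∀ p ∈ P, (p.1 : ℤ) - p.2 ∈ Ioo (-((H : ℤ) + 1)) ((H : ℤ) + 1) := by
    intro p hp
    rw [hPdef, Finset.mem_product, mem_Ioc, mem_Ioc] at hp
    rw [Finset.mem_Ioo]; constructor <;> omega
  rw [← Finset.sum_fiberwise_of_maps_to hmaps]
  refine Finset.sum_congr rfl fun d _ => ?_
  calc ∑ p ∈ P.filter (fun p => (p.1 : ℤ) - p.2 = d), ((H : ℂ) + 1)⁻¹ * (dft k f ((p.1 : ℤ) - p.2) *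
        eChar (-((((p.1 : ℤ) - p.2 : ℤ) : ℝ) * x / 2 ^ k)))
      = ∑ _p ∈ P.filter (fun p => (p.1 : ℤ) - p.2 = d), ((H : ℂ) + 1)⁻¹ * (dft k f d *
        eChar (-((d : ℝ) * x / 2 ^ k))) :=
        Finset.sum_congr rfl fun p hp => by rw [(Finset.mem_filter.mp hp).2]
    _ = (fejerCoeff H d : ℂ) * dft k f d * eChar (-((d : ℝ) * x / 2 ^ k)) := by
        rw [Finset.sum_const, nsmul_eq_mul]
        unfold fejerCoeff
        rw [hPdef]
        push_cast
        field_simp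

/-- `∑_{Z ≤ z} 1/z² ≤ 2/Z` over any finite range (`Z ≥ 1`). [folklore] -/
theorem sum_inv_sq_tail_le {Z : ℕ} (hZ : 1 ≤ Z) (S : Finset ℕ) (hS : ∀ z ∈ S, Z ≤ z) :
    ∑ z ∈ S, ((z : ℝ) ^ 2)⁻¹ ≤ 2 / Z := by
  rcases S.eq_empty_or_nonempty with hS0 | hSne
  · rw [hS0]; simp; positivity
  set n := S.max' hSne + 1 with hn
  have hsub : S ⊆ Ioo (Z - 1) n := by
    intro z hz
    rw [Finset.mem_Ioo]
    have h1 := hS z hz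
    have h2 := S.le_max' z hz
    omega
  calc ∑ z ∈ S, ((z : ℝ) ^ 2)⁻¹ ≤ ∑ z ∈ Ioo (Z - 1) n, ((z : ℝ) ^ 2)⁻¹ :=
        Finset.sum_le_sum_of_subset_of_nonneg hsub fun _ _ _ => by positivity
    _ ≤ 2 / ((Z - 1 : ℕ) + 1) := sum_Ioo_inv_sq_le _ _
    _ = 2 / Z := by
        congr 1
        have : (((Z - 1 : ℕ) : ℝ)) + 1 = ((Z - 1 + 1 : ℕ) : ℝ) := by push_cast; ring
        rw [this, Nat.sub_add_cancel hZ]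

/-- A block function `f(x) = F(⌊x/2^K⌋)` with `F` of period `2^ν` has period `2^{K+ν}`. [folklore] -/
theorem block_periodic {F : ℕ → ℝ} {ν : ℕ} (hF : ∀ y, F (y + 2 ^ ν) = F y) (K x : ℕ) :
    F ((x + 2 ^ (K + ν)) / 2 ^ K) = F (x / 2 ^ K) := by
  rw [pow_add, Nat.add_mul_div_left _ _ (Nat.two_pow_pos K), hF]

/-- **Mean-square error of the Fejér localisation of a block function** (the substitute for
Bourgain 2013, Lemma 5 (1.12): `‖W_A − w_A‖₂ < 2^{-ct}`): for `F` with `|F| ≤ 1` and period `2^ν`,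
`f(x) = F(⌊x/2^K⌋)`, `k = K + ν`, `H + 1 ≤ 2^k` and `1 ≤ Z ≤ 2^K`,
`∑_{x < 2^k} (f(x) − g(x))² ≤ 2^k (4 (2^k/((H+1)Z))² + 8Z/2^K)`
(off the `2Z`-neighbourhood of the block boundaries only the Fejér tail `∑_{|z| ≥ Z} K_H` acts;
on it the error is at most `2`). [cite: Bourgain2013MoebiusWalsh, Lemma 5 (1.12)–(1.13)] -/
theorem sum_sq_sub_fejerSmooth_le {F : ℕ → ℝ} {ν K H Z : ℕ} (hF1 : ∀ y, |F y| ≤ 1)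
    (hF : ∀ y, F (y + 2 ^ ν) = F y) (hH : H + 1 ≤ 2 ^ (K + ν)) (hZ1 : 1 ≤ Z) (hZK : Z ≤ 2 ^ K) :
    ∑ x ∈ range (2 ^ (K + ν)),
        (F (x / 2 ^ K) - fejerSmooth (K + ν) H (fun x => F (x / 2 ^ K)) x) ^ 2 ≤
      2 ^ (K + ν) * (4 * ((2 : ℝ) ^ (K + ν) / ((H + 1) * Z)) ^ 2 + 8 * Z / 2 ^ K) := by
  set k := K + ν with hk
  set f : ℕ → ℝ := fun x => F (x / 2 ^ K) with hfdef
  have hf1 : ∀ x, |f x| ≤ 1 := fun x => hF1 _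
  have hfper : ∀ x, f (x + 2 ^ k) = f x := fun x => block_periodic hF K x
  have hQ : 0 < 2 ^ k := Nat.two_pow_pos k
  have hQr : (0 : ℝ) < (2 : ℝ) ^ k := by positivity
  have hHr : (0 : ℝ) < (H : ℝ) + 1 := by positivity
  have hZr : (0 : ℝ) < Z := by exact_mod_cast hZ1
  set τ : ℝ := (2 : ℝ) ^ k / ((H + 1) * Z) with hτ
  have hτ0 : 0 ≤ τ := by positivity
  have hmass := sum_range_fejerKernel_div hH
  -- the error as a kernel average of differences
  have herr : ∀ x, f x - fejerSmooth k H f x =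
      (∑ z ∈ range (2 ^ k), fejerKernel H ((z : ℝ) / 2 ^ k) * (f x - f (x + z))) / 2 ^ k := by
    intro x
    unfold fejerSmooth
    have : f x = (∑ z ∈ range (2 ^ k), fejerKernel H ((z : ℝ) / 2 ^ k) * f x) / 2 ^ k := by
      rw [← Finset.sum_mul]
      push_cast at hmass
      rw [hmass]
      field_simp
    conv_lhs => rw [this]
    rw [← sub_div, ← Finset.sum_sub_distrib]
    congr 1
    exact Finset.sum_congr rfl fun z _ => by ring
  -- crude pointwise bound `≤ 2`
  have hcrude : ∀ x, |f x - fejerSmooth k H f x| ≤ 2 := by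
    intro x
    calc |f x - fejerSmooth k H f x| ≤ |f x| + |fejerSmooth k H f x| := abs_sub _ _
      _ ≤ 1 + 1 := add_le_add (hf1 x) (abs_fejerSmooth_le_one hH hf1 x)
      _ = 2 := by norm_num
  -- interior points: only the tail of the kernel acts
  have hint : ∀ x, Z ≤ x % 2 ^ K → x % 2 ^ K + Z ≤ 2 ^ K → |f x - fejerSmooth k H f x| ≤ 2 * τ := by
    intro x hx1 hx2
    rw [herr x, abs_div, abs_of_pos hQr, div_le_iff₀ hQr]
    have hvan : ∀ z ∈ range (2 ^ k), z < Z ∨ 2 ^ k - Z < z → f x - f (x + z) = 0 := by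
      intro z hz hz'
      have hzk := mem_range.mp hz
      simp only [hfdef]
      rcases hz' with h | h
      · -- no carry across the block boundary
        have hzK : z < 2 ^ K := by omega
        have : (x + z) / 2 ^ K = x / 2 ^ K := by
          have hmod : x % 2 ^ K + z % 2 ^ K < 2 ^ K := by rw [Nat.mod_eq_of_lt hzK]; omega
          rw [Nat.add_div_eq_of_add_mod_lt hmod, Nat.div_eq_of_lt hzK, add_zero]
        rw [this, sub_self]
      · -- `x + z = (x - z') + 2^k` with `z' = 2^k - z < Z`
        have hxz : 2 ^ k - z ≤ x := by
          have : x % 2 ^ K ≤ x := Nat.mod_le _ _; omega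
        have e : x + z = (x - (2 ^ k - z)) + 2 ^ k := by omega
        have hper := block_periodic hF K (x - (2 ^ k - z))
        rw [show K + ν = k from rfl] at hper
        rw [e, hper]
        have : (x - (2 ^ k - z)) / 2 ^ K = x / 2 ^ K := by
          have e1 := Nat.div_add_mod' x (2 ^ K)
          have e2 := Nat.lt_div_mul_add (a := x) (Nat.two_pow_pos K)
          refine Nat.div_eq_of_lt_le (by omega) ?_
          rw [Nat.succ_mul]; omega
        rw [this, sub_self]
    calc |∑ z ∈ range (2 ^ k), fejerKernel H ((z : ℝ) / 2 ^ k) * (f x - f (x + z))|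
        ≤ ∑ z ∈ range (2 ^ k), |fejerKernel H ((z : ℝ) / 2 ^ k) * (f x - f (x + z))| := abs_sum_le_sum_abs _ _
      _ = ∑ z ∈ (range (2 ^ k)).filter (fun z => Z ≤ z ∧ z ≤ 2 ^ k - Z),
            |fejerKernel H ((z : ℝ) / 2 ^ k) * (f x - f (x + z))| := by
          symm
          refine Finset.sum_subset (Finset.filter_subset _ _) fun z hz hz' => ?_
          simp only [Finset.mem_filter, not_and_or, not_le] at hz'
          rcases hz' with h | h | h
          · exact absurd hz h
          · rw [hvan z hz (Or.inl h), mul_zero, abs_zero]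
          · rw [hvan z hz (Or.inr h), mul_zero, abs_zero]
      _ ≤ ∑ z ∈ (range (2 ^ k)).filter (fun z => Z ≤ z ∧ z ≤ 2 ^ k - Z),
            (2 ^ k : ℝ) ^ 2 / (4 * (H + 1) * ((min z (2 ^ k - z) : ℕ) : ℝ) ^ 2) * 2 := by
          refine Finset.sum_le_sum fun z hz => ?_
          rw [Finset.mem_filter, mem_range] at hz
          rw [abs_mul, abs_of_nonneg (fejerKernel_nonneg _ _)]
          refine mul_le_mul ?_ ?_ (abs_nonneg _) (by positivity)
          · have := fejerKernel_natCast_div_le H (M := 2 ^ k) (z := z) (by omega) hz.1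
            rw [Nat.cast_pow, Nat.cast_ofNat] at this
            exact this
          · calc |f x - f (x + z)| ≤ |f x| + |f (x + z)| := abs_sub _ _
              _ ≤ 1 + 1 := add_le_add (hf1 _) (hf1 _)
              _ = 2 := by norm_num
      _ = (2 ^ k : ℝ) ^ 2 / (2 * (H + 1)) * ∑ z ∈ (range (2 ^ k)).filter (fun z => Z ≤ z ∧ z ≤ 2 ^ k - Z),
            ((((min z (2 ^ k - z) : ℕ) : ℝ)) ^ 2)⁻¹ := by
          rw [Finset.mul_sum]
          refine Finset.sum_congr rfl fun z hz => ?_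
          rw [Finset.mem_filter, mem_range] at hz
          have hm : (0 : ℝ) < ((min z (2 ^ k - z) : ℕ) : ℝ) := by
            have : 0 < min z (2 ^ k - z) := lt_min (by omega) (by omega)
            exact_mod_cast this
          field_simp
          ring
      _ ≤ (2 ^ k : ℝ) ^ 2 / (2 * (H + 1)) * (4 / Z) := by
          refine mul_le_mul_of_nonneg_left ?_ (by positivity)
          -- split according to which term attains the minimum
          set S := (range (2 ^ k)).filter (fun z => Z ≤ z ∧ z ≤ 2 ^ k - Z) with hS
          have hsplit := Finset.sum_filter_add_sum_filter_not S (fun z => z ≤ 2 ^ k - z)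
            (fun z => ((((min z (2 ^ k - z) : ℕ) : ℝ)) ^ 2)⁻¹)
          rw [← hsplit]
          have hA : ∑ z ∈ S.filter (fun z => z ≤ 2 ^ k - z), ((((min z (2 ^ k - z) : ℕ) : ℝ)) ^ 2)⁻¹ ≤ 2 / Z := by
            calc _ = ∑ z ∈ S.filter (fun z => z ≤ 2 ^ k - z), (((z : ℝ)) ^ 2)⁻¹ := by
                  refine Finset.sum_congr rfl fun z hz => ?_
                  rw [Finset.mem_filter] at hz
                  rw [min_eq_left hz.2]
              _ ≤ 2 / Z := sum_inv_sq_tail_le hZ1 _ fun z hz => by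
                  rw [Finset.mem_filter, hS, Finset.mem_filter] at hz; exact hz.1.2.1
          have hB : ∑ z ∈ S.filter (fun z => ¬ z ≤ 2 ^ k - z), ((((min z (2 ^ k - z) : ℕ) : ℝ)) ^ 2)⁻¹ ≤ 2 / Z := by
            calc _ = ∑ z ∈ S.filter (fun z => ¬ z ≤ 2 ^ k - z), ((((2 ^ k - z : ℕ) : ℝ)) ^ 2)⁻¹ := by
                  refine Finset.sum_congr rfl fun z hz => ?_
                  rw [Finset.mem_filter] at hz
                  rw [min_eq_right (by omega)]
              _ = ∑ w ∈ (S.filter (fun z => ¬ z ≤ 2 ^ k - z)).image (fun z : ℕ => (2 ^ k - z : ℕ)),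
                    ((((w : ℕ) : ℝ)) ^ 2)⁻¹ := by
                  rw [Finset.sum_image]
                  intro z hz z' hz' h
                  rw [Finset.mem_coe, Finset.mem_filter, hS, Finset.mem_filter, mem_range] at hz hz'
                  simp only at h
                  omega
              _ ≤ 2 / Z := sum_inv_sq_tail_le hZ1 _ fun w hw => by
                  rw [Finset.mem_image] at hw
                  obtain ⟨z, hz, rfl⟩ := hw
                  rw [Finset.mem_filter, hS, Finset.mem_filter] at hz
                  omega
          calc _ ≤ 2 / (Z : ℝ) + 2 / Z := add_le_add hA hB
            _ = 4 / Z := by ring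
      _ = 2 * τ * 2 ^ k := by rw [hτ]; field_simp; ring
  -- the boundary set is small
  have hbdry : (((range (2 ^ k)).filter (fun x => ¬ (Z ≤ x % 2 ^ K ∧ x % 2 ^ K + Z ≤ 2 ^ K))).card : ℝ) ≤
      2 ^ ν * (2 * Z) := by
    have hcount : ((range (2 ^ k)).filter (fun x => ¬ (Z ≤ x % 2 ^ K ∧ x % 2 ^ K + Z ≤ 2 ^ K))).card =
        2 ^ ν * ((range (2 ^ K)).filter (fun r => ¬ (Z ≤ r ∧ r + Z ≤ 2 ^ K))).card := by
      rw [Finset.card_filter, Finset.card_filter, show (2 : ℕ) ^ k = 2 ^ K * 2 ^ ν by rw [← pow_add],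
        sum_range_mul_eq_sum_sum _ (2 ^ K) (2 ^ ν)]
      have hin : ∀ y ∈ range (2 ^ ν), ∀ r ∈ range (2 ^ K),
          (if ¬ (Z ≤ (r + 2 ^ K * y) % 2 ^ K ∧ (r + 2 ^ K * y) % 2 ^ K + Z ≤ 2 ^ K) then 1 else 0) =
            (if ¬ (Z ≤ r ∧ r + Z ≤ 2 ^ K) then 1 else 0) := by
        intro y _ r hr
        have : (r + 2 ^ K * y) % 2 ^ K = r := by
          rw [Nat.add_mul_mod_self_left, Nat.mod_eq_of_lt (mem_range.mp hr)]
        rw [this]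
      rw [Finset.sum_congr rfl fun y hy => Finset.sum_congr rfl fun r hr => hin y hy r hr, Finset.sum_const,
        Finset.card_range, smul_eq_mul]
    have hsmall : ((range (2 ^ K)).filter (fun r => ¬ (Z ≤ r ∧ r + Z ≤ 2 ^ K))).card ≤ 2 * Z := by
      have hsub : (range (2 ^ K)).filter (fun r => ¬ (Z ≤ r ∧ r + Z ≤ 2 ^ K)) ⊆ range Z ∪ Ico (2 ^ K + 1 - Z) (2 ^ K) := by
        intro r hr
        rw [Finset.mem_filter, mem_range, not_and_or, not_le, not_le] at hr
        rw [Finset.mem_union, mem_range, mem_Ico]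
        omega
      calc _ ≤ (range Z ∪ Ico (2 ^ K + 1 - Z) (2 ^ K)).card := Finset.card_le_card hsub
        _ ≤ (range Z).card + (Ico (2 ^ K + 1 - Z) (2 ^ K)).card := Finset.card_union_le _ _
        _ ≤ 2 * Z := by rw [Finset.card_range, Nat.card_Ico]; omega
    rw [hcount]; push_cast
    exact mul_le_mul_of_nonneg_left (by exact_mod_cast hsmall) (by positivity)
  -- assemble
  set B := (range (2 ^ k)).filter (fun x => ¬ (Z ≤ x % 2 ^ K ∧ x % 2 ^ K + Z ≤ 2 ^ K)) with hB
  set G := (range (2 ^ k)).filter (fun x => Z ≤ x % 2 ^ K ∧ x % 2 ^ K + Z ≤ 2 ^ K) with hG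
  have hsplit := Finset.sum_filter_add_sum_filter_not (range (2 ^ k))
    (fun x => Z ≤ x % 2 ^ K ∧ x % 2 ^ K + Z ≤ 2 ^ K) (fun x => (f x - fejerSmooth k H f x) ^ 2)
  show ∑ x ∈ range (2 ^ k), (f x - fejerSmooth k H f x) ^ 2 ≤ 2 ^ k * (4 * τ ^ 2 + 8 * Z / 2 ^ K)
  rw [← hsplit, ← hG, ← hB]
  have hGsum : ∑ x ∈ G, (f x - fejerSmooth k H f x) ^ 2 ≤ (2 ^ k : ℝ) * (2 * τ) ^ 2 := by
    calc ∑ x ∈ G, (f x - fejerSmooth k H f x) ^ 2 ≤ ∑ _x ∈ G, (2 * τ) ^ 2 := by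
          refine Finset.sum_le_sum fun x hx => ?_
          rw [hG, Finset.mem_filter] at hx
          have h := hint x hx.2.1 hx.2.2
          rw [← sq_abs]
          exact pow_le_pow_left₀ (abs_nonneg _) h 2
      _ = (G.card : ℝ) * (2 * τ) ^ 2 := by rw [Finset.sum_const, nsmul_eq_mul]
      _ ≤ (2 ^ k : ℝ) * (2 * τ) ^ 2 := by
          refine mul_le_mul_of_nonneg_right ?_ (by positivity)
          have : G.card ≤ 2 ^ k := (Finset.card_filter_le _ _).trans (Finset.card_range _).le
          exact_mod_cast this
  have hBsum : ∑ x ∈ B, (f x - fejerSmooth k H f x) ^ 2 ≤ 2 ^ ν * (2 * Z) * 4 := by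
    calc ∑ x ∈ B, (f x - fejerSmooth k H f x) ^ 2 ≤ ∑ _x ∈ B, (4 : ℝ) := by
          refine Finset.sum_le_sum fun x _ => ?_
          have h := hcrude x
          rw [← sq_abs]
          nlinarith [abs_nonneg (f x - fejerSmooth k H f x)]
      _ = (B.card : ℝ) * 4 := by rw [Finset.sum_const, nsmul_eq_mul]
      _ ≤ 2 ^ ν * (2 * Z) * 4 := mul_le_mul_of_nonneg_right hbdry (by norm_num)
  have hkpow : (2 : ℝ) ^ k = 2 ^ K * 2 ^ ν := by rw [← pow_add]
  have hK0 : (0 : ℝ) < 2 ^ K := by positivity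
  calc ∑ x ∈ G, (f x - fejerSmooth k H f x) ^ 2 + ∑ x ∈ B, (f x - fejerSmooth k H f x) ^ 2
      ≤ (2 ^ k : ℝ) * (2 * τ) ^ 2 + 2 ^ ν * (2 * Z) * 4 := add_le_add hGsum hBsum
    _ = 2 ^ k * (4 * τ ^ 2 + 8 * Z / 2 ^ K) := by rw [hkpow]; field_simp; ring

/-! ### Counting resonances: separated points, grids, progressions -/

/-- **Few separated points near an integer**: if the points `x i`, `i ∈ S`, are pairwise
`δ`-separated modulo `1` (`δ > 0`), then `#{i : ‖x i‖ < η} ≤ 2(η/δ + 1)`. [folklore] -/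
theorem card_filter_distInt_lt_le {ι : Type*} (S : Finset ι) (x : ι → ℝ) {δ : ℝ} (hδ : 0 < δ)
    (hsep : ∀ i ∈ S, ∀ j ∈ S, i ≠ j → δ ≤ distInt (x i - x j)) {η : ℝ} (hη : 0 ≤ η) :
    ((S.filter fun i => distInt (x i) < η).card : ℝ) ≤ 2 * (η / δ + 1) := by
  classical
  set m : ℕ := ⌊η / δ⌋₊ with hm
  -- bin by `⌊distInt / δ⌋ ∈ [0, m]`
  have hmaps : ∀ i ∈ S.filter (fun i => distInt (x i) < η), ⌊distInt (x i) / δ⌋₊ ∈ range (m + 1) := by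
    intro i hi
    rw [Finset.mem_filter] at hi
    rw [mem_range, Nat.lt_succ_iff, hm]
    exact Nat.floor_le_floor (div_le_div_of_nonneg_right hi.2.le hδ.le)
  have hcard := Finset.card_le_mul_card_image_of_maps_to (n := 2) hmaps ?_
  · calc ((S.filter fun i => distInt (x i) < η).card : ℝ) ≤ (2 * (range (m + 1)).card : ℕ) := by
          exact_mod_cast hcard
      _ = 2 * ((m : ℝ) + 1) := by rw [Finset.card_range]; push_cast; ring
      _ ≤ 2 * (η / δ + 1) := by
          have : (m : ℝ) ≤ η / δ := Nat.floor_le (by positivity)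
          linarith
  · intro s _
    calc ((S.filter fun i => distInt (x i) < η).filter (fun i => ⌊distInt (x i) / δ⌋₊ = s)).card
        ≤ (S.filter fun i => s * δ ≤ distInt (x i) ∧ distInt (x i) < s * δ + δ).card := by
          refine Finset.card_le_card fun i hi => ?_
          rw [Finset.mem_filter, Finset.mem_filter] at hi
          rw [Finset.mem_filter]
          refine ⟨hi.1.1, ?_, ?_⟩
          · have h0 := Nat.floor_le (div_nonneg (distInt_nonneg (x i)) hδ.le)
            rw [hi.2] at h0
            rwa [le_div_iff₀ hδ] at h0
          · have h0 := Nat.lt_floor_add_one (distInt (x i) / δ)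
            rw [hi.2, div_lt_iff₀ hδ] at h0
            linarith
      _ ≤ 2 := card_filter_distInt_mem_Ico_le_two S x hsep _

/-- The `2^m` points `c d'/2^m + ψ`, `c < 2^m`, `d'` odd, are `2^{-m}`-separated modulo `1`.
[folklore] -/
theorem separated_odd_mul_div {m d' : ℕ} (hd' : Odd d') (ψ : ℝ) :
    ∀ c ∈ range (2 ^ m), ∀ c' ∈ range (2 ^ m), c ≠ c' →
      1 / (2 : ℝ) ^ m ≤ distInt (((c : ℝ) * d' / 2 ^ m + ψ) - ((c' : ℝ) * d' / 2 ^ m + ψ)) := by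
  intro c hc c' hc' hcc'
  have hc := mem_range.mp hc; have hc' := mem_range.mp hc'
  have heq : ((c : ℝ) * d' / 2 ^ m + ψ) - ((c' : ℝ) * d' / 2 ^ m + ψ) =
      ((((c : ℤ) - c') * d' : ℤ) : ℝ) / ((2 ^ m : ℕ) : ℝ) := by push_cast; ring
  rw [heq]
  have h := one_div_le_distInt_int_div (Nat.two_pow_pos m) (p := ((c : ℤ) - c') * d') ?_
  · simpa using h
  · intro hdvd
    have hcop : IsCoprime ((2 ^ m : ℕ) : ℤ) (d' : ℤ) := by
      rw [Int.isCoprime_iff_gcd_eq_one]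
      have h2d : Nat.Coprime 2 d' :=
        Nat.prime_two.coprime_iff_not_dvd.2 fun h => by have := Nat.odd_iff.mp hd'; omega
      have : Nat.Coprime (2 ^ m) d' := Nat.Coprime.pow_left m h2d
      exact_mod_cast this
    have h1 : ((2 ^ m : ℕ) : ℤ) ∣ (c : ℤ) - c' := hcop.dvd_of_dvd_mul_right hdvd
    have h2 : |(c : ℤ) - c'| < ((2 ^ m : ℕ) : ℤ) := by rw [abs_lt]; constructor <;> omega
    have := Int.eq_zero_of_abs_lt_dvd h1 h2
    omega

/-- **Residues of an odd multiple near an integer**: for `d'` odd, any real `ψ` and `η ≥ 0`,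
`#{c < 2^m : ‖c d'/2^m + ψ‖ < η} ≤ 2(η 2^m + 1)`. [folklore] -/
theorem card_filter_odd_mul_lt_le {m d' : ℕ} (hd' : Odd d') (ψ : ℝ) {η : ℝ} (hη : 0 ≤ η) :
    (((range (2 ^ m)).filter fun c : ℕ => distInt (((c : ℕ) : ℝ) * d' / 2 ^ m + ψ) < η).card : ℝ) ≤
      2 * (η * 2 ^ m + 1) := by
  have h := card_filter_distInt_lt_le (range (2 ^ m)) (fun c : ℕ => (c : ℝ) * d' / 2 ^ m + ψ)
    (δ := 1 / (2 : ℝ) ^ m) (by positivity) (separated_odd_mul_div hd' ψ) hη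
  refine h.trans (le_of_eq ?_)
  field_simp

/-- The number of elements of a given residue class modulo `P ≥ 1` in an interval of `N`
consecutive integers is at most `N/P + 1`. [folklore] -/
theorem card_filter_Ico_mod_eq_le {P : ℕ} (hP : 0 < P) (N₀ N c : ℕ) :
    ((Ico N₀ (N₀ + N)).filter (fun b => b % P = c)).card ≤ N / P + 1 := by
  classical
  calc ((Ico N₀ (N₀ + N)).filter (fun b => b % P = c)).card ≤ (range (N / P + 1)).card := by
        refine Finset.card_le_card_of_injOn (fun b => (b - N₀) / P) (fun b hb => ?_) ?_
        · rw [Finset.mem_coe, Finset.mem_filter, mem_Ico] at hb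
          rw [Finset.mem_coe, mem_range, Nat.lt_succ_iff]
          exact Nat.div_le_div_right (by omega)
        · intro b hb b' hb' h
          rw [Finset.mem_coe, Finset.mem_filter, mem_Ico] at hb hb'
          simp only at h
          -- same quotient and same residue force equality
          wlog hle : b' ≤ b generalizing b b'
          · exact (this hb' hb h.symm (by omega)).symm
          have hq1 := Nat.lt_div_mul_add (a := b - N₀) hP
          have hq2 := Nat.div_mul_le_self (b' - N₀) P
          rw [h] at hq1
          have hlt : b - b' < P := by omega
          have hdvd : P ∣ b - b' := Nat.dvd_of_mod_eq_zero (Nat.sub_mod_eq_zero_of_mod_eq (hb.2.trans hb'.2.symm))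
          have := Nat.eq_zero_of_dvd_of_lt hdvd hlt
          omega
    _ = N / P + 1 := Finset.card_range _

/-- **Counting `b` in an interval with `‖(2^r d' b + ψ)/2^ν‖ < δ`** (`d'` odd, `r ≤ ν`): at most
`2(δ 2^{ν−r} + 1)(N/2^{ν−r} + 1)` (the phase only depends on `b mod 2^{ν−r}`, through a permutation
of the residues). [cite: Bourgain2013MoebiusWalsh, (2.16)–(2.18)] -/
theorem card_filter_phase_lt_le {ν r d' : ℕ} (hr : r ≤ ν) (hd' : Odd d') (ψ : ℝ) {δ : ℝ} (hδ : 0 ≤ δ)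
    (N₀ N : ℕ) :
    (((Ico N₀ (N₀ + N)).filter fun b : ℕ =>
        distInt (((2 : ℝ) ^ r * d' * b + ψ) / 2 ^ ν) < δ).card : ℝ) ≤
      2 * (δ * 2 ^ (ν - r) + 1) * ((N / 2 ^ (ν - r) : ℕ) + 1) := by
  classical
  set m := ν - r with hm
  have hP : 0 < 2 ^ m := Nat.two_pow_pos m
  have hνr : (2 : ℝ) ^ ν = 2 ^ r * 2 ^ m := by rw [← pow_add, hm, Nat.add_sub_cancel' hr]
  set B := (Ico N₀ (N₀ + N)).filter fun b : ℕ => distInt (((2 : ℝ) ^ r * d' * b + ψ) / 2 ^ ν) < δ with hB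
  set C := (range (2 ^ m)).filter fun c : ℕ => distInt (((c : ℕ) : ℝ) * d' / 2 ^ m + ψ / 2 ^ ν) < δ with hC
  -- the phase depends on `b mod 2^m` only
  have hphase : ∀ b : ℕ, distInt (((2 : ℝ) ^ r * d' * b + ψ) / 2 ^ ν) =
      distInt ((((b % 2 ^ m : ℕ) : ℝ)) * d' / 2 ^ m + ψ / 2 ^ ν) := by
    intro b
    have hb : (b : ℝ) = ((b % 2 ^ m : ℕ) : ℝ) + 2 ^ m * ((b / 2 ^ m : ℕ) : ℝ) := by
      exact_mod_cast (Nat.mod_add_div b (2 ^ m)).symm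
    generalize b / 2 ^ m = qb at hb
    generalize b % 2 ^ m = rb at hb ⊢
    have h2 : (2 : ℝ) ^ m ≠ 0 := pow_ne_zero _ two_ne_zero
    have h2r : (2 : ℝ) ^ r ≠ 0 := pow_ne_zero _ two_ne_zero
    have : ((2 : ℝ) ^ r * d' * b + ψ) / 2 ^ ν =
        ((rb : ℕ) : ℝ) * d' / 2 ^ m + ψ / 2 ^ ν + (((d' * qb : ℕ) : ℤ) : ℝ) := by
      rw [hνr, hb]; push_cast; field_simp; ring
    rw [this, distInt_add_int]
  have himage : B.image (fun b => b % 2 ^ m) ⊆ C := by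
    intro c hc
    rw [Finset.mem_image] at hc
    obtain ⟨b, hb, rfl⟩ := hc
    rw [hB, Finset.mem_filter] at hb
    rw [hC, Finset.mem_filter, mem_range]
    exact ⟨Nat.mod_lt _ hP, by rw [← hphase]; exact hb.2⟩
  have hfib : ∀ c ∈ B.image (fun b => b % 2 ^ m), (B.filter fun b => b % 2 ^ m = c).card ≤ N / 2 ^ m + 1 := by
    intro c _
    calc (B.filter fun b => b % 2 ^ m = c).card
        ≤ ((Ico N₀ (N₀ + N)).filter fun b => b % 2 ^ m = c).card :=
          Finset.card_le_card (Finset.filter_subset_filter _ (Finset.filter_subset _ _))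
      _ ≤ N / 2 ^ m + 1 := card_filter_Ico_mod_eq_le hP N₀ N c
  have hcard := Finset.card_le_mul_card_image B (N / 2 ^ m + 1) hfib
  have hC' : (C.card : ℝ) ≤ 2 * (δ * 2 ^ m + 1) := card_filter_odd_mul_lt_le hd' (ψ / 2 ^ ν) hδ
  calc (B.card : ℝ) ≤ ((N / 2 ^ m + 1 : ℕ) : ℝ) * (B.image (fun b => b % 2 ^ m)).card := by exact_mod_cast hcard
    _ ≤ ((N / 2 ^ m + 1 : ℕ) : ℝ) * C.card := by
        refine mul_le_mul_of_nonneg_left ?_ (by positivity)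
        exact_mod_cast Finset.card_le_card himage
    _ ≤ ((N / 2 ^ m + 1 : ℕ) : ℝ) * (2 * (δ * 2 ^ m + 1)) := mul_le_mul_of_nonneg_left hC' (by positivity)
    _ = _ := by push_cast; ring

/-- **Resonance forces the constant phase near the grid** ((2.17) in Bourgain 2013): if
`‖(2^r d' b + ψ)/2^ν‖ < δ` for some integer `b` (`r ≤ ν`), then `‖ψ/2^r‖ < 2^{ν−r} δ + ε` for
every `ε > 0`; precisely `‖ψ/2^r‖ ≤ 2^{ν-r} ‖(2^r d' b + ψ)/2^ν‖`.
[cite: Bourgain2013MoebiusWalsh, (2.17)] -/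
theorem distInt_div_two_pow_le {ν r : ℕ} (hr : r ≤ ν) (d' b : ℕ) (ψ : ℝ) :
    distInt (ψ / 2 ^ r) ≤ 2 ^ (ν - r) * distInt (((2 : ℝ) ^ r * d' * b + ψ) / 2 ^ ν) := by
  have hνr : (2 : ℝ) ^ ν = 2 ^ r * 2 ^ (ν - r) := by rw [← pow_add, Nat.add_sub_cancel' hr]
  have h2 : (2 : ℝ) ^ (ν - r) ≠ 0 := pow_ne_zero _ two_ne_zero
  have h2r : (2 : ℝ) ^ r ≠ 0 := pow_ne_zero _ two_ne_zero
  have h := Literature.NumberTheory.LFunctions.MoebiusWalshTypeII.distInt_nat_mul_le (2 ^ (ν - r)) (((2 : ℝ) ^ r * d' * b + ψ) / 2 ^ ν)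
  have heq : ((2 ^ (ν - r) : ℕ) : ℝ) * (((2 : ℝ) ^ r * d' * b + ψ) / 2 ^ ν) = ψ / 2 ^ r + ((d' * b : ℕ) : ℤ) := by
    rw [hνr]; push_cast; field_simp; ring
  rw [heq, distInt_add_int] at h
  push_cast at h
  exact h

/-- **Residues `c mod 2^r` with `‖cℓ/2^r‖ < η` are few**: at most `2(η 2^r + gcd(ℓ, 2^r))`
(decompose `c = c₁ + (2^r/g)c₂`; the `2^r/g` points `c₁ℓ/2^r` run through the `g⁻¹2^r`-th roots
grid). [cite: Bourgain2013MoebiusWalsh, (2.17)] -/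
theorem card_filter_mul_div_lt_le (r n : ℕ) {η : ℝ} (hη : 0 ≤ η) :
    (((range (2 ^ r)).filter fun c : ℕ => distInt (((c : ℕ) : ℝ) * n / 2 ^ r) < η).card : ℝ) ≤
      2 * (η * 2 ^ r + Nat.gcd n (2 ^ r)) := by
  classical
  have hQ : 0 < 2 ^ r := Nat.two_pow_pos r
  have hg0 : 0 < Nat.gcd n (2 ^ r) := Nat.gcd_pos_of_pos_right n hQ
  obtain ⟨d, hd⟩ : Nat.gcd n (2 ^ r) ∣ 2 ^ r := Nat.gcd_dvd_right n (2 ^ r)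
  obtain ⟨n', hn'⟩ : Nat.gcd n (2 ^ r) ∣ n := Nat.gcd_dvd_left n (2 ^ r)
  generalize hg : Nat.gcd n (2 ^ r) = g at hg0 hd hn'
  have hd0 : 0 < d := Nat.pos_of_ne_zero fun h => by rw [h, mul_zero] at hd; omega
  have hcop : Nat.Coprime n' d := by
    have h := Nat.coprime_div_gcd_div_gcd (m := n) (n := 2 ^ r) (hg ▸ hg0)
    rw [hg] at h
    have e1 : n / g = n' := by rw [hn', Nat.mul_div_cancel_left _ hg0]
    have e2 : 2 ^ r / g = d := by rw [hd, Nat.mul_div_cancel_left _ hg0]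
    rwa [e1, e2] at h
  -- `d` is a power of two
  obtain ⟨m, -, hdm⟩ : ∃ m ≤ r, d = 2 ^ m := (Nat.dvd_prime_pow Nat.prime_two).1 ⟨g, by rw [hd, mul_comm]⟩
  have hQr : ((2 : ℝ) ^ r) = (d : ℝ) * g := by
    rw [show (2 : ℝ) ^ r = ((2 ^ r : ℕ) : ℝ) by push_cast; ring, hd]; push_cast; ring
  have hd0r : (0 : ℝ) < d := by exact_mod_cast hd0
  have hg0r : (0 : ℝ) < g := by exact_mod_cast hg0
  -- split `c = c₁ + d c₂`
  rw [Finset.card_filter, show (2 : ℕ) ^ r = d * g by rw [hd, mul_comm], sum_range_mul_eq_sum_sum _ d g]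
  have hred : ∀ c₂ ∈ range g, ∀ c₁ ∈ range d,
      (if distInt ((((c₁ + d * c₂ : ℕ) : ℕ) : ℝ) * n / 2 ^ r) < η then 1 else 0) =
        (if distInt (((c₁ : ℕ) : ℝ) * n' / 2 ^ m + 0) < η then 1 else 0) := by
    intro c₂ _ c₁ _
    have : (((c₁ + d * c₂ : ℕ) : ℕ) : ℝ) * n / 2 ^ r = ((c₁ : ℕ) : ℝ) * n' / 2 ^ m + 0 + ((c₂ * n' : ℕ) : ℤ) := by
      rw [hQr, hn', hdm]; push_cast
      have : (2 : ℝ) ^ m ≠ 0 := pow_ne_zero _ two_ne_zero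
      field_simp; ring
    rw [this, distInt_add_int]
  rw [Finset.sum_congr rfl fun c₂ hc₂ => Finset.sum_congr rfl fun c₁ hc₁ => hred c₂ hc₂ c₁ hc₁, Finset.sum_const,
    Finset.card_range, smul_eq_mul, ← Finset.card_filter]
  push_cast
  -- the inner count, by the odd-multiple lemma (or trivially if `d = 1`)
  have hinner : ((((range d).filter fun c₁ : ℕ => distInt (((c₁ : ℕ) : ℝ) * n' / 2 ^ m + 0) < η).card : ℕ) : ℝ) ≤
      2 * (η * d + 1) := by
    rcases Nat.even_or_odd n' with hev | hodd
    · -- `n'` even forces `d = 1` (coprimality with a power of two)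
      have hm0 : m = 0 := by
        by_contra hm0
        have h2d : 2 ∣ d := by rw [hdm]; exact dvd_pow_self 2 hm0
        have h2n : 2 ∣ n' := even_iff_two_dvd.mp hev
        have := Nat.eq_one_of_dvd_one (hcop ▸ Nat.dvd_gcd h2n h2d)
        omega
      have hd1 : d = 1 := by rw [hdm, hm0, pow_zero]
      calc _ ≤ (((range d).card : ℕ) : ℝ) := by exact_mod_cast Finset.card_filter_le _ _
        _ = 1 := by rw [Finset.card_range, hd1]; simp
        _ ≤ 2 * (η * d + 1) := by nlinarith [mul_nonneg hη hd0r.le]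
    · rw [hdm]; push_cast
      exact card_filter_odd_mul_lt_le hodd 0 hη
  calc (g : ℝ) * ((((range d).filter fun c₁ : ℕ => distInt (((c₁ : ℕ) : ℝ) * n' / 2 ^ m + 0) < η).card : ℕ) : ℝ)
      ≤ g * (2 * (η * d + 1)) := mul_le_mul_of_nonneg_left hinner hg0r.le
    _ = 2 * (η * 2 ^ r + g) := by rw [hQr]; ring

/-- `(h + h') ≡ 0 (mod P)` iff `h ≡ −h' (mod P)`, in `ℕ`. [folklore] -/
theorem add_mod_eq_zero_iff {P : ℕ} (hP : 0 < P) (h h' : ℕ) :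
    (h + h') % P = 0 ↔ h % P = (P - h' % P) % P := by
  have ha := Nat.mod_lt h hP
  have hb := Nat.mod_lt h' hP
  rw [Nat.add_mod]
  generalize h % P = a at ha ⊢
  generalize h' % P = b at hb ⊢
  rcases Nat.eq_zero_or_pos b with hb0 | hb0
  · subst hb0
    rw [Nat.sub_zero, Nat.mod_self, add_zero, Nat.mod_eq_of_lt ha]
  · rw [Nat.mod_eq_of_lt (by omega : P - b < P)]
    rcases Nat.lt_or_ge (a + b) P with h1 | h1
    · rw [Nat.mod_eq_of_lt h1]; omega
    · rw [Nat.mod_eq_sub_mod h1, Nat.mod_eq_of_lt (by omega : a + b - P < P)]; omega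

/-- **Counting a linear phase near the integers** (the count behind (2.24)–(2.25) of Bourgain
2013): for `n ≥ 1`, `Q > 0`, `δ ≥ 0`, a real shift `ψ` and an interval of `N` consecutive integers,
`#{b : ‖(nb + ψ)/Q‖ < δ} ≤ (nN/Q + 2)(2δQ/n + 1)` (the nearest integer to `(nb+ψ)/Q` takes at most
`nN/Q + 2` values, each on a run of `b` of length `< 2δQ/n + 1`). [cite: Bourgain2013MoebiusWalsh, (2.24)–(2.25)] -/
theorem card_filter_linear_lt_le {n : ℕ} (hn : 0 < n) {Q : ℝ} (hQ : 0 < Q) (ψ : ℝ) {δ : ℝ} (hδ : 0 ≤ δ)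
    (N₀ N : ℕ) :
    ((((Ico N₀ (N₀ + N)).filter fun b : ℕ => distInt (((n : ℝ) * b + ψ) / Q) < δ).card : ℕ) : ℝ) ≤
      ((n : ℝ) * N / Q + 2) * (2 * δ * Q / n + 1) := by
  classical
  set x : ℕ → ℝ := fun b => ((n : ℝ) * b + ψ) / Q with hx
  set B := (Ico N₀ (N₀ + N)).filter fun b : ℕ => distInt (x b) < δ with hB
  show ((B.card : ℕ) : ℝ) ≤ _
  have hnr : (0 : ℝ) < n := by exact_mod_cast hn
  rcases Nat.eq_zero_or_pos N with hN0 | hNpos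
  · have : B = ∅ := by rw [hB, hN0, add_zero, Finset.Ico_self]; rfl
    rw [this, Finset.card_empty]; push_cast; positivity
  set f : ℕ → ℤ := fun b => round (x b) with hf
  -- fibres are short runs
  set D : ℕ := ⌊2 * δ * Q / n⌋₊ with hD
  have hfib : ∀ m ∈ B.image f, (B.filter fun b => f b = m).card ≤ D + 1 := by
    intro m _
    refine card_le_of_forall_sub_le fun b hb b' hb' => ?_
    rw [Finset.mem_filter, hB, Finset.mem_filter] at hb hb'
    have h1 : |x b - (f b : ℝ)| < δ := hb.1.2
    have h2 : |x b' - (f b' : ℝ)| < δ := hb'.1.2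
    rw [hb.2] at h1; rw [hb'.2] at h2
    have h3 : x b - x b' < 2 * δ := by
      have := abs_sub_lt_iff.1 h1; have := abs_sub_lt_iff.1 h2; linarith
    have h4 : x b - x b' = ((b : ℝ) - b') * n / Q := by simp only [hx]; field_simp; ring
    rw [h4, div_lt_iff₀ hQ] at h3
    have h5 : ((b : ℝ) - b') < 2 * δ * Q / n := by rw [lt_div_iff₀ hnr]; linarith
    by_contra hcon
    have h6 : (D : ℝ) + 1 ≤ (b : ℝ) - b' := by
      have : b' + D + 1 ≤ b := by omega
      have : ((b' + D + 1 : ℕ) : ℝ) ≤ b := by exact_mod_cast this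
      push_cast at this; linarith
    have h7 : 2 * δ * Q / n < (D : ℝ) + 1 := Nat.lt_floor_add_one _
    linarith
  -- the rounded values lie in a short integer interval
  set xf := x N₀ with hxf
  set xl := x (N₀ + N - 1) with hxl
  have himg : B.image f ⊆ Finset.Icc ⌈xf - 1 / 2⌉ ⌊xl + 1 / 2⌋ := by
    intro m hm
    rw [Finset.mem_image] at hm
    obtain ⟨b, hb, rfl⟩ := hm
    rw [hB, Finset.mem_filter, mem_Ico] at hb
    have hr := abs_sub_round (x b)
    have hmono : xf ≤ x b ∧ x b ≤ xl := by
      simp only [hxf, hxl, hx]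
      have h1 : (N₀ : ℝ) ≤ b := by exact_mod_cast hb.1.1
      have h2 : (b : ℝ) ≤ ((N₀ + N - 1 : ℕ) : ℝ) := by exact_mod_cast (by omega : b ≤ N₀ + N - 1)
      constructor
      · exact div_le_div_of_nonneg_right (by nlinarith) hQ.le
      · exact div_le_div_of_nonneg_right (by nlinarith) hQ.le
    have hr' := abs_sub_le_iff.1 hr
    rw [Finset.mem_Icc, Int.ceil_le, Int.le_floor]
    simp only [hf]
    constructor <;> linarith [hr'.1, hr'.2, hmono.1, hmono.2]
  have hcardimg : ((B.image f).card : ℝ) ≤ (n : ℝ) * N / Q + 2 := by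
    have h1 := Finset.card_le_card himg
    rw [Int.card_Icc] at h1
    have hdiff : xl - xf = ((N - 1 : ℕ) : ℝ) * n / Q := by
      simp only [hxl, hxf, hx]
      have : ((N₀ + N - 1 : ℕ) : ℝ) = N₀ + ((N - 1 : ℕ) : ℝ) := by
        rw [show N₀ + N - 1 = N₀ + (N - 1) by omega]; push_cast; ring
      rw [this]; field_simp; ring
    have hN1 : ((N - 1 : ℕ) : ℝ) ≤ N := by exact_mod_cast Nat.sub_le N 1
    have h2 : ((⌊xl + 1 / 2⌋ + 1 - ⌈xf - 1 / 2⌉).toNat : ℝ) ≤ (n : ℝ) * N / Q + 2 := by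
      have hfl : (⌊xl + 1 / 2⌋ : ℝ) ≤ xl + 1 / 2 := Int.floor_le _
      have hce : xf - 1 / 2 ≤ (⌈xf - 1 / 2⌉ : ℝ) := Int.le_ceil _
      have hbound : ((⌊xl + 1 / 2⌋ + 1 - ⌈xf - 1 / 2⌉ : ℤ) : ℝ) ≤ (n : ℝ) * N / Q + 2 := by
        push_cast
        have : ((N - 1 : ℕ) : ℝ) * n / Q ≤ (n : ℝ) * N / Q := by
          rw [div_le_div_iff_of_pos_right hQ]; nlinarith
        linarith
      rcases le_or_gt 0 (⌊xl + 1 / 2⌋ + 1 - ⌈xf - 1 / 2⌉) with h0 | h0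
      · have : (((⌊xl + 1 / 2⌋ + 1 - ⌈xf - 1 / 2⌉).toNat : ℤ) : ℝ) = ((⌊xl + 1 / 2⌋ + 1 - ⌈xf - 1 / 2⌉ : ℤ) : ℝ) := by
          rw [Int.toNat_of_nonneg h0]
        have e : (((⌊xl + 1 / 2⌋ + 1 - ⌈xf - 1 / 2⌉).toNat : ℕ) : ℝ) =
            (((⌊xl + 1 / 2⌋ + 1 - ⌈xf - 1 / 2⌉).toNat : ℤ) : ℝ) := rfl
        rw [e, this]; exact hbound
      · rw [Int.toNat_of_nonpos h0.le]; push_cast; positivity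
    exact le_trans (by exact_mod_cast h1) h2
  have hmain := Finset.card_le_mul_card_image B (D + 1) hfib
  have hD' : ((D + 1 : ℕ) : ℝ) ≤ 2 * δ * Q / n + 1 := by
    push_cast
    have := Nat.floor_le (show 0 ≤ 2 * δ * Q / n by positivity)
    rw [hD]; linarith
  calc ((B.card : ℕ) : ℝ) ≤ ((D + 1 : ℕ) : ℝ) * (B.image f).card := by exact_mod_cast hmain
    _ ≤ (2 * δ * Q / n + 1) * ((n : ℝ) * N / Q + 2) :=
        mul_le_mul hD' hcardimg (by positivity) (by positivity)
    _ = _ := mul_comm _ _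

/-! ### The resonance sum for the bottom window (`K = 0`; Bourgain 2013, (2.13)–(2.22)) -/

section ResonanceK0

variable {ν : ℕ} (A : Finset (Fin ν))

/-- The spectral weight `ω(h) = |ŵ_A(h/2^ν)|`. [folklore] -/
def specWeight (h : ℕ) : ℝ := ‖walshCoeff A ((h : ℝ) / 2 ^ ν)‖

/-- `0 ≤ ω`. [folklore] -/
theorem specWeight_nonneg (h : ℕ) : 0 ≤ specWeight A h := norm_nonneg _

/-- `ω ≤ 2·2^{-c₂|A|}` (Lemma 2). [cite: Bourgain2013MoebiusWalsh, Lemma 2 (1.3)] -/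
theorem specWeight_le_sup (h : ℕ) : specWeight A h ≤ 2 * (2 : ℝ) ^ (-(walshSupExponent * A.card)) :=
  norm_walshCoeff_le_two_mul_rpow A _

/-- `ω` is `2^ν`-periodic. [folklore] -/
theorem specWeight_add_mul (h u : ℕ) : specWeight A (h + 2 ^ ν * u) = specWeight A h := by
  unfold specWeight
  -- direct computation: the argument differs by the integer `u`
  congr 1
  unfold walshCoeff
  congr 1
  refine Finset.sum_congr rfl fun x _ => ?_
  congr 1
  rw [show (((h + 2 ^ ν * u : ℕ)) : ℝ) / 2 ^ ν * (bitsToNat (List.ofFn x) : ℕ) =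
    (h : ℝ) / 2 ^ ν * (bitsToNat (List.ofFn x) : ℕ) + ((u * bitsToNat (List.ofFn x) : ℕ) : ℤ) by
      push_cast; field_simp]
  exact eChar_add_intCast _ _

/-- **Sums of `ω` over a residue class `c mod 2^r`** (Lemma 4): for `r ≤ ν`,
`∑_{u < 2^{ν−r}} ω(c + 2^r u) ≤ 2·2^{κ(ν−r)}`. [cite: Bourgain2013MoebiusWalsh, Lemma 4 (1.7)] -/
theorem sum_specWeight_progression_le {r : ℕ} (hr : r ≤ ν) (c : ℕ) :
    ∑ u ∈ range (2 ^ (ν - r)), specWeight A (c + 2 ^ r * u) ≤ 2 * (2 : ℝ) ^ (walshL1Exponent * (ν - r : ℕ)) := by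
  unfold specWeight
  have h := sum_norm_walshCoeff_progression_le A hr c
  refine le_trans (le_of_eq (Finset.sum_congr rfl fun u _ => ?_)) h
  push_cast; ring_nf

/-- The same class sum over `h < 2^ν` with `h ≡ c (mod 2^r)` (`c < 2^r`), also bounded by the
sup norm times the class size: `≤ min(2·2^{κ(ν−r)}, 2^{ν−r}·sup ω)`. [cite: Bourgain2013MoebiusWalsh, Lemma 4] -/
theorem sum_specWeight_filter_mod_le {r : ℕ} (hr : r ≤ ν) {c : ℕ} (hc : c < 2 ^ r) :
    ∑ h ∈ (range (2 ^ ν)).filter (fun h => h % 2 ^ r = c), specWeight A h ≤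
      min (2 * (2 : ℝ) ^ (walshL1Exponent * (ν - r : ℕ)))
        (2 ^ (ν - r) * (2 * (2 : ℝ) ^ (-(walshSupExponent * A.card)))) := by
  have hclass : (range (2 ^ ν)).filter (fun h => h % 2 ^ r = c) = (range (2 ^ (ν - r))).image (fun u => c + 2 ^ r * u) := by
    ext h
    rw [Finset.mem_filter, mem_range, Finset.mem_image]
    constructor
    · rintro ⟨hh, hmod⟩
      refine ⟨h / 2 ^ r, mem_range.2 ?_, ?_⟩
      · rw [Nat.div_lt_iff_lt_mul (Nat.two_pow_pos r), ← pow_add, Nat.sub_add_cancel hr]; exact hh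
      · have := Nat.mod_add_div h (2 ^ r); rw [hmod] at this; linarith
    · rintro ⟨u, hu, rfl⟩
      have hu := mem_range.mp hu
      refine ⟨?_, by rw [Nat.add_mul_mod_self_left, Nat.mod_eq_of_lt hc]⟩
      calc c + 2 ^ r * u < 2 ^ r + 2 ^ r * u := by omega
        _ = 2 ^ r * (u + 1) := by ring
        _ ≤ 2 ^ r * 2 ^ (ν - r) := Nat.mul_le_mul_left _ hu
        _ = 2 ^ ν := by rw [← pow_add, Nat.add_sub_cancel' hr]
  rw [hclass, Finset.sum_image (fun u _ u' _ h => by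
    have := Nat.two_pow_pos r; exact Nat.eq_of_mul_eq_mul_left this (by omega))]
  refine le_min (sum_specWeight_progression_le A hr c) ?_
  calc ∑ u ∈ range (2 ^ (ν - r)), specWeight A (c + 2 ^ r * u)
      ≤ ∑ _u ∈ range (2 ^ (ν - r)), 2 * (2 : ℝ) ^ (-(walshSupExponent * A.card)) :=
        Finset.sum_le_sum fun u _ => specWeight_le_sup A _
    _ = _ := by rw [Finset.sum_const, Finset.card_range, nsmul_eq_mul]; push_cast; ring

/-- The number of `b` in an interval of length `N` at which the pair `(h, h')` resonates,
`‖((h+h')b + h'ℓ)/2^ν‖ < δ`, when `h + h' ≢ 0 (mod 2^ν)`: with `2^r ∥ (h + h') mod 2^ν`, it is at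
most `2(δ2^{ν−r} + 1)(N/2^{ν−r} + 1)`, and it vanishes unless `‖h'ℓ/2^r‖ < 2^{ν−r}δ`.
[cite: Bourgain2013MoebiusWalsh, (2.16)–(2.18)] -/
theorem card_resonant_le {h h' N₀ N : ℕ} {ℓ : ℤ} {δ : ℝ} (hδ : 0 < δ)
    (hd : (h + h') % 2 ^ ν ≠ 0) :
    let r := ((h + h') % 2 ^ ν).factorization 2
    ((((Ico N₀ (N₀ + N)).filter fun b : ℕ =>
        distInt ((((h : ℝ) + h') * b + (h' : ℝ) * ℓ) / 2 ^ ν) < δ).card : ℕ) : ℝ) ≤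
      (if distInt ((h' : ℝ) * ℓ / 2 ^ r) < 2 ^ (ν - r) * δ then
        2 * (δ * 2 ^ (ν - r) + 1) * ((N / 2 ^ (ν - r) : ℕ) + 1) else 0) := by
  intro r
  set n := (h + h') % 2 ^ ν with hn
  set d' := n / 2 ^ r with hd'
  have hdec : 2 ^ r * d' = n := Nat.ordProj_mul_ordCompl_eq_self n 2
  have hd'odd : Odd d' := by
    have hc : Nat.Coprime 2 d' := Nat.coprime_ordCompl Nat.prime_two hd
    rw [Nat.odd_iff]
    by_contra h2
    have : 2 ∣ d' := Nat.dvd_of_mod_eq_zero (by omega)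
    have := Nat.eq_one_of_dvd_one (hc ▸ Nat.dvd_gcd (dvd_refl 2) this)
    omega
  have hrν : r ≤ ν := by
    have h1 : 2 ^ r ≤ n := Nat.le_of_dvd (Nat.pos_of_ne_zero hd) (Nat.ordProj_dvd n 2)
    have h2 : n < 2 ^ ν := Nat.mod_lt _ (Nat.two_pow_pos ν)
    exact ((Nat.pow_lt_pow_iff_right (by norm_num)).1 (lt_of_le_of_lt h1 h2)).le
  -- the phase in normal form
  have hphase : ∀ b : ℕ, distInt ((((h : ℝ) + h') * b + (h' : ℝ) * ℓ) / 2 ^ ν) =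
      distInt (((2 : ℝ) ^ r * d' * b + (h' : ℝ) * ℓ) / 2 ^ ν) := by
    intro b
    have e1 : ((h + h' : ℕ) : ℝ) = (n : ℝ) + 2 ^ ν * (((h + h') / 2 ^ ν : ℕ) : ℝ) := by
      have := Nat.mod_add_div (h + h') (2 ^ ν)
      rw [← hn] at this
      exact_mod_cast this.symm
    generalize (h + h') / 2 ^ ν = qq at e1
    have e2 : (n : ℝ) = 2 ^ r * d' := by rw [← hdec]; push_cast; ring
    have h2 : (2 : ℝ) ^ ν ≠ 0 := pow_ne_zero _ two_ne_zero
    have : (((h : ℝ) + h') * b + (h' : ℝ) * ℓ) / 2 ^ ν =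
        ((2 : ℝ) ^ r * d' * b + (h' : ℝ) * ℓ) / 2 ^ ν + ((((qq * b : ℕ)) : ℤ) : ℝ) := by
      have e3 : ((h : ℝ) + h') = ((h + h' : ℕ) : ℝ) := by push_cast; ring
      rw [e3, e1, e2]; push_cast; field_simp; ring
    rw [this, distInt_add_int]
  simp_rw [hphase]
  split_ifs with hres
  · exact card_filter_phase_lt_le hrν hd'odd _ hδ.le N₀ N
  · -- no resonance at all
    have hempty : (Ico N₀ (N₀ + N)).filter (fun b : ℕ =>
        distInt (((2 : ℝ) ^ r * d' * b + (h' : ℝ) * ℓ) / 2 ^ ν) < δ) = ∅ := by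
      refine Finset.filter_eq_empty_iff.2 fun b _ hb => hres ?_
      have h1 := distInt_div_two_pow_le hrν d' b ((h' : ℝ) * ℓ)
      have h2 : (0 : ℝ) < 2 ^ (ν - r) := by positivity
      calc distInt ((h' : ℝ) * ℓ / 2 ^ r) ≤ 2 ^ (ν - r) * distInt (((2 : ℝ) ^ r * d' * b + (h' : ℝ) * ℓ) / 2 ^ ν) := h1
        _ < 2 ^ (ν - r) * δ := mul_lt_mul_of_pos_left hb h2
    rw [hempty]; simp

/-- **The resonance sum for the bottom window `K = 0`** (Bourgain 2013, (2.13)–(2.22), per shift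
`ℓ ≠ 0`, `|ℓ| < L`): with `Q = 2^ν`, `ω = |ŵ_A(·/Q)|`, `η = 2·2^{-c₂|A|}`, `κ = walshL1Exponent`,
`Λ = 2(2^ν/M₁ + L)`,
`∑_{b} ∑_{h,h' < Q} ω(h)ω(h') 𝟙[‖((h+h')b + h'ℓ)/Q‖ < 1/M₁]
  ≤ N η² Λ + ∑_{r<ν} 2(2^{ν−r}/M₁ + 1)(N/2^{ν−r} + 1) · Λ · 2·2^{κ(ν−r)} · min(2·2^{κ(ν−r)}, 2^{ν−r}η)`
(diagonal `h + h' ≡ 0`: sup norm twice and `#{h' : ‖h'ℓ/Q‖ < 1/M₁} ≤ Λ`; off the diagonal, with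
`2^r ∥ h + h'`: the `b`-count of `card_resonant_le`, Lemma 4 for the `h`-sum over the class
`h ≡ −h' (2^r)`, and the restriction (2.17) of `h'` to `≤ Λ` classes, each summed by Lemma 4).
[cite: Bourgain2013MoebiusWalsh, (2.13)–(2.22)] -/
theorem resonance_bottom (N₀ N L : ℕ) {M₁ : ℝ} (hM₁ : 0 < M₁) {ℓ : ℤ} (hℓ0 : ℓ ≠ 0) (hℓL : |ℓ| < L) :
    ∑ b ∈ Ico N₀ (N₀ + N), ∑ h ∈ range (2 ^ ν), ∑ h' ∈ range (2 ^ ν),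
        specWeight A h * specWeight A h' *
          (if distInt ((((h : ℝ) + h') * b + (h' : ℝ) * ℓ) / 2 ^ ν) < 1 / M₁ then (1 : ℝ) else 0) ≤
      N * (2 * (2 : ℝ) ^ (-(walshSupExponent * A.card))) ^ 2 * (2 * ((2 : ℝ) ^ ν / M₁ + L)) +
        ∑ r ∈ range ν, 2 * ((2 : ℝ) ^ (ν - r) / M₁ + 1) * ((N : ℝ) / 2 ^ (ν - r) + 1) *
          ((2 * ((2 : ℝ) ^ ν / M₁ + L)) * (2 * (2 : ℝ) ^ (walshL1Exponent * (ν - r : ℕ)))) *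
          min (2 * (2 : ℝ) ^ (walshL1Exponent * (ν - r : ℕ)))
            (2 ^ (ν - r) * (2 * (2 : ℝ) ^ (-(walshSupExponent * A.card)))) := by
  classical
  set Q := 2 ^ ν with hQdef
  have hQ : 0 < Q := Nat.two_pow_pos ν
  set δ : ℝ := 1 / M₁ with hδ
  have hδ0 : 0 < δ := by positivity
  set η : ℝ := 2 * (2 : ℝ) ^ (-(walshSupExponent * A.card)) with hη
  have hη0 : 0 ≤ η := by positivity
  set Lam : ℝ := 2 * ((2 : ℝ) ^ ν / M₁ + L) with hLam
  set ω := specWeight A with hω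
  have hω0 : ∀ h, 0 ≤ ω h := specWeight_nonneg A
  have hωη : ∀ h, ω h ≤ η := specWeight_le_sup A
  set n : ℕ := ℓ.natAbs with hn
  have hn0 : 0 < n := Int.natAbs_pos.2 hℓ0
  have hnL : n < L := by
    have : (n : ℤ) < L := by rw [hn, Int.natCast_natAbs]; exact hℓL
    exact_mod_cast this
  set I := Ico N₀ (N₀ + N) with hI
  set Ind : ℕ → ℕ → ℕ → ℝ := fun h h' b =>
    if distInt ((((h : ℝ) + h') * b + (h' : ℝ) * ℓ) / 2 ^ ν) < δ then (1 : ℝ) else 0 with hInd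
  set cnt : ℕ → ℕ → ℝ := fun h h' => ∑ b ∈ I, Ind h h' b with hcnt
  have hcnt_eq : ∀ h h', cnt h h' = ((I.filter fun b : ℕ =>
      distInt ((((h : ℝ) + h') * b + (h' : ℝ) * ℓ) / 2 ^ ν) < δ).card : ℝ) := by
    intro h h'; rw [hcnt]; simp only [hInd]; rw [Finset.sum_boole]
  have hcnt_le_N : ∀ h h', cnt h h' ≤ N := by
    intro h h'
    rw [hcnt_eq]
    have : (I.filter fun b : ℕ => distInt ((((h : ℝ) + h') * b + (h' : ℝ) * ℓ) / 2 ^ ν) < δ).card ≤ N :=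
      (Finset.card_filter_le _ _).trans (by rw [hI, Nat.card_Ico]; omega)
    exact_mod_cast this
  have hcnt0 : ∀ h h', 0 ≤ cnt h h' := fun h h' => by rw [hcnt_eq]; positivity
  -- Step 0: exchange sums, `S = ∑_{h,h'} ω ω' cnt`
  have hS : ∑ b ∈ I, ∑ h ∈ range Q, ∑ h' ∈ range Q, ω h * ω h' * Ind h h' b =
      ∑ h ∈ range Q, ∑ h' ∈ range Q, ω h * ω h' * cnt h h' := by
    rw [Finset.sum_comm]
    refine Finset.sum_congr rfl fun h _ => ?_
    rw [Finset.sum_comm]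
    refine Finset.sum_congr rfl fun h' _ => ?_
    rw [hcnt, Finset.mul_sum]
  show ∑ b ∈ I, ∑ h ∈ range Q, ∑ h' ∈ range Q, ω h * ω h' * Ind h h' b ≤ _
  rw [hS]
  -- Step 1: split the diagonal `h + h' ≡ 0 (mod Q)`
  have hsplit : ∀ h ∈ range Q, ∑ h' ∈ range Q, ω h * ω h' * cnt h h' =
      ∑ h' ∈ (range Q).filter (fun h' => (h + h') % Q = 0), ω h * ω h' * cnt h h' +
        ∑ h' ∈ (range Q).filter (fun h' => ¬ (h + h') % Q = 0), ω h * ω h' * cnt h h' :=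
    fun h _ => (Finset.sum_filter_add_sum_filter_not _ _ _).symm
  rw [Finset.sum_congr rfl hsplit, Finset.sum_add_distrib]
  refine add_le_add ?_ ?_
  · -- the diagonal part
    -- for each `h` there is at most one `h'` with `h + h' ≡ 0`, and there `Ind` does not depend on `b`
    have hdiag : ∀ h ∈ range Q, ∑ h' ∈ (range Q).filter (fun h' => (h + h') % Q = 0), ω h * ω h' * cnt h h' ≤
        η * (ω ((Q - h) % Q) * (N * (if distInt (((((Q - h) % Q : ℕ)) : ℝ) * ℓ / 2 ^ ν) < δ then 1 else 0))) := by
      intro h hh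
      have hh' := mem_range.mp hh
      have hset : (range Q).filter (fun h' => (h + h') % Q = 0) = {(Q - h) % Q} := by
        ext h'
        rw [Finset.mem_filter, mem_range, Finset.mem_singleton]
        constructor
        · rintro ⟨h1, h2⟩
          obtain ⟨k, hk⟩ := Nat.dvd_of_mod_eq_zero h2
          have hk2 : k < 2 := by
            by_contra hk2
            have : Q * 2 ≤ Q * k := Nat.mul_le_mul_left Q (by omega)
            omega
          interval_cases k
          · have h0 : h = 0 := by omega
            have h0' : h' = 0 := by omega
            rw [h0, h0', Nat.sub_zero, Nat.mod_self]
          · rw [mul_one] at hk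
            have hpos : 0 < h := by
              by_contra hp
              have : h = 0 := by omega
              omega
            rw [Nat.mod_eq_of_lt (by omega : Q - h < Q)]; omega
        · intro e
          rw [e]
          rcases Nat.eq_zero_or_pos h with h0 | h0
          · rw [h0, Nat.sub_zero, Nat.mod_self]; exact ⟨hQ, by simp⟩
          · rw [Nat.mod_eq_of_lt (by omega : Q - h < Q)]
            exact ⟨by omega, by rw [show h + (Q - h) = Q by omega, Nat.mod_self]⟩
      rw [hset, Finset.sum_singleton]
      set h' := (Q - h) % Q with hh'def
      have hmod : (h + h') % Q = 0 := by
        have : h' ∈ (range Q).filter (fun h' => (h + h') % Q = 0) := by rw [hset]; exact Finset.mem_singleton_self _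
        exact (Finset.mem_filter.mp this).2
      -- `Ind` is constant in `b` on the diagonal
      have hInd_const : ∀ b : ℕ, Ind h h' b = (if distInt ((h' : ℝ) * ℓ / 2 ^ ν) < δ then 1 else 0) := by
        intro b
        simp only [hInd]
        have e1 : ((h : ℝ) + h') = (Q : ℝ) * (((h + h') / Q : ℕ) : ℝ) := by
          have := Nat.div_add_mod (h + h') Q
          rw [hmod, add_zero] at this
          have : ((h + h' : ℕ) : ℝ) = ((Q * ((h + h') / Q) : ℕ) : ℝ) := by exact_mod_cast this.symm
          push_cast at this; exact this
        generalize (h + h') / Q = qq at e1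
        have hQr : (Q : ℝ) = 2 ^ ν := by rw [hQdef]; push_cast; ring
        have : (((h : ℝ) + h') * b + (h' : ℝ) * ℓ) / 2 ^ ν = (h' : ℝ) * ℓ / 2 ^ ν + (((qq * b : ℕ)) : ℤ) := by
          rw [e1, hQr]; push_cast; field_simp; ring
        rw [this, distInt_add_int]
      have hcnt_diag : cnt h h' = N * (if distInt ((h' : ℝ) * ℓ / 2 ^ ν) < δ then 1 else 0) := by
        simp only [hcnt]
        rw [Finset.sum_congr rfl fun b _ => hInd_const b, Finset.sum_const, nsmul_eq_mul, hI, Nat.card_Ico,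
          Nat.add_sub_cancel_left]
      rw [hcnt_diag]
      calc ω h * ω h' * (N * (if distInt ((h' : ℝ) * ℓ / 2 ^ ν) < δ then 1 else 0))
          ≤ η * ω h' * (N * (if distInt ((h' : ℝ) * ℓ / 2 ^ ν) < δ then 1 else 0)) := by
            refine mul_le_mul_of_nonneg_right (mul_le_mul_of_nonneg_right (hωη h) (hω0 _)) ?_
            split_ifs <;> positivity
        _ = _ := by ring
    refine (Finset.sum_le_sum hdiag).trans ?_
    rw [← Finset.mul_sum]
    -- reindex by `h' = (Q - h) % Q`, a bijection of `range Q`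
    have hbij : ∑ h ∈ range Q, ω ((Q - h) % Q) * (N * (if distInt (((((Q - h) % Q : ℕ)) : ℝ) * ℓ / 2 ^ ν) < δ then 1 else 0)) =
        ∑ h' ∈ range Q, ω h' * (N * (if distInt ((h' : ℝ) * ℓ / 2 ^ ν) < δ then 1 else 0)) := by
      refine Finset.sum_nbij' (fun h => (Q - h) % Q) (fun h' => (Q - h') % Q) ?_ ?_ ?_ ?_ (fun _ _ => rfl)
      · intro h _; exact mem_range.2 (Nat.mod_lt _ hQ)
      · intro h' _; exact mem_range.2 (Nat.mod_lt _ hQ)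
      · intro h hh
        have hh := mem_range.mp hh
        rcases Nat.eq_zero_or_pos h with h0 | h0
        · subst h0; simp [Nat.mod_self]
        · rw [Nat.mod_eq_of_lt (by omega : Q - h < Q), show Q - (Q - h) = h by omega, Nat.mod_eq_of_lt hh]
      · intro h' hh'
        have hh' := mem_range.mp hh'
        rcases Nat.eq_zero_or_pos h' with h0 | h0
        · subst h0; simp [Nat.mod_self]
        · rw [Nat.mod_eq_of_lt (by omega : Q - h' < Q), show Q - (Q - h') = h' by omega, Nat.mod_eq_of_lt hh']
    rw [hbij]
    -- bound `ω ≤ η` and count the resonant `h'`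
    have hcount : (((range Q).filter fun h' : ℕ => distInt (((h' : ℕ) : ℝ) * n / 2 ^ ν) < δ).card : ℝ) ≤
        2 * (δ * 2 ^ ν + Nat.gcd n (2 ^ ν)) := card_filter_mul_div_lt_le ν n hδ0.le
    have hgcd : (Nat.gcd n (2 ^ ν) : ℝ) ≤ L := by
      have : Nat.gcd n (2 ^ ν) ≤ n := Nat.gcd_le_left _ hn0
      exact_mod_cast (this.trans hnL.le)
    have hℓn : ∀ h' : ℕ, distInt ((h' : ℝ) * ℓ / 2 ^ ν) = distInt (((h' : ℕ) : ℝ) * n / 2 ^ ν) := by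
      intro h'
      rcases Int.natAbs_eq ℓ with e | e
      · rw [hn]; congr 2; rw [e]; simp
      · rw [hn]
        have : (ℓ : ℝ) = -(n : ℝ) := by rw [hn]; exact_mod_cast e
        rw [this, show (h' : ℝ) * -(n : ℝ) / 2 ^ ν = -(((h' : ℕ) : ℝ) * n / 2 ^ ν) by ring,
          Literature.NumberTheory.Sieve.Vinogradov.distInt_neg]
    calc η * ∑ h' ∈ range Q, ω h' * (N * (if distInt ((h' : ℝ) * ℓ / 2 ^ ν) < δ then 1 else 0))
        ≤ η * ∑ h' ∈ range Q, η * (N * (if distInt (((h' : ℕ) : ℝ) * n / 2 ^ ν) < δ then 1 else 0)) := by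
          refine mul_le_mul_of_nonneg_left (Finset.sum_le_sum fun h' _ => ?_) hη0
          rw [hℓn]
          refine mul_le_mul_of_nonneg_right (hωη h') ?_
          split_ifs <;> positivity
      _ = η * η * N * (((range Q).filter fun h' : ℕ => distInt (((h' : ℕ) : ℝ) * n / 2 ^ ν) < δ).card : ℝ) := by
          rw [← Finset.mul_sum, ← Finset.mul_sum, ← Finset.sum_boole]; ring
      _ ≤ η * η * N * (2 * (δ * 2 ^ ν + Nat.gcd n (2 ^ ν))) :=
          mul_le_mul_of_nonneg_left hcount (by positivity)
      _ ≤ η * η * N * (2 * ((2 : ℝ) ^ ν / M₁ + L)) := by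
          refine mul_le_mul_of_nonneg_left ?_ (by positivity)
          rw [hδ]
          have : 1 / M₁ * (2 : ℝ) ^ ν = 2 ^ ν / M₁ := by ring
          rw [this]; linarith
      _ = N * η ^ 2 * Lam := by rw [hLam]; ring
  · -- the off-diagonal part
    set P₁ := (range Q ×ˢ range Q).filter (fun p : ℕ × ℕ => ¬ (p.1 + p.2) % Q = 0) with hP₁
    have hpairs : ∑ h ∈ range Q, ∑ h' ∈ (range Q).filter (fun h' => ¬ (h + h') % Q = 0), ω h * ω h' * cnt h h' =
        ∑ p ∈ P₁, ω p.1 * ω p.2 * cnt p.1 p.2 := by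
      rw [hP₁, Finset.sum_filter, Finset.sum_product]
      refine Finset.sum_congr rfl fun h _ => ?_
      rw [Finset.sum_filter]
    rw [hpairs]
    -- the `2`-adic valuation of `h + h' mod Q`
    set rp : ℕ × ℕ → ℕ := fun p => ((p.1 + p.2) % Q).factorization 2 with hrp
    set Ind' : ℕ → ℕ → ℝ := fun h' r =>
      if distInt ((h' : ℝ) * ℓ / 2 ^ r) < 2 ^ (ν - r) * δ then 1 else 0 with hInd'
    set CNT : ℕ → ℝ := fun r => 2 * ((2 : ℝ) ^ (ν - r) / M₁ + 1) * ((N : ℝ) / 2 ^ (ν - r) + 1) with hCNT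
    set B₄ : ℕ → ℝ := fun r => 2 * (2 : ℝ) ^ (walshL1Exponent * (ν - r : ℕ)) with hB₄
    have hCNT0 : ∀ r, 0 ≤ CNT r := fun r => by simp only [hCNT]; positivity
    have hInd'0 : ∀ h' r, 0 ≤ Ind' h' r := fun h' r => by simp only [hInd']; split_ifs <;> norm_num
    have hInd'1 : ∀ h' r, Ind' h' r ≤ 1 := fun h' r => by simp only [hInd']; split_ifs <;> norm_num
    -- Step 2: the `b`-count for each off-diagonal pair
    have hcnt_le : ∀ p ∈ P₁, cnt p.1 p.2 ≤ CNT (rp p) * Ind' p.2 (rp p) := by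
      intro p hp
      rw [hP₁, Finset.mem_filter] at hp
      have hd : (p.1 + p.2) % 2 ^ ν ≠ 0 := hp.2
      have h := card_resonant_le (ν := ν) (N₀ := N₀) (N := N) (ℓ := ℓ) (h := p.1) (h' := p.2) hδ0 hd
      simp only at h
      rw [hcnt_eq, hI]
      refine h.trans ?_
      simp only [hInd', hrp, hCNT]
      split_ifs with hres
      · rw [mul_one]
        have h1 : ((N / 2 ^ (ν - ((p.1 + p.2) % 2 ^ ν).factorization 2) : ℕ) : ℝ) ≤
            (N : ℝ) / 2 ^ (ν - ((p.1 + p.2) % 2 ^ ν).factorization 2) := by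
          have := Nat.cast_div_le (m := N) (n := 2 ^ (ν - ((p.1 + p.2) % 2 ^ ν).factorization 2)) (α := ℝ)
          push_cast at this; exact this
        have h2 : δ * (2 : ℝ) ^ (ν - ((p.1 + p.2) % 2 ^ ν).factorization 2) =
            2 ^ (ν - ((p.1 + p.2) % 2 ^ ν).factorization 2) / M₁ := by rw [hδ]; ring
        rw [h2]
        gcongr
      · rw [mul_zero]
    have hrp_mem : ∀ p ∈ P₁, rp p ∈ range ν := by
      intro p hp
      rw [hP₁, Finset.mem_filter] at hp
      have hd : (p.1 + p.2) % Q ≠ 0 := hp.2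
      rw [mem_range]
      have h1 : 2 ^ rp p ≤ (p.1 + p.2) % Q := Nat.le_of_dvd (Nat.pos_of_ne_zero hd) (Nat.ordProj_dvd _ 2)
      have h2 : (p.1 + p.2) % Q < 2 ^ ν := Nat.mod_lt _ hQ
      exact (Nat.pow_lt_pow_iff_right (by norm_num)).1 (lt_of_le_of_lt h1 h2)
    -- Step 3: bound and regroup by `r`
    calc ∑ p ∈ P₁, ω p.1 * ω p.2 * cnt p.1 p.2
        ≤ ∑ p ∈ P₁, ω p.1 * ω p.2 * (CNT (rp p) * Ind' p.2 (rp p)) :=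
          Finset.sum_le_sum fun p hp => mul_le_mul_of_nonneg_left (hcnt_le p hp) (mul_nonneg (hω0 _) (hω0 _))
      _ = ∑ r ∈ range ν, ∑ p ∈ P₁.filter (fun p => rp p = r), ω p.1 * ω p.2 * (CNT r * Ind' p.2 r) := by
          rw [← Finset.sum_fiberwise_of_maps_to hrp_mem]
          refine Finset.sum_congr rfl fun r _ => Finset.sum_congr rfl fun p hp => ?_
          rw [(Finset.mem_filter.mp hp).2]
      _ ≤ ∑ r ∈ range ν, CNT r * ((Lam * B₄ r) * min (B₄ r) (2 ^ (ν - r) * η)) := by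
          refine Finset.sum_le_sum fun r hr => ?_
          have hrν : r < ν := mem_range.mp hr
          -- enlarge the fiber to the pairs with `2^r ∣ h + h'`
          set P₂ := (range Q ×ˢ range Q).filter (fun p : ℕ × ℕ => (p.1 + p.2) % 2 ^ r = 0) with hP₂
          have hsub : P₁.filter (fun p => rp p = r) ⊆ P₂ := by
            intro p hp
            rw [Finset.mem_filter, hP₁, Finset.mem_filter] at hp
            rw [hP₂, Finset.mem_filter]
            refine ⟨hp.1.1, ?_⟩
            have h1 : 2 ^ r ∣ (p.1 + p.2) % Q := by rw [← hp.2]; exact Nat.ordProj_dvd _ 2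
            have h2 : 2 ^ r ∣ Q := by rw [hQdef]; exact pow_dvd_pow 2 hrν.le
            exact Nat.mod_eq_zero_of_dvd ((Nat.dvd_mod_iff h2).1 h1)
          have hPr : 0 < 2 ^ r := Nat.two_pow_pos r
          -- (a) enlarge, (b) reorganise as `∑_{h'} Ind' ω' ∑_{h ≡ -h'} ω`
          have hstepA : ∑ p ∈ P₁.filter (fun p => rp p = r), ω p.1 * ω p.2 * (CNT r * Ind' p.2 r) ≤
              ∑ p ∈ P₂, ω p.1 * ω p.2 * (CNT r * Ind' p.2 r) :=
            Finset.sum_le_sum_of_subset_of_nonneg hsub fun p _ _ =>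
              mul_nonneg (mul_nonneg (hω0 _) (hω0 _)) (mul_nonneg (hCNT0 r) (hInd'0 _ _))
          have hstepB : ∑ p ∈ P₂, ω p.1 * ω p.2 * (CNT r * Ind' p.2 r) =
              CNT r * ∑ h' ∈ range Q, Ind' h' r * ω h' *
                ∑ h ∈ (range Q).filter (fun h => (h + h') % 2 ^ r = 0), ω h := by
            rw [hP₂, Finset.sum_filter, Finset.sum_product, Finset.sum_comm, Finset.mul_sum]
            refine Finset.sum_congr rfl fun h' _ => ?_
            rw [Finset.sum_filter, Finset.mul_sum, Finset.mul_sum]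
            refine Finset.sum_congr rfl fun h _ => ?_
            split_ifs <;> ring
          -- (c) the inner class sum
          have hinnerC : ∀ h' : ℕ, ∑ h ∈ (range Q).filter (fun h => (h + h') % 2 ^ r = 0), ω h ≤
              min (B₄ r) (2 ^ (ν - r) * η) := by
            intro h'
            have hset : (range Q).filter (fun h => (h + h') % 2 ^ r = 0) =
                (range Q).filter (fun h => h % 2 ^ r = (2 ^ r - h' % 2 ^ r) % 2 ^ r) := by
              refine Finset.filter_congr fun h _ => ?_
              exact add_mod_eq_zero_iff hPr h h'
            rw [hset, hQdef]
            exact sum_specWeight_filter_mod_le A hrν.le (Nat.mod_lt _ hPr)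
          -- (d) the restricted `h'`-sum
          have hD : ∑ h' ∈ range Q, Ind' h' r * ω h' ≤ Lam * B₄ r := by
            have hsplitQ : range Q = range (2 ^ r * 2 ^ (ν - r)) := by
              rw [hQdef, ← pow_add, Nat.add_sub_cancel' hrν.le]
            rw [hsplitQ, sum_range_mul_eq_sum_sum _ (2 ^ r) (2 ^ (ν - r))]
            have hIndper : ∀ u c : ℕ, Ind' (c + 2 ^ r * u) r = Ind' c r := by
              intro u c
              simp only [hInd']
              have : (((c + 2 ^ r * u : ℕ)) : ℝ) * ℓ / 2 ^ r = (c : ℝ) * ℓ / 2 ^ r + ((u * ℓ : ℤ) : ℝ) := by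
                have : (2 : ℝ) ^ r ≠ 0 := pow_ne_zero _ two_ne_zero
                push_cast; field_simp
              rw [this, distInt_add_int]
            calc ∑ u ∈ range (2 ^ (ν - r)), ∑ c ∈ range (2 ^ r), Ind' (c + 2 ^ r * u) r * ω (c + 2 ^ r * u)
                = ∑ c ∈ range (2 ^ r), Ind' c r * ∑ u ∈ range (2 ^ (ν - r)), ω (c + 2 ^ r * u) := by
                  rw [Finset.sum_comm]
                  refine Finset.sum_congr rfl fun c _ => ?_
                  rw [Finset.mul_sum]
                  refine Finset.sum_congr rfl fun u _ => by rw [hIndper]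
              _ ≤ ∑ c ∈ range (2 ^ r), Ind' c r * B₄ r := by
                  refine Finset.sum_le_sum fun c _ => mul_le_mul_of_nonneg_left ?_ (hInd'0 _ _)
                  exact sum_specWeight_progression_le A hrν.le c
              _ = B₄ r * (((range (2 ^ r)).filter fun c : ℕ =>
                    distInt ((c : ℝ) * ℓ / 2 ^ r) < 2 ^ (ν - r) * δ).card : ℝ) := by
                  rw [← Finset.sum_mul, mul_comm]
                  congr 1
                  simp only [hInd']
                  rw [Finset.sum_boole]
              _ ≤ B₄ r * (2 * (2 ^ (ν - r) * δ * 2 ^ r + Nat.gcd n (2 ^ r))) := by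
                  refine mul_le_mul_of_nonneg_left ?_ (by simp only [hB₄]; positivity)
                  have hℓn' : ∀ c : ℕ, distInt ((c : ℝ) * ℓ / 2 ^ r) = distInt (((c : ℕ) : ℝ) * n / 2 ^ r) := by
                    intro c
                    rcases Int.natAbs_eq ℓ with e | e
                    · rw [hn]; congr 2; rw [e]; simp
                    · have : (ℓ : ℝ) = -(n : ℝ) := by rw [hn]; exact_mod_cast e
                      rw [this, show (c : ℝ) * -(n : ℝ) / 2 ^ r = -(((c : ℕ) : ℝ) * n / 2 ^ r) by ring,
                        Literature.NumberTheory.Sieve.Vinogradov.distInt_neg]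
                  have hset : ((range (2 ^ r)).filter fun c : ℕ => distInt ((c : ℝ) * ℓ / 2 ^ r) < 2 ^ (ν - r) * δ) =
                      ((range (2 ^ r)).filter fun c : ℕ => distInt (((c : ℕ) : ℝ) * n / 2 ^ r) < 2 ^ (ν - r) * δ) :=
                    Finset.filter_congr fun c _ => by rw [hℓn']
                  rw [hset]
                  exact card_filter_mul_div_lt_le r n (by positivity)
              _ ≤ B₄ r * Lam := by
                  refine mul_le_mul_of_nonneg_left ?_ (by simp only [hB₄]; positivity)
                  rw [hLam]
                  have h1 : (2 : ℝ) ^ (ν - r) * δ * 2 ^ r = 2 ^ ν / M₁ := by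
                    rw [hδ, show (2 : ℝ) ^ ν = 2 ^ (ν - r) * 2 ^ r by rw [← pow_add, Nat.sub_add_cancel hrν.le]]
                    ring
                  have h2 : (Nat.gcd n (2 ^ r) : ℝ) ≤ L := by
                    have : Nat.gcd n (2 ^ r) ≤ n := Nat.gcd_le_left _ hn0
                    exact_mod_cast (this.trans hnL.le)
                  rw [h1]; linarith
              _ = Lam * B₄ r := mul_comm _ _
          -- (e) combine
          refine hstepA.trans ?_
          rw [hstepB]
          refine mul_le_mul_of_nonneg_left ?_ (hCNT0 r)
          calc ∑ h' ∈ range Q, Ind' h' r * ω h' * ∑ h ∈ (range Q).filter (fun h => (h + h') % 2 ^ r = 0), ω h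
              ≤ ∑ h' ∈ range Q, Ind' h' r * ω h' * min (B₄ r) (2 ^ (ν - r) * η) :=
                Finset.sum_le_sum fun h' _ => mul_le_mul_of_nonneg_left (hinnerC h')
                  (mul_nonneg (hInd'0 _ _) (hω0 _))
            _ = (∑ h' ∈ range Q, Ind' h' r * ω h') * min (B₄ r) (2 ^ (ν - r) * η) := by rw [Finset.sum_mul]
            _ ≤ (Lam * B₄ r) * min (B₄ r) (2 ^ (ν - r) * η) :=
                mul_le_mul_of_nonneg_right hD (le_min (by simp only [hB₄]; positivity) (by positivity))
      _ = _ := by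
          refine Finset.sum_congr rfl fun r _ => ?_
          simp only [hCNT, hB₄, hLam]
          ring

end ResonanceK0

/-! ### Step 1 of the type-II bound: smoothing the short variable and differencing the long one -/

section Assembly

variable (T : Finset ℕ) (β : ℕ → ℝ) (j : ℕ)

/-- The long sums `A_a = ∑_{b ∈ D_j} β(b) w_T(ab)`. [cite: Bourgain2013MoebiusWalsh, (2.1)] -/
def longSum (a : ℕ) : ℝ := ∑ b ∈ dyBlock j, β b * natWalsh T (a * b)

/-- The differenced correlation `Ψ'(ℓ) = ∑_{b, b+ℓ ∈ D_j} |∑_a Ω(a) w_T(a(b+ℓ)) w_T(ab)|` for a weight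
`Ω` on the short variable. [cite: Bourgain2013MoebiusWalsh, (2.2)] -/
def diffCorr (Ω : ℕ → ℝ) (Ma : ℕ) (ℓ : ℤ) : ℝ :=
  ∑ b ∈ dyBlock j, (if ((b : ℤ) + ℓ).toNat ∈ dyBlock j then
    |∑ a ∈ range Ma, Ω a * (natWalsh T (a * ((b : ℤ) + ℓ).toNat) * natWalsh T (a * b))| else 0)

/-- `Ψ' ≥ 0`. [folklore] -/
theorem diffCorr_nonneg (Ω : ℕ → ℝ) (Ma : ℕ) (ℓ : ℤ) : 0 ≤ diffCorr T j Ω Ma ℓ := by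
  unfold diffCorr
  exact Finset.sum_nonneg fun b _ => by split_ifs <;> positivity

/-- **Weighted van der Corput step** (Bourgain 2013, (2.1)–(2.2) with the smooth weight `Ω ≥ 0` on
the short variable): for `|β| ≤ 1` and `1 ≤ L ≤ 2^j`,
`∑_a Ω(a) A_a² ≤ ((N + L)/L) ∑_{|ℓ| < L} Ψ'(ℓ)`, `N = 2^j`.
[cite: Bourgain2013MoebiusWalsh, (2.2)] -/
theorem sum_weight_mul_longSum_sq_le {Ω : ℕ → ℝ} (hΩ : ∀ a, 0 ≤ Ω a) (hβ : ∀ b, |β b| ≤ 1)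
    (Ma : ℕ) {L : ℕ} (hL : 1 ≤ L) :
    ∑ a ∈ range Ma, Ω a * (longSum T β j a) ^ 2 ≤
      (((2 : ℝ) ^ j + L) / L) * ∑ ℓ ∈ Ioo (-(L : ℤ)) L, diffCorr T j Ω Ma ℓ := by
  classical
  set N : ℕ := 2 ^ j with hNdef
  have hL0 : (0 : ℝ) < L := by exact_mod_cast hL
  -- the sequences `z_a` on `ℤ`
  set z : ℕ → ℤ → ℝ := fun a b =>
    if 0 ≤ b ∧ b.toNat ∈ dyBlock j then β b.toNat * natWalsh T (a * b.toNat) else 0 with hz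
  have hzsupp : ∀ a b, z a b ≠ 0 → b ∈ Ico (N : ℤ) ((N : ℤ) + N) := by
    intro a b hb
    simp only [hz] at hb
    split_ifs at hb with hcond
    · rw [mem_dyBlock] at hcond
      rw [mem_Ico]
      have h1 : ((b.toNat : ℕ) : ℤ) = b := Int.toNat_of_nonneg hcond.1
      have h2 := hcond.2
      rw [← hNdef, pow_succ] at h2
      constructor <;> omega
    · exact absurd rfl hb
  -- the long sum as a sum over `ℤ`
  have hsumz : ∀ a, ∑ b ∈ Ico (N : ℤ) ((N : ℤ) + N), z a b = longSum T β j a := by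
    intro a
    unfold longSum
    refine Finset.sum_nbij' (fun b : ℤ => b.toNat) (fun b : ℕ => (b : ℤ)) ?_ ?_ ?_ ?_ ?_
    · intro b hb
      rw [mem_Ico] at hb
      rw [mem_dyBlock, ← hNdef, pow_succ]
      constructor <;> omega
    · intro b hb
      rw [mem_dyBlock, ← hNdef, pow_succ] at hb
      rw [mem_Ico]
      constructor <;> omega
    · intro b hb
      rw [mem_Ico] at hb
      exact Int.toNat_of_nonneg (by omega)
    · intro b _
      exact Int.toNat_natCast b
    · intro b hb
      rw [mem_Ico] at hb
      simp only [hz]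
      rw [if_pos]
      refine ⟨by omega, ?_⟩
      rw [mem_dyBlock, ← hNdef, pow_succ]
      constructor <;> omega
  -- van der Corput for each `a`, weighted and summed
  have hvdC : ∀ a, ((L : ℝ) * longSum T β j a) ^ 2 ≤ ((N : ℝ) + L) *
      ∑ p ∈ range L ×ˢ range L, ∑ b ∈ Ico (N : ℤ) ((N : ℤ) + N), z a (b + ((p.1 : ℤ) - p.2)) * z a b := by
    intro a
    have h := vdCorput_shift_pairs (S := 1) L (hzsupp a)
    rw [hsumz a] at h
    simp only [Nat.cast_one, one_mul, mul_one] at h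
    exact h
  have hstep1 : (L : ℝ) ^ 2 * ∑ a ∈ range Ma, Ω a * (longSum T β j a) ^ 2 ≤
      ((N : ℝ) + L) * ∑ p ∈ range L ×ˢ range L, ∑ a ∈ range Ma, Ω a *
        ∑ b ∈ Ico (N : ℤ) ((N : ℤ) + N), z a (b + ((p.1 : ℤ) - p.2)) * z a b := by
    rw [Finset.mul_sum, Finset.mul_sum]
    calc ∑ a ∈ range Ma, (L : ℝ) ^ 2 * (Ω a * longSum T β j a ^ 2)
        = ∑ a ∈ range Ma, Ω a * ((L : ℝ) * longSum T β j a) ^ 2 := Finset.sum_congr rfl fun a _ => by ring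
      _ ≤ ∑ a ∈ range Ma, Ω a * (((N : ℝ) + L) *
          ∑ p ∈ range L ×ˢ range L, ∑ b ∈ Ico (N : ℤ) ((N : ℤ) + N), z a (b + ((p.1 : ℤ) - p.2)) * z a b) :=
          Finset.sum_le_sum fun a _ => mul_le_mul_of_nonneg_left (hvdC a) (hΩ a)
      _ = ∑ a ∈ range Ma, ∑ p ∈ range L ×ˢ range L, ((N : ℝ) + L) * (Ω a *
          ∑ b ∈ Ico (N : ℤ) ((N : ℤ) + N), z a (b + ((p.1 : ℤ) - p.2)) * z a b) := by
          refine Finset.sum_congr rfl fun a _ => ?_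
          rw [Finset.mul_sum, Finset.mul_sum]
          refine Finset.sum_congr rfl fun p _ => by ring
      _ = ∑ p ∈ range L ×ˢ range L, ((N : ℝ) + L) * ∑ a ∈ range Ma, Ω a *
          ∑ b ∈ Ico (N : ℤ) ((N : ℤ) + N), z a (b + ((p.1 : ℤ) - p.2)) * z a b := by
          rw [Finset.sum_comm]
          refine Finset.sum_congr rfl fun p _ => ?_
          rw [Finset.mul_sum]
  -- the inner correlations are bounded by `Ψ'`
  have hΓ : ∀ hh : ℤ, ∑ a ∈ range Ma, Ω a * ∑ b ∈ Ico (N : ℤ) ((N : ℤ) + N), z a (b + hh) * z a b ≤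
      diffCorr T j Ω Ma hh := by
    intro hh
    unfold diffCorr
    -- pass to `b ∈ D_j`
    have hreidx : ∀ a, ∑ b ∈ Ico (N : ℤ) ((N : ℤ) + N), z a (b + hh) * z a b =
        ∑ b ∈ dyBlock j, (if ((b : ℤ) + hh).toNat ∈ dyBlock j then
          β (((b : ℤ) + hh).toNat) * natWalsh T (a * ((b : ℤ) + hh).toNat) else 0) *
          (β b * natWalsh T (a * b)) := by
      intro a
      refine Finset.sum_nbij' (fun b : ℤ => b.toNat) (fun b : ℕ => (b : ℤ)) ?_ ?_ ?_ ?_ ?_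
      · intro b hb
        rw [mem_Ico] at hb
        rw [mem_dyBlock, ← hNdef, pow_succ]
        constructor <;> omega
      · intro b hb
        rw [mem_dyBlock, ← hNdef, pow_succ] at hb
        rw [mem_Ico]
        constructor <;> omega
      · intro b hb
        rw [mem_Ico] at hb
        exact Int.toNat_of_nonneg (by omega)
      · intro b _
        exact Int.toNat_natCast b
      · intro b hb
        rw [mem_Ico] at hb
        have hb0 : (0 : ℤ) ≤ b := by omega
        have hbnat : ((b.toNat : ℕ) : ℤ) = b := Int.toNat_of_nonneg hb0
        simp only [hz]
        rw [hbnat]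
        have hcond2 : (0 ≤ b ∧ b.toNat ∈ dyBlock j) := ⟨hb0, by rw [mem_dyBlock, ← hNdef, pow_succ]; constructor <;> omega⟩
        rw [if_pos hcond2]
        by_cases hc : (b + hh).toNat ∈ dyBlock j
        · have h0 : 0 ≤ b + hh := by
            by_contra hneg
            rw [mem_dyBlock, Int.toNat_of_nonpos (by omega)] at hc
            have := Nat.one_le_two_pow (n := j); omega
          rw [if_pos ⟨h0, hc⟩, if_pos hc]
        · rw [if_neg (fun h => hc h.2), if_neg hc]
    simp_rw [hreidx]
    rw [show (∑ a ∈ range Ma, Ω a * ∑ b ∈ dyBlock j,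
        (if ((b : ℤ) + hh).toNat ∈ dyBlock j then
          β (((b : ℤ) + hh).toNat) * natWalsh T (a * ((b : ℤ) + hh).toNat) else 0) * (β b * natWalsh T (a * b))) =
        ∑ b ∈ dyBlock j, (if ((b : ℤ) + hh).toNat ∈ dyBlock j then
          β (((b : ℤ) + hh).toNat) * β b *
            ∑ a ∈ range Ma, Ω a * (natWalsh T (a * ((b : ℤ) + hh).toNat) * natWalsh T (a * b)) else 0) by
      rw [Finset.sum_congr rfl fun a _ => Finset.mul_sum _ _ _, Finset.sum_comm]
      refine Finset.sum_congr rfl fun b _ => ?_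
      split_ifs
      · rw [Finset.mul_sum]
        refine Finset.sum_congr rfl fun a _ => by ring
      · simp]
    refine Finset.sum_le_sum fun b _ => ?_
    split_ifs with hc
    · calc β (((b : ℤ) + hh).toNat) * β b *
            ∑ a ∈ range Ma, Ω a * (natWalsh T (a * ((b : ℤ) + hh).toNat) * natWalsh T (a * b))
          ≤ |β (((b : ℤ) + hh).toNat) * β b *
            ∑ a ∈ range Ma, Ω a * (natWalsh T (a * ((b : ℤ) + hh).toNat) * natWalsh T (a * b))| := le_abs_self _
        _ = |β (((b : ℤ) + hh).toNat)| * |β b| *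
            |∑ a ∈ range Ma, Ω a * (natWalsh T (a * ((b : ℤ) + hh).toNat) * natWalsh T (a * b))| := by
            rw [abs_mul, abs_mul]
        _ ≤ 1 * 1 * |∑ a ∈ range Ma, Ω a * (natWalsh T (a * ((b : ℤ) + hh).toNat) * natWalsh T (a * b))| := by
            refine mul_le_mul_of_nonneg_right (mul_le_mul (hβ _) (hβ _) (abs_nonneg _) zero_le_one) (abs_nonneg _)
        _ = _ := by ring
    · exact le_rfl
  -- regroup the pairs by their difference
  have hstep2 : ∑ p ∈ range L ×ˢ range L, ∑ a ∈ range Ma, Ω a *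
      ∑ b ∈ Ico (N : ℤ) ((N : ℤ) + N), z a (b + ((p.1 : ℤ) - p.2)) * z a b ≤
      L * ∑ ℓ ∈ Ioo (-(L : ℤ)) L, diffCorr T j Ω Ma ℓ :=
    (Finset.sum_le_sum fun p _ => hΓ _).trans (sum_pairs_le_mul_sum_Ioo (diffCorr_nonneg T j Ω Ma) L)
  have hmain : (L : ℝ) ^ 2 * ∑ a ∈ range Ma, Ω a * (longSum T β j a) ^ 2 ≤
      ((N : ℝ) + L) * (L * ∑ ℓ ∈ Ioo (-(L : ℤ)) L, diffCorr T j Ω Ma ℓ) :=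
    hstep1.trans (mul_le_mul_of_nonneg_left hstep2 (by positivity))
  rw [div_mul_eq_mul_div, le_div_iff₀ hL0]
  have hNr : (N : ℝ) = (2 : ℝ) ^ j := by rw [hNdef]; push_cast; ring
  rw [hNr] at hmain
  nlinarith [hmain, hL0]

/-- The undifferenced term: `Ψ'(0) = 2^j ∑_a Ω(a)`. [folklore] -/
theorem diffCorr_zero_eq {Ω : ℕ → ℝ} (hΩ : ∀ a, 0 ≤ Ω a) (Ma : ℕ) :
    diffCorr T j Ω Ma 0 = 2 ^ j * ∑ a ∈ range Ma, Ω a := by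
  unfold diffCorr
  have h1 : ∀ b ∈ dyBlock j, (if ((b : ℤ) + 0).toNat ∈ dyBlock j then
      |∑ a ∈ range Ma, Ω a * (natWalsh T (a * ((b : ℤ) + 0).toNat) * natWalsh T (a * b))| else 0) =
      ∑ a ∈ range Ma, Ω a := by
    intro b hb
    rw [add_zero, Int.toNat_natCast, if_pos hb]
    have : ∀ a, natWalsh T (a * b) * natWalsh T (a * b) = 1 := fun a => by
      have h := abs_natWalsh T (a * b)
      rcases abs_eq (zero_le_one) |>.1 h with h | h <;> rw [h] <;> norm_num
    simp_rw [this, mul_one]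
    exact abs_of_nonneg (Finset.sum_nonneg fun a _ => hΩ a)
  rw [Finset.sum_congr rfl h1, Finset.sum_const, nsmul_eq_mul]
  congr 1
  rw [dyBlock, Nat.card_Ico, pow_succ]
  rw [show (2 : ℕ) ^ j * 2 - 2 ^ j = 2 ^ j by omega]; push_cast; ring

/-- **Step 2: digit truncation of the differenced correlation** (Bourgain 2013, before (2.3), with
the carry count of [M-R] Lemma 5): for a weight `0 ≤ Ω ≤ 1` supported on `[2^{i-1}, 2^{i+2})`,
`i ≥ 1`, a shift `0 < |ℓ| < 2^ρ` (`ρ ≥ 1`) and `ρ + E + 5 ≤ j`,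
`Ψ'_T(ℓ) ≤ Ψ'_{T₀}(ℓ) + 36·2^i·2^j/2^E` with `T₀ = T ∩ [0, i+2+ρ+E)`.
[cite: Bourgain2013MoebiusWalsh, §2 (before (2.3))] -/
theorem diffCorr_le_window {Ω : ℕ → ℝ} (hΩ0 : ∀ a, 0 ≤ Ω a) (hΩ1 : ∀ a, Ω a ≤ 1) {i : ℕ} (hi : 1 ≤ i)
    (hsupp : ∀ a, Ω a ≠ 0 → 2 ^ (i - 1) ≤ a ∧ a < 2 ^ (i + 2)) {ρ E : ℕ} (hρ : 1 ≤ ρ)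
    (hjE : ρ + E + 5 ≤ j) {ℓ : ℤ} (hℓ0 : ℓ ≠ 0) (hℓ : |ℓ| < 2 ^ ρ) :
    diffCorr T j Ω (3 * 2 ^ i) ℓ ≤
      diffCorr (T.filter (fun t => t < i + 2 + ρ + E)) j Ω (3 * 2 ^ i) ℓ + 36 * 2 ^ i * 2 ^ j / 2 ^ E := by
  classical
  set P₀ := i + 2 + ρ with hP₀
  set T₀ := T.filter (fun t => t < i + 2 + ρ + E) with hT₀
  have hT₀' : T₀ = T.filter (fun t => 0 ≤ t ∧ t < P₀ + E) := by
    rw [hT₀]; refine Finset.filter_congr fun t _ => ?_; rw [hP₀]; omega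
  set n : ℕ := ℓ.natAbs with hn
  have hn0 : 0 < n := Int.natAbs_pos.2 hℓ0
  have hnρ : n < 2 ^ ρ := by
    have : (n : ℤ) < 2 ^ ρ := by rw [hn, Int.natCast_natAbs]; exact_mod_cast hℓ
    exact_mod_cast this
  set bad : ℕ → Prop := fun x => x / 2 ^ P₀ % 2 ^ E = 2 ^ E - 1 ∨ x / 2 ^ P₀ % 2 ^ E = 0 with hbad
  -- pointwise comparison of the two products off the bad set
  have hpt : ∀ a b : ℕ, Ω a ≠ 0 → ((b : ℤ) + ℓ).toNat ∈ dyBlock j → b ∈ dyBlock j →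
      |Ω a * (natWalsh T (a * ((b : ℤ) + ℓ).toNat) * natWalsh T (a * b)) -
        Ω a * (natWalsh T₀ (a * ((b : ℤ) + ℓ).toNat) * natWalsh T₀ (a * b))| ≤
        2 * (if bad (a * b) then Ω a else 0) := by
    intro a b ha hbℓ hb
    have hab := hsupp a ha
    have hc : n * a * 2 ^ 0 < 2 ^ P₀ := by
      rw [pow_zero, mul_one, hP₀, show i + 2 + ρ = ρ + (i + 2) by ring, pow_add]
      exact Nat.mul_lt_mul_of_lt_of_le hnρ hab.2.le (by positivity)
    by_cases hB : bad (a * b)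
    · rw [if_pos hB, ← mul_sub, abs_mul, abs_of_nonneg (hΩ0 a)]
      calc Ω a * |natWalsh T (a * ((b : ℤ) + ℓ).toNat) * natWalsh T (a * b) -
            natWalsh T₀ (a * ((b : ℤ) + ℓ).toNat) * natWalsh T₀ (a * b)|
          ≤ Ω a * (1 + 1) := by
            refine mul_le_mul_of_nonneg_left ((abs_sub _ _).trans (add_le_add ?_ ?_)) (hΩ0 a)
            · rw [abs_mul, abs_natWalsh, abs_natWalsh]; norm_num
            · rw [abs_mul, abs_natWalsh, abs_natWalsh]; norm_num
        _ = 2 * Ω a := by ring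
    · rw [if_neg hB, mul_zero]
      simp only [hbad, not_or] at hB
      have key := natWalsh_mul_natWalsh_shift_eq T (x := a * b) (c := n * a) (K := 0) (P := P₀) (E := E) hc hB.1 hB.2
      rw [← hT₀'] at key
      rw [pow_zero, mul_one] at key
      -- identify `a · (b + ℓ)` with `ab ± na`
      have hprod : a * ((b : ℤ) + ℓ).toNat = (if 0 ≤ ℓ then a * b + n * a else a * b - n * a) := by
        split_ifs with hℓs
        · have e : ((b : ℤ) + ℓ).toNat = b + n := by
            rw [hn]; have := Int.natAbs_of_nonneg hℓs; omega
          rw [e]; ring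
        · have e : ((b : ℤ) + ℓ).toNat = b - n := by
            rw [hn]; have := Int.ofNat_natAbs_of_nonpos (le_of_lt (not_le.mp hℓs)); omega
          rw [e, Nat.mul_sub]; ring_nf
      rw [hprod]
      split_ifs at hprod ⊢ with hℓs
      · rw [mul_comm (natWalsh T (a * b + n * a)), mul_comm (natWalsh T₀ (a * b + n * a)), key.1, sub_self, abs_zero]
      · rw [mul_comm (natWalsh T (a * b - n * a)), mul_comm (natWalsh T₀ (a * b - n * a)), key.2, sub_self, abs_zero]
  -- sum over `a`, then over `b`
  have hb_step : ∀ b ∈ dyBlock j, (if ((b : ℤ) + ℓ).toNat ∈ dyBlock j then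
      |∑ a ∈ range (3 * 2 ^ i), Ω a * (natWalsh T (a * ((b : ℤ) + ℓ).toNat) * natWalsh T (a * b))| else 0) ≤
      (if ((b : ℤ) + ℓ).toNat ∈ dyBlock j then
        |∑ a ∈ range (3 * 2 ^ i), Ω a * (natWalsh T₀ (a * ((b : ℤ) + ℓ).toNat) * natWalsh T₀ (a * b))| else 0) +
        2 * ∑ a ∈ range (3 * 2 ^ i), (if bad (a * b) then Ω a else 0) := by
    intro b hb
    split_ifs with hbℓ
    · rw [Finset.mul_sum]
      calc |∑ a ∈ range (3 * 2 ^ i), Ω a * (natWalsh T (a * ((b : ℤ) + ℓ).toNat) * natWalsh T (a * b))|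
          = |∑ a ∈ range (3 * 2 ^ i), Ω a * (natWalsh T₀ (a * ((b : ℤ) + ℓ).toNat) * natWalsh T₀ (a * b)) +
              ∑ a ∈ range (3 * 2 ^ i), (Ω a * (natWalsh T (a * ((b : ℤ) + ℓ).toNat) * natWalsh T (a * b)) -
                Ω a * (natWalsh T₀ (a * ((b : ℤ) + ℓ).toNat) * natWalsh T₀ (a * b)))| := by
            rw [← Finset.sum_add_distrib]; congr 1; exact Finset.sum_congr rfl fun a _ => by ring
        _ ≤ |∑ a ∈ range (3 * 2 ^ i), Ω a * (natWalsh T₀ (a * ((b : ℤ) + ℓ).toNat) * natWalsh T₀ (a * b))| +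
              ∑ a ∈ range (3 * 2 ^ i), |Ω a * (natWalsh T (a * ((b : ℤ) + ℓ).toNat) * natWalsh T (a * b)) -
                Ω a * (natWalsh T₀ (a * ((b : ℤ) + ℓ).toNat) * natWalsh T₀ (a * b))| :=
            (abs_add_le _ _).trans (add_le_add le_rfl (Finset.abs_sum_le_sum_abs _ _))
        _ ≤ _ := by
            refine add_le_add le_rfl (Finset.sum_le_sum fun a _ => ?_)
            by_cases ha : Ω a = 0
            · rw [ha]; simp
            · exact hpt a b ha hbℓ hb
    · have : 0 ≤ 2 * ∑ a ∈ range (3 * 2 ^ i), (if bad (a * b) then Ω a else 0) :=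
        mul_nonneg zero_le_two (Finset.sum_nonneg fun a _ => by split_ifs; exacts [hΩ0 a, le_rfl])
      linarith
  unfold diffCorr
  refine (Finset.sum_le_sum hb_step).trans ?_
  rw [Finset.sum_add_distrib]
  refine add_le_add le_rfl ?_
  -- the carry-bad count
  rw [← Finset.mul_sum, Finset.sum_comm]
  have hN : (2 : ℝ) ^ ρ * 16 + 2 ≤ (2 : ℝ) ^ j / 2 ^ E := by
    rw [le_div_iff₀ (by positivity)]
    have h1 : (2 : ℝ) ^ ρ * 16 * 2 ^ E = 2 ^ (ρ + E + 4) := by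
      rw [pow_add, pow_add]; norm_num; ring
    have h2 : (2 : ℝ) * 2 ^ E ≤ 2 ^ (ρ + E + 4) := by
      rw [show (2 : ℝ) * 2 ^ E = 2 ^ (E + 1) by ring]
      exact pow_le_pow_right₀ (by norm_num) (by omega)
    have h3 : (2 : ℝ) ^ (ρ + E + 4) * 2 ≤ 2 ^ j := by
      rw [show (2 : ℝ) ^ (ρ + E + 4) * 2 = 2 ^ (ρ + E + 5) by ring]
      exact pow_le_pow_right₀ (by norm_num) hjE
    nlinarith
  have hcount : ∀ a ∈ range (3 * 2 ^ i), ∑ b ∈ dyBlock j, (if bad (a * b) then Ω a else 0) ≤ 6 * 2 ^ j / 2 ^ E := by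
    intro a _
    by_cases ha : Ω a = 0
    · simp only [ha, ite_self, Finset.sum_const_zero]; positivity
    obtain ⟨ha1, ha2⟩ := hsupp a ha
    have ha0 : 0 < a := lt_of_lt_of_le (Nat.two_pow_pos _) ha1
    rw [Finset.sum_ite, Finset.sum_const_zero, add_zero, Finset.sum_const, nsmul_eq_mul]
    -- one digit pattern
    have hone : ∀ c, ((((dyBlock j).filter fun b => a * b / 2 ^ P₀ % 2 ^ E = c).card : ℕ) : ℝ) ≤
        3 * 2 ^ j / 2 ^ E := by
      intro c
      have h := card_filter_block_eq_le ha0 (2 ^ j) (2 ^ j) P₀ E c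
      rw [show (2 : ℕ) ^ j + 2 ^ j = 2 ^ (j + 1) by rw [pow_succ]; ring] at h
      rw [show dyBlock j = Ico (2 ^ j) (2 ^ (j + 1)) from rfl]
      have hcast : ((((Ico (2 ^ j) (2 ^ (j + 1))).filter fun b => a * b / 2 ^ P₀ % 2 ^ E = c).card : ℕ) : ℝ) ≤
          (((a * 2 ^ j / 2 ^ (P₀ + E) : ℕ) : ℝ) + 2) * ((((2 ^ P₀ - 1) / a : ℕ) : ℝ) + 1) := by
        exact_mod_cast h
      refine hcast.trans ?_
      have hX : ((a * 2 ^ j / 2 ^ (P₀ + E) : ℕ) : ℝ) ≤ (a : ℝ) * 2 ^ j / 2 ^ (P₀ + E) := by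
        have := Nat.cast_div_le (m := a * 2 ^ j) (n := 2 ^ (P₀ + E)) (α := ℝ)
        push_cast at this; exact this
      have hY : (((2 ^ P₀ - 1) / a : ℕ) : ℝ) ≤ (2 : ℝ) ^ P₀ / a := by
        have h1 := Nat.cast_div_le (m := 2 ^ P₀ - 1) (n := a) (α := ℝ)
        have h2 : (((2 ^ P₀ - 1 : ℕ)) : ℝ) ≤ (2 : ℝ) ^ P₀ := by
          have : 2 ^ P₀ - 1 ≤ 2 ^ P₀ := Nat.sub_le _ _
          exact_mod_cast this
        exact h1.trans (div_le_div_of_nonneg_right h2 (by positivity))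
      have har : (0 : ℝ) < a := by exact_mod_cast ha0
      have ha1r : (2 : ℝ) ^ (i - 1) ≤ a := by exact_mod_cast ha1
      have ha2r : (a : ℝ) ≤ 2 ^ (i + 2) := by exact_mod_cast ha2.le
      set X : ℝ := (a : ℝ) * 2 ^ j / 2 ^ (P₀ + E) with hXdef
      set Y : ℝ := (2 : ℝ) ^ P₀ / a with hYdef
      have hXY : X * Y = 2 ^ j / 2 ^ E := by
        rw [hXdef, hYdef, pow_add]; field_simp
      have hXle : X ≤ 2 ^ j / 2 ^ E := by
        rw [hXdef, pow_add, div_le_div_iff₀ (by positivity) (by positivity)]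
        have : (a : ℝ) ≤ 2 ^ P₀ := by
          refine ha2r.trans (pow_le_pow_right₀ (by norm_num) (by rw [hP₀]; omega))
        have h0 : (0 : ℝ) ≤ 2 ^ j * 2 ^ E := by positivity
        nlinarith
      have hYle : Y ≤ 2 ^ ρ * 8 := by
        rw [hYdef, div_le_iff₀ har]
        calc (2 : ℝ) ^ P₀ = 2 ^ ρ * 8 * 2 ^ (i - 1) := by
              rw [hP₀, show i + 2 + ρ = ρ + 3 + (i - 1) by omega, pow_add, pow_add]; norm_num
          _ ≤ 2 ^ ρ * 8 * a := mul_le_mul_of_nonneg_left ha1r (by positivity)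
      have hX0 : 0 ≤ X := by rw [hXdef]; positivity
      have hY0 : 0 ≤ Y := by rw [hYdef]; positivity
      calc (((a * 2 ^ j / 2 ^ (P₀ + E) : ℕ) : ℝ) + 2) * ((((2 ^ P₀ - 1) / a : ℕ) : ℝ) + 1)
          ≤ (X + 2) * (Y + 1) := mul_le_mul (by linarith) (by linarith) (by positivity) (by linarith)
        _ = X * Y + X + 2 * Y + 2 := by ring
        _ ≤ 2 ^ j / 2 ^ E + 2 ^ j / 2 ^ E + (2 ^ ρ * 16 + 2) := by rw [hXY]; linarith
        _ ≤ 2 ^ j / 2 ^ E + 2 ^ j / 2 ^ E + 2 ^ j / 2 ^ E := by linarith [hN]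
        _ = 3 * 2 ^ j / 2 ^ E := by ring
    calc (((dyBlock j).filter fun b => bad (a * b)).card : ℝ) * Ω a
        ≤ (((dyBlock j).filter fun b => bad (a * b)).card : ℝ) * 1 :=
          mul_le_mul_of_nonneg_left (hΩ1 a) (by positivity)
      _ ≤ 3 * 2 ^ j / 2 ^ E + 3 * 2 ^ j / 2 ^ E := by
          rw [mul_one]
          have hsplitB : ((dyBlock j).filter fun b => bad (a * b)) ⊆
              ((dyBlock j).filter fun b => a * b / 2 ^ P₀ % 2 ^ E = 2 ^ E - 1) ∪
                ((dyBlock j).filter fun b => a * b / 2 ^ P₀ % 2 ^ E = 0) := by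
            intro b hb
            rw [Finset.mem_filter] at hb
            rw [Finset.mem_union, Finset.mem_filter, Finset.mem_filter]
            rcases hb.2 with h | h
            · exact Or.inl ⟨hb.1, h⟩
            · exact Or.inr ⟨hb.1, h⟩
          calc (((dyBlock j).filter fun b => bad (a * b)).card : ℝ)
              ≤ ((((dyBlock j).filter fun b => a * b / 2 ^ P₀ % 2 ^ E = 2 ^ E - 1) ∪
                  ((dyBlock j).filter fun b => a * b / 2 ^ P₀ % 2 ^ E = 0)).card : ℝ) := by
                exact_mod_cast Finset.card_le_card hsplitB
            _ ≤ ((((dyBlock j).filter fun b => a * b / 2 ^ P₀ % 2 ^ E = 2 ^ E - 1)).card : ℝ) +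
                  ((((dyBlock j).filter fun b => a * b / 2 ^ P₀ % 2 ^ E = 0)).card : ℝ) := by
                exact_mod_cast Finset.card_union_le _ _
            _ ≤ _ := add_le_add (hone _) (hone _)
      _ = 6 * 2 ^ j / 2 ^ E := by ring
  calc 2 * ∑ a ∈ range (3 * 2 ^ i), ∑ b ∈ dyBlock j, (if bad (a * b) then Ω a else 0)
      ≤ 2 * ∑ _a ∈ range (3 * 2 ^ i), (6 : ℝ) * 2 ^ j / 2 ^ E :=
        mul_le_mul_of_nonneg_left (Finset.sum_le_sum hcount) zero_le_two
    _ = 36 * 2 ^ i * 2 ^ j / 2 ^ E := by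
        rw [Finset.sum_const, Finset.card_range, nsmul_eq_mul]; push_cast; ring

/-- **Step 4 for the bottom window: from the differenced correlation to the resonance sum**
(Bourgain 2013, (2.5), (2.11)): expanding `w_{T₀}` (`T₀ ⊆ [0, ν)`) on `ℤ/2^νℤ` and summing the
smooth weight `Ω` over the short variable,
`Ψ'_{T₀}(ℓ) ≤ 2M·∑_b ∑_{h,h'} ω(h)ω(h') 𝟙[‖((h+h')b + h'ℓ)/2^ν‖ < 1/M₁] + 2M (M₁/(2W))^A N (2·2^{κν})²`
(`M = 2^i`, `N = 2^j`; the second term is the tail of `Ω̂`, the first the resonant set).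
[cite: Bourgain2013MoebiusWalsh, (2.11)] -/
theorem diffCorr_le_resonance {ν i : ℕ} {T₀ : Finset ℕ} (hT₀ : ∀ t ∈ T₀, t < ν) {W A : ℕ} (hW : 0 < W)
    (hAW : A * W ≤ 2 ^ i) {M₁ : ℝ} (hM₁ : 0 < M₁) (ℓ : ℤ) :
    diffCorr T₀ j (boxKernel (2 ^ i) W A) (3 * 2 ^ i) ℓ ≤
      2 * 2 ^ i * ∑ b ∈ (Ico (2 ^ j) (2 ^ j + 2 ^ j) : Finset ℕ), ∑ h ∈ range (2 ^ ν), ∑ h' ∈ range (2 ^ ν),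
        specWeight (T₀.attachFin hT₀) h * specWeight (T₀.attachFin hT₀) h' *
          (if distInt ((((h : ℝ) + h') * (b : ℕ) + (h' : ℝ) * ℓ) / 2 ^ ν) < 1 / M₁ then (1 : ℝ) else 0) +
      2 * 2 ^ i * (M₁ / (2 * W)) ^ A * 2 ^ j * (2 * (2 : ℝ) ^ (walshL1Exponent * ν)) ^ 2 := by
  classical
  set Q := 2 ^ ν with hQdef
  set M := 2 ^ i with hMdef
  set Afin := T₀.attachFin hT₀ with hAfin
  set ω := specWeight Afin with hω
  set t : ℝ := (M₁ / (2 * W)) ^ A with ht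
  have ht0 : 0 ≤ t := by positivity
  have hω0 : ∀ h, 0 ≤ ω h := specWeight_nonneg Afin
  have hω1 : ∑ h ∈ range Q, ω h ≤ 2 * (2 : ℝ) ^ (walshL1Exponent * ν) := by
    simp only [hω, specWeight, hQdef]
    exact sum_norm_walshCoeff_le Afin
  have hD : dyBlock j = Ico (2 ^ j) (2 ^ j + 2 ^ j) := by rw [dyBlock, pow_succ, mul_two]
  set Ind : ℕ → ℕ → ℕ → ℝ := fun h h' b =>
    if distInt ((((h : ℝ) + h') * b + (h' : ℝ) * ℓ) / 2 ^ ν) < 1 / M₁ then (1 : ℝ) else 0 with hInd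
  -- the bound for one `b` with `b + ℓ ∈ D_j`
  have hb_bound : ∀ b ∈ dyBlock j, ((b : ℤ) + ℓ).toNat ∈ dyBlock j →
      |∑ a ∈ range (3 * M), boxKernel M W A a *
        (natWalsh T₀ (a * ((b : ℤ) + ℓ).toNat) * natWalsh T₀ (a * b))| ≤
        ∑ h ∈ range Q, ∑ h' ∈ range Q, ω h * ω h' * (2 * M * Ind h h' b + 2 * M * t) := by
    intro b hb hbℓ
    set bℓ := ((b : ℤ) + ℓ).toNat with hbℓdef
    have hbℓpos : ((bℓ : ℕ) : ℤ) = (b : ℤ) + ℓ := by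
      rw [hbℓdef]; refine Int.toNat_of_nonneg ?_
      by_contra hneg
      rw [mem_dyBlock, hbℓdef, Int.toNat_of_nonpos (by omega)] at hbℓ
      have := Nat.one_le_two_pow (n := j); omega
    -- complexify and expand
    have hexp : ((∑ a ∈ range (3 * M), boxKernel M W A a *
        (natWalsh T₀ (a * bℓ) * natWalsh T₀ (a * b)) : ℝ) : ℂ) =
        ∑ h ∈ range Q, ∑ h' ∈ range Q,
          walshCoeff Afin ((h : ℝ) / 2 ^ ν) * walshCoeff Afin ((h' : ℝ) / 2 ^ ν) *
            ∑ a ∈ range (3 * M), (boxKernel M W A a : ℂ) * eChar (a * (-(((h : ℝ) * b + (h' : ℝ) * bℓ)) / 2 ^ ν)) := by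
      push_cast
      -- `x` is the frequency of `w(a bℓ)`, `y` that of `w(ab)`
      have hterm : ∀ a : ℕ, (boxKernel M W A a : ℂ) * ((natWalsh T₀ (a * bℓ) : ℂ) * (natWalsh T₀ (a * b) : ℂ)) =
          ∑ x ∈ range Q, ∑ y ∈ range Q,
            walshCoeff Afin ((y : ℝ) / 2 ^ ν) * walshCoeff Afin ((x : ℝ) / 2 ^ ν) *
              ((boxKernel M W A a : ℂ) * eChar (a * (-(((y : ℝ) * b + (x : ℝ) * bℓ)) / 2 ^ ν))) := by
        intro a
        rw [natWalsh_eq_sum_range T₀ hT₀ (a * b), natWalsh_eq_sum_range T₀ hT₀ (a * bℓ)]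
        rw [← hQdef, ← hAfin, Finset.sum_mul_sum, Finset.mul_sum]
        refine Finset.sum_congr rfl fun x _ => ?_
        rw [Finset.mul_sum]
        refine Finset.sum_congr rfl fun y _ => ?_
        have : eChar (-((x : ℝ) * ((((a * bℓ : ℕ)) : ℝ) / 2 ^ ν))) * eChar (-((y : ℝ) * ((((a * b : ℕ)) : ℝ) / 2 ^ ν))) =
            eChar (a * (-(((y : ℝ) * b + (x : ℝ) * bℓ)) / 2 ^ ν)) := by
          rw [← eChar_add]; congr 1; push_cast; ring
        rw [← this]; ring
      rw [Finset.sum_congr rfl fun a _ => hterm a]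
      -- reorder to `∑_h ∑_{h'} ∑_a` with `h = y`, `h' = x`
      rw [Finset.sum_comm]
      rw [Finset.sum_congr rfl fun x _ => Finset.sum_comm]
      rw [Finset.sum_comm]
      refine Finset.sum_congr rfl fun h _ => Finset.sum_congr rfl fun h' _ => ?_
      rw [Finset.mul_sum]
    -- the kernel transform: resonant or tail
    have hkernel : ∀ h h' : ℕ, ‖∑ a ∈ range (3 * M), (boxKernel M W A a : ℂ) *
        eChar (a * (-(((h : ℝ) * b + (h' : ℝ) * bℓ)) / 2 ^ ν))‖ ≤ 2 * M * Ind h h' b + 2 * M * t := by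
      intro h h'
      set φ : ℝ := -(((h : ℝ) * b + (h' : ℝ) * bℓ)) / 2 ^ ν with hφ
      have hdist : distInt φ = distInt ((((h : ℝ) + h') * b + (h' : ℝ) * ℓ) / 2 ^ ν) := by
        rw [hφ, neg_div, Literature.NumberTheory.Sieve.Vinogradov.distInt_neg]
        congr 1
        have : ((bℓ : ℕ) : ℝ) = (b : ℝ) + ℓ := by exact_mod_cast hbℓpos
        rw [this]; ring
      have hM2 : ‖∑ a ∈ range (3 * M), (boxKernel M W A a : ℂ) * eChar (a * φ)‖ ≤ 2 * M := by
        have := norm_sum_boxKernel_mul_eChar_le (M := M) hAW hW φ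
        rw [hMdef] at this ⊢; push_cast at this ⊢; exact this
      simp only [hInd]
      split_ifs with hres
      · have : 0 ≤ 2 * (M : ℝ) * t := by positivity
        linarith
      · rw [mul_zero, zero_add]
        rw [← hdist, not_lt] at hres
        have hpos : 0 < distInt φ := lt_of_lt_of_le (by positivity) hres
        have htail := norm_sum_boxKernel_mul_eChar_le_tail (M := M) hAW hW hpos
        refine htail.trans ?_
        rw [hMdef]; push_cast
        refine mul_le_mul_of_nonneg_left ?_ (by positivity)
        rw [ht]
        refine pow_le_pow_left₀ (by positivity) ?_ A
        have hW0 : (0 : ℝ) < W := by exact_mod_cast hW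
        rw [div_le_div_iff₀ (by positivity) (by positivity)]
        have := mul_le_mul_of_nonneg_left hres (show (0 : ℝ) ≤ M₁ * (2 * W) by positivity)
        calc 1 * (2 * (W : ℝ)) = (1 / M₁) * (M₁ * (2 * W)) := by field_simp
          _ ≤ distInt φ * (M₁ * (2 * W)) := mul_le_mul_of_nonneg_right hres (by positivity)
          _ = M₁ * (2 * W * distInt φ) := by ring
    -- conclude for this `b`
    have hnorm : |∑ a ∈ range (3 * M), boxKernel M W A a * (natWalsh T₀ (a * bℓ) * natWalsh T₀ (a * b))| =
        ‖((∑ a ∈ range (3 * M), boxKernel M W A a * (natWalsh T₀ (a * bℓ) * natWalsh T₀ (a * b)) : ℝ) : ℂ)‖ := by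
      rw [Complex.norm_real, Real.norm_eq_abs]
    rw [hnorm, hexp]
    refine (norm_sum_le _ _).trans (Finset.sum_le_sum fun h _ => (norm_sum_le _ _).trans (Finset.sum_le_sum fun h' _ => ?_))
    rw [norm_mul, norm_mul]
    exact mul_le_mul_of_nonneg_left (hkernel h h') (mul_nonneg (norm_nonneg _) (norm_nonneg _))
  -- sum over `b`
  unfold diffCorr
  rw [hD]
  have hIco : Ico (2 ^ j) (2 ^ j + 2 ^ j) = dyBlock j := hD.symm
  calc ∑ b ∈ (Ico (2 ^ j) (2 ^ j + 2 ^ j) : Finset ℕ), (if ((b : ℤ) + ℓ).toNat ∈ Ico (2 ^ j) (2 ^ j + 2 ^ j) then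
        |∑ a ∈ range (3 * 2 ^ i), boxKernel (2 ^ i) W A a *
          (natWalsh T₀ (a * ((b : ℤ) + ℓ).toNat) * natWalsh T₀ (a * b))| else 0)
      ≤ ∑ b ∈ Ico (2 ^ j) (2 ^ j + 2 ^ j), ∑ h ∈ range Q, ∑ h' ∈ range Q, ω h * ω h' * (2 * M * Ind h h' b + 2 * M * t) := by
        refine Finset.sum_le_sum fun b hb => ?_
        split_ifs with hbℓ
        · rw [hIco] at hb hbℓ; rw [← hMdef]; exact hb_bound b hb hbℓ
        · exact Finset.sum_nonneg fun h _ => Finset.sum_nonneg fun h' _ => by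
            have := hω0 h; have := hω0 h'
            have : 0 ≤ 2 * (M : ℝ) * Ind h h' b + 2 * M * t := by
              have : 0 ≤ Ind h h' b := by simp only [hInd]; split_ifs <;> norm_num
              positivity
            positivity
    _ = 2 * M * ∑ b ∈ Ico (2 ^ j) (2 ^ j + 2 ^ j), ∑ h ∈ range Q, ∑ h' ∈ range Q, ω h * ω h' * Ind h h' b +
          2 * M * t * ∑ _b ∈ Ico (2 ^ j) (2 ^ j + 2 ^ j), (∑ h ∈ range Q, ω h) * (∑ h' ∈ range Q, ω h') := by
        rw [Finset.mul_sum, Finset.mul_sum, ← Finset.sum_add_distrib]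
        refine Finset.sum_congr rfl fun b _ => ?_
        rw [Finset.sum_mul_sum, Finset.mul_sum, Finset.mul_sum, ← Finset.sum_add_distrib]
        refine Finset.sum_congr rfl fun h _ => ?_
        rw [Finset.mul_sum, Finset.mul_sum, ← Finset.sum_add_distrib]
        refine Finset.sum_congr rfl fun h' _ => by ring
    _ ≤ 2 * M * ∑ b ∈ Ico (2 ^ j) (2 ^ j + 2 ^ j), ∑ h ∈ range Q, ∑ h' ∈ range Q, ω h * ω h' * Ind h h' b +
          2 * M * t * ∑ _b ∈ Ico (2 ^ j) (2 ^ j + 2 ^ j), (2 * (2 : ℝ) ^ (walshL1Exponent * ν)) ^ 2 := by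
        refine add_le_add le_rfl (mul_le_mul_of_nonneg_left (Finset.sum_le_sum fun b _ => ?_) (by positivity))
        rw [sq]
        exact mul_le_mul hω1 hω1 (Finset.sum_nonneg fun h _ => hω0 h) (by positivity)
    _ = _ := by
        rw [Finset.sum_const, Nat.card_Ico, Nat.add_sub_cancel_left, nsmul_eq_mul, hMdef]
        push_cast
        simp only [hInd, ht]
        ring

/-- The resonance bound of `resonance_bottom`, as a function of the parameters (it does not depend
on the shift `ℓ`). [cite: Bourgain2013MoebiusWalsh, (2.13)–(2.22)] -/
def resBoundBottom (ν cardA N L : ℕ) (M₁ : ℝ) : ℝ :=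
  N * (2 * (2 : ℝ) ^ (-(walshSupExponent * cardA))) ^ 2 * (2 * ((2 : ℝ) ^ ν / M₁ + L)) +
    ∑ r ∈ range ν, 2 * ((2 : ℝ) ^ (ν - r) / M₁ + 1) * ((N : ℝ) / 2 ^ (ν - r) + 1) *
      ((2 * ((2 : ℝ) ^ ν / M₁ + L)) * (2 * (2 : ℝ) ^ (walshL1Exponent * (ν - r : ℕ)))) *
      min (2 * (2 : ℝ) ^ (walshL1Exponent * (ν - r : ℕ)))
        (2 ^ (ν - r) * (2 * (2 : ℝ) ^ (-(walshSupExponent * cardA))))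

/-- `0 ≤ resBoundBottom`. [folklore] -/
theorem resBoundBottom_nonneg (ν cardA N L : ℕ) {M₁ : ℝ} (hM₁ : 0 < M₁) : 0 ≤ resBoundBottom ν cardA N L M₁ := by
  unfold resBoundBottom
  refine add_nonneg (by positivity) (Finset.sum_nonneg fun r _ => ?_)
  refine mul_nonneg (by positivity) (le_min (by positivity) (by positivity))

/-- **The type-II mean square with the bottom digit window** (Bourgain 2013, §2 for `K = 0`,
assembled): for `|β| ≤ 1`, `i ≥ 1`, `ρ ≥ 1`, `ρ + E + 5 ≤ j`, `W ≥ 1`, `AW ≤ 2^{i-1}`, `M₁ > 0`,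
with `M = 2^i`, `N = 2^j`, `L = 2^ρ`, `ν = i+2+ρ+E`, `T₀ = T ∩ [0, ν)`,
`∑_{a ∈ D_i} (∑_{b ∈ D_j} β(b) w_T(ab))² ≤ ((N+L)/L)·(3MN + 2L·(36MN/2^E + 2M·RES + 2M (M₁/(2W))^A N (2·2^{κν})²))`
where `RES = resBoundBottom ν |T₀| N L M₁`. [cite: Bourgain2013MoebiusWalsh, §2 (2.1)–(2.22)] -/
theorem meanSquare_le_bottom {β : ℕ → ℝ} (hβ : ∀ b, |β b| ≤ 1) {i : ℕ} (hi : 1 ≤ i) {ρ E W A : ℕ}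
    (hρ : 1 ≤ ρ) (hjE : ρ + E + 5 ≤ j) (hW : 0 < W) (hAW : A * W ≤ 2 ^ i / 2)
    {M₁ : ℝ} (hM₁ : 0 < M₁) :
    ∑ a ∈ dyBlock i, (longSum T β j a) ^ 2 ≤
      (((2 : ℝ) ^ j + 2 ^ ρ) / 2 ^ ρ) * (3 * 2 ^ i * 2 ^ j + 2 * 2 ^ ρ *
        (36 * 2 ^ i * 2 ^ j / 2 ^ E +
          2 * 2 ^ i * resBoundBottom (i + 2 + ρ + E) (T.filter (fun t => t < i + 2 + ρ + E)).card
            (2 ^ j) (2 ^ ρ) M₁ +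
          2 * 2 ^ i * (M₁ / (2 * W)) ^ A * 2 ^ j * (2 * (2 : ℝ) ^ (walshL1Exponent * (i + 2 + ρ + E : ℕ))) ^ 2)) := by
  classical
  set ν := i + 2 + ρ + E with hν
  set M := 2 ^ i with hMdef
  set N := 2 ^ j with hNdef
  set L := 2 ^ ρ with hLdef
  set T₀ := T.filter (fun t => t < i + 2 + ρ + E) with hT₀
  have hT₀ν : ∀ t ∈ T₀, t < ν := fun t ht => by rw [hT₀, Finset.mem_filter] at ht; exact ht.2
  set Ω := boxKernel M W A with hΩ
  have hΩ0 : ∀ a, 0 ≤ Ω a := boxKernel_nonneg M W A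
  have hΩ1 : ∀ a, Ω a ≤ 1 := boxKernel_le_one M W A
  have hAW' : A * W ≤ M := hAW.trans (Nat.div_le_self _ _)
  have hsupp : ∀ a, Ω a ≠ 0 → 2 ^ (i - 1) ≤ a ∧ a < 2 ^ (i + 2) := by
    intro a ha
    by_contra hcon
    apply ha
    apply boxKernel_eq_zero
    rw [not_and_or, not_le, not_lt] at hcon
    have hM2 : M / 2 = 2 ^ (i - 1) := by
      rw [hMdef, ← Nat.pow_div hi (by norm_num), pow_one]
    rcases hcon with h | h
    · left; rw [hM2]; exact h
    · right
      have : A * (W - 1) ≤ M / 2 := (Nat.mul_le_mul_left A (Nat.sub_le W 1)).trans hAW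
      have h4 : 2 ^ (i + 2) = 4 * M := by rw [hMdef, pow_add]; ring
      omega
  have hL1 : 1 ≤ L := Nat.one_le_two_pow
  have hL0 : (0 : ℝ) < L := by exact_mod_cast hL1
  -- Step 1
  have hDsub : dyBlock i ⊆ range (3 * M) := by
    intro a ha; rw [mem_dyBlock] at ha; rw [mem_range, hMdef]; rw [pow_succ] at ha; omega
  have hS1 : ∑ a ∈ dyBlock i, (longSum T β j a) ^ 2 ≤ ∑ a ∈ range (3 * M), Ω a * (longSum T β j a) ^ 2 := by
    calc ∑ a ∈ dyBlock i, (longSum T β j a) ^ 2 = ∑ a ∈ dyBlock i, Ω a * (longSum T β j a) ^ 2 := by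
          refine Finset.sum_congr rfl fun a ha => ?_
          rw [mem_dyBlock] at ha
          have h2M : 2 ^ (i + 1) = 2 * M := by rw [hMdef, pow_succ, mul_comm]
          rw [hΩ, boxKernel_eq_one hAW hW ha.1 (by omega), one_mul]
      _ ≤ ∑ a ∈ range (3 * M), Ω a * (longSum T β j a) ^ 2 :=
          Finset.sum_le_sum_of_subset_of_nonneg hDsub fun a _ _ => mul_nonneg (hΩ0 a) (sq_nonneg _)
  have hS2 := sum_weight_mul_longSum_sq_le T β j hΩ0 hβ (3 * M) hL1
  -- Step 2–4 for each shift
  set RES := resBoundBottom ν T₀.card N L M₁ with hRES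
  have hRES0 : 0 ≤ RES := resBoundBottom_nonneg _ _ _ _ hM₁
  set C : ℝ := 36 * M * N / 2 ^ E + 2 * M * RES +
    2 * M * (M₁ / (2 * W)) ^ A * N * (2 * (2 : ℝ) ^ (walshL1Exponent * ν)) ^ 2 with hC
  have hC0 : 0 ≤ C := by rw [hC]; positivity
  have hshift : ∀ ℓ ∈ (Ioo (-(L : ℤ)) L).erase 0, diffCorr T j Ω (3 * M) ℓ ≤ C := by
    intro ℓ hℓ
    rw [Finset.mem_erase, Finset.mem_Ioo] at hℓ
    have hℓ0 : ℓ ≠ 0 := hℓ.1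
    have hℓL : |ℓ| < L := abs_lt.2 ⟨hℓ.2.1, hℓ.2.2⟩
    have hℓL' : |ℓ| < 2 ^ ρ := by rw [hLdef] at hℓL; exact_mod_cast hℓL
    have h2 := diffCorr_le_window T j hΩ0 hΩ1 hi hsupp hρ hjE hℓ0 hℓL'
    have h4 := diffCorr_le_resonance j hT₀ν hW hAW' hM₁ ℓ
    have hres := resonance_bottom (T₀.attachFin hT₀ν) N N L hM₁ hℓ0 (by exact_mod_cast hℓL)
    rw [Finset.card_attachFin] at hres
    have hNN : (Ico N (N + N) : Finset ℕ) = Ico (2 ^ j) (2 ^ j + 2 ^ j) := by rw [hNdef]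
    rw [← hNN] at h4
    have hres' : ∑ b ∈ Ico N (N + N), ∑ h ∈ range (2 ^ ν), ∑ h' ∈ range (2 ^ ν),
        specWeight (T₀.attachFin hT₀ν) h * specWeight (T₀.attachFin hT₀ν) h' *
          (if distInt ((((h : ℝ) + h') * (b : ℕ) + (h' : ℝ) * ℓ) / 2 ^ ν) < 1 / M₁ then (1 : ℝ) else 0) ≤ RES := by
      rw [hRES]; unfold resBoundBottom; exact_mod_cast hres
    calc diffCorr T j Ω (3 * M) ℓ ≤ diffCorr T₀ j Ω (3 * M) ℓ + 36 * 2 ^ i * 2 ^ j / 2 ^ E := h2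
      _ ≤ (2 * 2 ^ i * RES + 2 * 2 ^ i * (M₁ / (2 * W)) ^ A * 2 ^ j * (2 * (2 : ℝ) ^ (walshL1Exponent * ν)) ^ 2) +
            36 * 2 ^ i * 2 ^ j / 2 ^ E := by
          have := mul_le_mul_of_nonneg_left hres' (show (0 : ℝ) ≤ 2 * 2 ^ i by positivity)
          linarith [h4]
      _ = C := by rw [hC, hMdef, hNdef]; push_cast; ring
  -- assemble
  have hsplit : ∑ ℓ ∈ Ioo (-(L : ℤ)) L, diffCorr T j Ω (3 * M) ℓ =
      diffCorr T j Ω (3 * M) 0 + ∑ ℓ ∈ (Ioo (-(L : ℤ)) L).erase 0, diffCorr T j Ω (3 * M) ℓ := by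
    rw [Finset.add_sum_erase]
    have : (0 : ℤ) < L := by exact_mod_cast hL1
    rw [Finset.mem_Ioo]; constructor <;> linarith
  have hzero : diffCorr T j Ω (3 * M) 0 ≤ 3 * M * N := by
    rw [diffCorr_zero_eq T j hΩ0 (3 * M)]
    rw [hNdef]; push_cast
    rw [mul_comm]
    refine mul_le_mul_of_nonneg_right ?_ (by positivity)
    calc ∑ a ∈ range (3 * M), Ω a ≤ ∑ _a ∈ range (3 * M), (1 : ℝ) := Finset.sum_le_sum fun a _ => hΩ1 a
      _ = 3 * M := by simp
  have herase : ∑ ℓ ∈ (Ioo (-(L : ℤ)) L).erase 0, diffCorr T j Ω (3 * M) ℓ ≤ 2 * L * C := by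
    calc ∑ ℓ ∈ (Ioo (-(L : ℤ)) L).erase 0, diffCorr T j Ω (3 * M) ℓ ≤ ∑ _ℓ ∈ (Ioo (-(L : ℤ)) L).erase 0, C :=
          Finset.sum_le_sum hshift
      _ = (((Ioo (-(L : ℤ)) L).erase 0).card : ℝ) * C := by rw [Finset.sum_const, nsmul_eq_mul]
      _ ≤ 2 * L * C := by
          refine mul_le_mul_of_nonneg_right ?_ hC0
          have : ((Ioo (-(L : ℤ)) L).erase 0).card ≤ 2 * L := by
            refine (Finset.card_erase_le).trans ?_
            rw [Int.card_Ioo]; omega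
          exact_mod_cast this
  calc ∑ a ∈ dyBlock i, (longSum T β j a) ^ 2 ≤ ∑ a ∈ range (3 * M), Ω a * (longSum T β j a) ^ 2 := hS1
    _ ≤ (((2 : ℝ) ^ j + L) / L) * ∑ ℓ ∈ Ioo (-(L : ℤ)) L, diffCorr T j Ω (3 * M) ℓ := hS2
    _ ≤ (((2 : ℝ) ^ j + L) / L) * (3 * M * N + 2 * L * C) := by
        refine mul_le_mul_of_nonneg_left ?_ (by positivity)
        rw [hsplit]; exact add_le_add hzero herase
    _ = _ := by rw [hC, hMdef, hNdef, hLdef]; push_cast; ring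

end Assembly

end Literature.NumberTheory.LFunctions.MoebiusWalshResonance
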